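/-
Copyright: statement-level skeleton of a published paper (lit-balaban cell, Phase-2 proof seat p39 gen 25). No proof claims
beyond what the kernel checks below.
-/
import Literature.MathematicalPhysics.QuantumFieldTheory.Balaban1983to89.B3Eq122ChargeWick

/-!
# Bałaban, *(Higgs)₂,₃ quantum fields in a finite volume. III*, CMP 88 (1983) [Balaban1983Higgs3], p. 417: THE DEFINING
# EQUATIONS OF THE MASS COUNTERTERM `−δm²_{(α,β)} + Σ_{x∈T_ε}ε^dΣ^ε_{(α,β)}(x) = 0`, DERIVED AT WEIGHT `α + 2β = 2` FOR THE
# TWO-POINT FUNCTION (1.19) WITH THE COUNTERTERM INSERTED IN THE ACTION (1.20) — the letter `−δm²` of the bracket of (1.21) at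
# orders `e²` and `λ`, by dominated differentiation along the counterterm curve, and its dictionary to p26's typed (1.23)

statement-level skeleton of published theorems with citation tags; proofs where landed; nothing here is a claim about the
Yang–Mills mass gap.

[cite: Balaban1983Higgs3, (1.19)–(1.22) p.416 (PDF 6); (1.23) and the paragraph before it p.417 (PDF 7); (1.7) p.413 (PDF 3)].
Unit `lit-balaban-p39-g25` (Phase-2 proof seat p39, gen 25), free-target protocol G.5-34(d), ZERO head weight: OPTIONAL LOCATED
MEMBER of rows **B3.Eq1.23** and **B3.Eq1.19-1.22** of `HOME/lit-balaban-r15/ROWS-B3.md` (owner r15; heads `proved` on the lead's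
words Q19 / Q25 (P)); the successor brick this seat's gen 24 named («renormalized order e²»); TAKING HOME/STATUS
2026-08-23T20:41:05Z, owner r15 g17 20:41:37Z «WELCOME … no objection, no competing stem».  Sibling bricks (imported or cited
by name, nothing restated): BRICK 7 `B3Eq122ChargeWick` (this seat, gen 23: the order-`e²` terms ② + ④ of (1.22) and the
`Σ₁/Σ₂` companions at `δm² = 0` — IMPORTED: its joint weight `J`, two-point function `twoPt`, insertions `D1`/`D2`, majorant and
Wick lemmas are the engine here), BRICK 1 `B3Eq122FirstOrderWick` (gen 22: the order-`λ` term ① at `e = 0`, one-sided dominated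
differentiation `hasDerivWithinAt_gaussInt_exp_neg_of_le`), BRICK 8 `B3Eq122MassInsertionWick` (gen 24: the sector `e²δm²` with
`δm²` an INDEPENDENT variable — the mass-insertion identity `∂_{M²}C₀ = −C₀⋆C₀`; its `Gins = Σ_zη^dC₀(·,z)C₀(z,·)` is written out
here as the explicit sum, that module being unbuilt on the farm at filing time), p26's `B3Eq123Counterterms` ((1.22)/(1.23) typed:
`sig1`, `sig2`, `sig4`, `delta`, `ct1`, `ct2`, `ct4`, `dm2One`, `ct1_eq`, `ct2_eq`, `ct4_eq` — consumed BY NAME), r15's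
`B3Sect1TwoPoint` (`dm2Graph`, `dm2Coeff`, `dm2Of123`, `idx123` — the typed (1.23) bookkeeping) and `B3Sect3ScalarSelfEnergy`
(`kernelOp`, `d1Kernel`, `dKernel`).

PDF held: `paper:balaban1983-higgs-2-3-quantum-fields-finite-volume` (journal page = PDF page + 410); pp. 416–417 read first-hand
for this file on the ×2 renders `run/shared/lean/pub/pub-balaban/b2b-balaban-ref1/pages/1983-cmp88-higgs23-III/1983-cmp88-higgs23-
III-p006-x2.png`, `…-p007-x2.png` (2026-08-23T20:35Z).

THE PRINTED TEXT (verbatim).  P. 416: *"G^ε_{ab}(x,x′) = ⟨φ_a(x)φ_b(x′)⟩^ε = (Z^ε)^{−1}∫dA∫dφ e^{−S^ε(A,φ)}φ_a(x)φ_b(x′), x, x′ ∈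
T_ε, (1.19) where S^ε(A,φ) is the lattice action of the model given by S^ε(A,φ) = ½⟨φ,(−Δ^ε_A + m²)φ⟩ + Σ_{x∈T_ε}ε^d(λ∣φ(x)∣⁴ +
½δm²∣φ(x)∣²) + ½⟨A,(−Δ^ε + μ₀²)A⟩, (1.20) … The function G^ε has a perturbative expansion of the following structure G^ε =
Σ_{n=0}^∞ C₀^ε[(−δm² + Σ^ε + ∂^{ε*}Σ₁^ε + Σ₁^{ε*}∂^ε + ∂^{ε*}Σ₂^ε∂^ε)C₀^ε]ⁿ, (1.21) where C₀^ε = (−Δ₀^ε + m²)^{−1} and Σ^ε, Σ₁^ε, Σ₂^ε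
are given by amputated, one-particle-irreducible graphs of the expansion of G^ε. … the only vertices are (1.6), (1.7) [with δm²
instead of δm²_l(x)], (1.8), and (1.10) …"*.  P. 417: *"The mass renormalization counterterm δm² is chosen in such a way that
−δm² + Σ^ε is convergent. Of course this condition does not determine δm² uniquely, and usually it is defined as a solution of the
equation −δm² + Σ_{x∈T_ε}ε^dΣ^ε(x) = 0. This equation can be solved recursively if δm² and Σ^ε are expanded into power series in
e, λ. In our case δm² will be defined by the terms of order ≦ 4. More exactly we write δm² = Σ_{2≦α+2β≦4}e^αλ^βδm²_{(α,β)} and we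
insert this into Σ^ε. This gives us an expansion of Σ^ε in coupling constants and we take a sum of terms of order ≦ 4:
Σ_{2≦α+2β≦4}e^αλ^βΣ^ε_{(α,β)}. The counterterms δm²_{(α,β)} are defined by the equations −δm²_{(α,β)} + Σ_{x∈T_ε}ε^dΣ^ε_{(α,β)}(x) =
0. … For example the expressions in (1.22) define the following counterterms: δm² = −4(N+2)λC^ε_0(0) + e²dC^ε(0)q² + … −
e²Σ_{x′∈T_ε}ε^dΣ_{μ=1}^d q(∂^ε_μC^ε_0∂^{ε*}_μ)(x−x′)qC^ε(x−x′) + … (1.23) where δm²₁ denote a sum of terms δm²_{(α,β)} of the order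
α + 2β = 2. Thus we have determined the counterterm δm²."*

WHAT WAS IN THE TREE BEFORE.  (1.23) and its defining equations are TYPED (r15 `B3Sect1TwoPoint.dm2Coeff`/`dm2Of123`/`dm2Graph`,
p26 `B3Eq123Counterterms.ct1…ct7`/`dm2One`/`dm2_123`; p26's `solves_123`: the displayed counterterms solve the equations BY
DEFINITION of `dm2Graph`), for SUPPLIED self-energy kernels.  BRICKS 1 and 7 derived the self-energy letters `Σ^ε` (①; ② + ④) and
`Σ₁`, `Σ₂` of (1.21) from (1.19)/(1.20) at `δm² = 0`; BRICK 8 treated `δm²` as an independent variable.  NOT in the tree: the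
counterterm INSERTED in the action AS A POWER SERIES IN THE COUPLINGS — which is how print defines `Σ^ε_{(α,β)}` (*"we insert this
into Σ^ε"*) — and the defining equations read as RENORMALIZATION CONDITIONS ON THE DERIVED TWO-POINT FUNCTION.  This file does that
at the first step of print's recursion, weight `α + 2β = 2`, i.e. the orders `(α,β) = (2,0)` (`e²`) and `(0,1)` (`λ`) — p26's
`idx123_filter_le_two = {(2,0),(0,1)}`.

THE SETTING = BRICK 7's (its §0–§3): the model torus `T^{(j)}_η` of `B3WT223Instance` (print's `T_ε`, `η = ε`, volume element
`w = η^d`, `c = η⁻¹`), scalar fields `φ : T → ℝ^N`, the vector field in components `A : T → ℝ^d` with the Feynman-gauge Gaussian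
`W_A`, the charge `e` a VARIABLE (`Ce C e`, `U = exp(qηeA_b)`), the joint weight `J_e(M)(A,φ) = W_A(A)·e^{−½⟨φ,(−Δ^η_{A,e}+M)φ⟩}` at
scalar mass `M` (`B3Eq122ChargeWick.J C η w c M μ2 e`) and `G_{e,ab}(x,x′;M) = ∫J_e(M)φ_a(x)φ_b(x′)/∫J_e(M)` (`twoPt … M … e a b x x′`).
**THE COUNTERTERM IS A MASS SHIFT** (§1 `weight_mass_add`, `J_mass_add`): the term `Σ_xε^d·½δm²∣φ(x)∣²` of (1.20) makes the scalar
mass `m² + δm²`, `J_e(m²+t) = J_e(m²)·e^{−½tΣ_xη^d∣φ(x)∣²}` EXACTLY; so **(1.19) WITH THE COUNTERTERM `δm² = ct(e)` INSERTED is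
`e ↦ twoPt C η w c (m2 + ct e) μ2 e a b x x′`** (`λ = 0`), and at `e = 0` with `δm² = λδ₁` the `λ∣φ∣⁴` integrand of BRICK 1 at the
running mass `m² + λδ₁` (§10 `weight_mul_exp_massCurve`).  Hypotheses throughout: `η^d > 0`, `m² > 0`, `μ₀² > 0`; any level `j`,
mesh, dimension `d`, number of components `N`; the counterterm curve `ct : ℝ → ℝ` with `ct′ = ct'`, `ct″ = ct''` everywhere,
`ct''` continuous at `0`, `ct(0) = ct′(0) = 0` (print's truncated series `Σ_{2≤α≤4}e^αδm²_{(α,0)}` at `λ = 0` is such a curve, §11;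
the quadratic `δm²_{(2,0)}e²`, §8).

WHAT THIS FILE PROVES (theorems only; no definition, no named fact, no `sorry`; standard axioms).
* §1 `weight_mass_add`, `J_mass_add` — the factorization above.
* §2 THE INSERTIONS ALONG THE CURVE (pointwise derivatives, from BRICK 7's `hasDerivAt_weight`/`hasDerivAt_D1`):
  `hasDerivAt_J_massCurve`: `d/de J_e(m²+ct(e)) = [D₁(e) − ½ct′(e)Σ_xη^d∣φ(x)∣²]·J_e(m²+ct(e))` — BRICK 7's charge insertion `D₁`
  plus the derivative of the mass vertex (1.7); `hasDerivAt_D1_J_massCurve`: the second derivative, insertion `D₂ − ½ct″Σ∣φ∣² −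
  ct′Σ∣φ∣²D₁ + ¼ct′²(Σ∣φ∣²)²`.
* §3 BOUNDS on a ball `∣e∣ < r` where `∣ct∣ ≤ m²/2`, `∣ct′∣, ∣ct″∣ ≤ B`: `J_massCurve_le` (the weight along the curve is dominated
  by `W_A·e^{−(m²η^d/4)Σ∣φ∣²}`, BRICK 7's Gaussian majorant AT HALF THE MASS, uniformly in `e` and `A`), `abs_D1_massCurve_le`,
  `abs_D2_massCurve_le` (every monomial of the insertions has degree `≤ 2` in `sup∣A∣`, `≤ 4` in `sup∣φ∣`).
* §4 **DOMINATED DIFFERENTIATION UNDER `∫dA∫dφ` ALONG THE CURVE, TWICE** (`hasDerivAt_integral_J_massCurve`,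
  `hasDerivAt_integral_D1_J_massCurve`; Mathlib's `hasDerivAt_integral_of_dominated_loc_of_deriv_le` on the ball, majorant =
  BRICK 7's `integrable_majorant` at mass `m²/2`; every integrability is BRICK 7's at the positive running mass `m² + ct(e)`).
* §5 `exists_ball_bounds` (the ball from continuity), `hasDerivAt_twoPt_massCurve_of_ball` (`(G^{ct})′ = (N′Z − NZ′)/Z²` near
  `0`), `integral_D1_J_massCurve_zero` (the order-`e` term vanishes also with the counterterm: at `e = 0` the first insertion is
  BRICK 7's `D₁(0)`, one vector leg against the even Gaussian), `hasDerivAt_deriv_twoPt_massCurve_zero_of_ball` and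
  **`iteratedDeriv_two_twoPt_massCurve_raw`: `d²/de²∣₀G^{ct} = (N″(0)Z(0) − N(0)Z″(0))/Z(0)²` with `N″(0) = ∫[D₂(0) −
  ½ct″(0)Σ_xη^d∣φ(x)∣²]e^{−S_0}φ_aφ_b`** — BRICK 7's second insertion plus the mass vertex with coefficient `ct″(0)/2`.
* §6 WICK FOR THE MASS VERTEX AGAINST THE TWO LEGS (`cov_massForm_legs`, on BRICK 7's `integral_legs_cur` with the current
  `⟪φ(z),1·φ(z)⟫`: the vacuum loop `N·C₀(z,z)` cancels, connected part `2Σ_zη^dC₀(x′,z)C₀(z,x)δ_{ab}`; `cov_massForm_legs_J` on the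
  joint measure via BRICK 7's `J_zero`/Fubini) and the **MAIN THEOREM `iteratedDeriv_two_twoPt_massCurve`:
  `d²/de²∣₀G^{ct}_{ab}(x,x′) = d²/de²∣₀G_{ab}(x,x′) − ct″(0)·δ_{ab}·Σ_zη^dC₀(x′,z)C₀(z,x)`** — BRICK 7's order-`e²` coefficient PLUS
  the `n = 1` term `C₀(−δm²)C₀` of (1.21) with `δm²∣_{e²} = ct″(0)/2`: of the inserted series ONLY `δm²_{(2,0)}` ENTERS at this
  order (and it enters linearly: the second-order chain rule along the curve `M = m² + ct(e)`, `∂²_eG + ct″(0)·∂_MG`, DERIVED by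
  dominated differentiation — no joint smoothness in `(e, M)` is assumed; `∂_MG(0,M) = −C₀⋆C₀` is BRICK 8's
  `hasDerivAt_twoPt_zero_mass`).
* §7 **THE STRUCTURE (1.21) AT ORDER `e²` WITH ALL FIVE LETTERS** (`sum_G_delta_G`: the `−δm²` letter is p26's `delta` kernel
  between two free propagators; **`secondOrder_massCurve_eq_structure121`**: `(e²/2)d²/de²∣₀G^{ct}_{ab} = Σ_{y,y′}η^{2d}C₀(x,y)
  [−(ct″(0)/2)e²δ_{ab}·δ^ε + sig2 D + sig4 D](y,y′)C₀(y′,x′) + Σ_{y,y′,μ}η^{2d}[(∂_μC₀)Σ₁,μC₀ + C₀Σ₁,μ^T(∂_μC₀) + (∂_μC₀)Σ₂(∂_μC₀)]`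
  with BRICK 7's derived `Σ₁,μ = sgOne`, `Σ₂ = sgTwo`; **`secondOrder_massCurve_structure121_op`**: as operators in r15's
  `kernelOp`/`pdiff`/`pdiffAdj` vocabulary, `(e²/2)G^{ct}″(0)f = C₀[(−δm²∣_{e²})(C₀f) + Σ(C₀f) + Σ_μ(∂^{η*}_μΣ₁,μ + Σ₁,μ^*∂^η_μ +
  ∂^{η*}_μΣ₂∂^η_μ)(C₀f)]` — the `n = 1` term of (1.21) at order `e²λ⁰` with the letters `−δm²`, `Σ^ε`, `∂^{ε*}Σ₁^ε`, `Σ₁^{ε*}∂^ε`,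
  `∂^{ε*}Σ₂^ε∂^ε` ALL DERIVED from (1.19)/(1.20) (`kernelOp_G_const_G`: `C₀(−δm²)C₀` as an operator).
* §8 print's quadratic counterterm `δm² = δm²_{(2,0)}e²`: `iteratedDeriv_two_twoPt_quadraticCounterterm` (the main theorem with
  `ct″(0) = 2δm²_{(2,0)}`).
* §9 **PRINT'S EQUATIONS FOR THE DERIVED WEIGHT-2 SELF-ENERGIES** (`rowsum_add_delta`: the row sum `Σ_{x′}ε^d[K + rδ^ε](x,x′)` =
  r15's `dm2Graph ε^d K x + r`): **`condition_20_iff`** — the row sums of the derived order-`e²` mass-type kernel `−r·δ^ε + sig2 D +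
  sig4 D` (`r = δm²∣_{e²}δ_{ab}`) vanish, i.e. «−δm²_{(2,0)} + Σ_{x′}ε^dΣ^ε_{(2,0)}(x−x′) = 0», IF AND ONLY IF `r = ct2 D + ct4 D`,
  p26's typed (1.23) terms ② + ④; `condition_20_iff_explicit`: iff `r = e²dC^ε(y,y)q² − e²Σ_{x′}ε^dΣ_μq²(∂^ε_μC^ε_0∂^{ε*}_μ)(y,x′)
  C^ε(y,x′)` (p26's `ct2_eq`/`ct4_eq`) — the derived (2,0)-equation FIXES `δm²_{(2,0)}` as this function of the lattice data;
  **`condition_01_iff`**/`_explicit`: the same at `(0,1)` with `sig1 D`/`ct1 D = −4(N+2)λC^ε_0(y,y)`; **`dm2One_eq_of_conditions`**: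
  if both weight-2 equations hold for the inserted `r₁ = λδm²_{(0,1)}`, `r₂ = e²δm²_{(2,0)}` then `r₁ + r₂ = dm2One D` — print's
  *"δm²₁ … a sum of terms δm²_{(α,β)} of the order α + 2β = 2"* RECOVERED AS THE SOLUTION; `conditions_at_dm2One`: conversely
  p26's `ct1`, `ct2 + ct4` solve them (*"This equation can be solved recursively"*, the weight-2 step).
* §10 **THE `λ`-DIRECTION `(0,1)` AT `e = 0`** (`neg_le_V_massCurve`: the shifted interaction `Σ_yη^d(∣φ∣⁴ + ½δ₁∣φ∣²)` is bounded
  below; **`hasDerivWithinAt_twoPointPhi4_massCurve`**: BRICK 1's `λ∣φ∣⁴` two-point function with the counterterm `λδ₁` inserted is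
  right-differentiable at `λ = 0⁺` with derivative `−δ_{ab}[4(N+2)Σ_yη^dC₀(y,y)C₀(x,y)C₀(x′,y) + δ₁Σ_zη^dC₀(x′,z)C₀(z,x)]` — the
  tadpole ① plus `C₀(−δm²_{(0,1)})C₀`; `derivWithin_massCurve_eq_C0_sig1_delta_C0`: `= C₀[sig1 D − λδ₁·δ^ε]C₀` per `δ_{ab}`, the
  bracket `(−δm² + Σ^ε)` of (1.21) at order `λ`).
* §11 **PRINT'S TRUNCATED SERIES** (`dm2Of123_lam_zero`: r15's `dm2Of123 e 0 ε^d Σ^ε_{(·,·)}` = `δm²_{(2,0)}e² + δm²_{(3,0)}e³ +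
  δm²_{(4,0)}e⁴`; **`iteratedDeriv_two_twoPt_dm2Of123`**: with that series inserted — any supplied coefficients — the order-`e²`
  coefficient of (1.19) is BRICK 7's minus `2δm²_{(2,0)}·δ_{ab}·Σ_zη^dC₀(x′,z)C₀(z,x)`, `δm²_{(2,0)} = dm2Coeff ε^d Σ^ε 2 0`: only the
  weight-2 counterterm enters at weight 2, as print's recursion requires).

* §12 **THE ZERO-MOMENTUM READING** (`sform_const_right`, `Ks_mulVec_one`: `(−Δ^η+M²)𝟙 = M²𝟙`; **`sum_G_row`**: the free
  propagator has constant row sums `Σ_{x′}η^dC₀(x,x′) = 1/m²`; `rowsum_G_K_G`; **`rowsum_zero_iff_sandwich`**: for any kernel `K`,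
  print's equation «row sums of `K` vanish» ⟺ the `n = 1` term `C₀KC₀` of (1.21) annihilates the constants — the renormalized
  weight-2 mass-type insertion of `G^ε` vanishes at zero lattice momentum; `C₀` is invertible).
* §13 (v1.1) **WEIGHT 3: THE ODD ORDERS IN `e` VANISH BY THE REFLECTION `A ↦ −A`** (`weight_Ce_neg`: `U_{−e}(A_b) =
  U_e((−A)_b)`, so the scalar weight at charge `−e` is the weight at charge `e` along `−A`; `WA_neg`: the vector-field Gaussian of
  (1.20) is even; `J_neg_charge`: `e^{−S^ε_{−e}(A,φ)} = e^{−S^ε_e(−A,φ)}`; `integral_J_neg_charge`: `A ↦ −A` preserves `dA dφ`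
  (sitewise `−1 ∈ O(d)`), hence **`twoPt_neg_charge`: (1.19) is EVEN in the charge** at every scalar mass;
  **`iteratedDeriv_odd_twoPt_massCurve`**: with any `e`-even counterterm inserted ALL odd `e`-derivatives of (1.19) vanish at `e = 0`;
  **`iteratedDeriv_three_twoPt_dm2Of123`**: print's index `(3,0)` — with r15's series inserted and `δm²_{(3,0)} = 0` the order-`e³`
  coefficient of the FULL two-point function (1.19) vanishes, so print's equation «`−δm²_{(3,0)} + Σ_xε^dΣ^ε_{(3,0)}(x) = 0`» is
  consistent with `δm²_{(3,0)} = 0`; `twoPtJoint_neg_charge` and **`iteratedDeriv_odd_twoPtJoint_massCurve`**: print's index `(1,1)` —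
  the joint family with `λΣ_yη^d∣φ(y)∣⁴` and an `e`-even `ct(e,λ)` is even in `e` at every `λ`, so every odd `e`-derivative at `0`
  vanishes at every `λ` AND so does every odd `e`-derivative of the right `λ`-derivative at `λ = 0⁺`: the `e¹λ¹` coefficient of (1.19) is
  zero in both orders of differentiation, consistent with `δm²_{(1,1)} = 0` and with (1.23) displaying no `e³` and no `eλ` term.  The
  1PI letters `Σ^ε_{(3,0)}`, `Σ^ε_{(1,1)}` of (1.21) are NOT extracted here: at weight `3` the bracket of (1.21) is not decomposed into
  its letters in this file — referee D-g79-2.)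
* §14 (v1.2) **THE INDEX `(1,1)` NON-VACUOUSLY** (`expGrowth_exp_neg_V`: `e^{−λV} ≤ 1` is an admissible observable;
  `integral_J_mul_pos`; **`hasDerivAt_twoPtJoint_massCurve_of_ball`**: the joint family is differentiable in `e` on the ball at every
  `λ ≥ 0` — §4's dominated differentiation with `e^{−λV}` in the observable; **`hasDerivAt_twoPtJoint_massCurve_zero`**: at `e = 0` its
  `e`-derivative EXISTS and is `0` for an even `C¹` counterterm with positive running mass `m² + ct(0,λ)`;
  **`hasDerivWithinAt_deriv_twoPtJoint_massCurve`**: `λ ↦ ∂_e∣₀G^{ct}(·,λ) ≡ 0` has right-derivative `0` at `λ = 0⁺` — the `e¹λ¹`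
  coefficient in the order «`e` first» exists and vanishes; `twoPtJoint_zero_charge`: at `e = 0` the vector field integrates out and
  the joint family with `λδm²_{(0,1)}` IS §10's family.)
* §15 (v1.3) **THE ORDER «`λ` FIRST», NON-VACUOUSLY** (**`hasDerivWithinAt_integral_J_exp_neg`**/`_of_le`: ONE-SIDED
  differentiation in `λ` under the JOINT integral `∫dA dφ e^{−S^ε_e}e^{−λV}F` at every charge `e` — BRICK 1's dominated convergence
  with the joint weight; `J_affine_mul_exp`; **`hasDerivWithinAt_twoPtJoint_affine`**: for a counterterm affine in `λ` the joint family
  has the first-order right `λ`-derivative `(N′Z − NZ′)/Z²` at `λ = 0⁺` AT EVERY CHARGE (perturbation theory in `λ` at charge `e`);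
  **`hasDerivAt_derivWithin_twoPtJoint_affine`**: for `δm²(e,λ) = c₀(e) + λc₁(e)` with `c₀`, `c₁` even, `e ↦ ∂_λ∣_{0⁺}G^{ct}_{e,λ}` is
  differentiable at `e = 0` (§4 on its six integrals) with derivative `0` (§13) — the `λ¹e¹` coefficient in the order «`λ` first»
  exists and vanishes; **`hasDerivAt_derivWithin_twoPtJoint_dm2Of123`**: the same for r15's series with
  `δm²_{(3,0)} = δm²_{(1,1)} = δm²_{(0,2)} = 0`.)

COVERAGE IN PRINT'S INDICES `(α,β)`, `2 ≤ α + 2β ≤ 4`.  DERIVED here: the equations at `(2,0)` (§6–§9, the full structure (1.21) at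
order `e²` including `−δm²`) and at `(0,1)` (§9–§10, at `e = 0`, one-sided in `λ`); at weight `3`, `(3,0)` and `(1,1)` (§13, v1.1:
the order-`e³` and `e¹λ¹` coefficients of the full two-point function (1.19) vanish by the reflection `A ↦ −A` for any `e`-even
inserted counterterm, consistent with `δm²_{(3,0)} = δm²_{(1,1)} = 0` — the 1PI letters `Σ^ε_{(3,0)}`, `Σ^ε_{(1,1)}` themselves are not
extracted; the symmetry statement is in Mathlib's total `deriv`; §14 adds the existence of the first `e`-derivative near `e = 0` at every `λ ≥ 0` and of the `λ`-right-derivative of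
`λ ↦ ∂_eG^{ct}(0,λ) ≡ 0`; §15 the right `λ`-derivative at `λ = 0⁺` at every charge and the `e`-derivative at `0` of
`e ↦ ∂_λ∣_{0⁺}G^{ct}_{e,λ}` for counterterms affine in `λ` — so the `(1,1)` coefficient exists and vanishes in BOTH orders; higher odd
`e`-derivatives at `λ > 0` are not constructed).  NOT treated: `(4,0)` (terms ③ ⑤ and `⑦`
with `δm²₁`: order `e⁴`, needs four charge derivatives), `(2,1)`, `(0,2)` (weight `4`, mixed and `λ²`; the joint `(e,λ)`-Taylor
statement would need joint smoothness).  So this file is the FIRST step of print's recursion *"solved recursively"* plus the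
vanishing of the weight-`3` step; the weight-`4` step stays typed (p26's `recursion_order_four`, `solves_123`).

HONEST SCOPE.  (i) Scalar `δm²` as printed in (1.20) (*"internal indices … understood"*): the derived `(2,0)` kernel carries the
matrix element `(q²)_{ab}` (p26's scalar `q2`) while the counterterm carries `δ_{ab}`; `condition_20_iff` is stated for a scalar `r`
standing for `δm²∣_{e²}·δ_{ab}` — for the models in view `q² = −κ²·1`, so at `a ≠ b` both sides vanish and at `a = b` it is the
printed equation; no claim for a general antisymmetric `q` with non-scalar `q²`.  (ii) Orders: `e²` at `λ = 0` (two-sided second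
derivative at `e = 0`) and `λ¹` at `e = 0` (right-derivative at `λ = 0⁺`, BRICK 1's one-sided convention — the quartic weight is not
integrable for `λ < 0`); weight `3` by the reflection symmetry only (§13); nothing at weight `4`; the joint `(e,λ)` family
enters through its `e`-parity and its first derivatives (§14–§15).  (iii) As BRICK 7: Feynman gauge as the definition of
the `A`-integral, `cη = 1` in the dictionary theorems, finite torus, `Σ₁,μ`/`Σ₂` = what the Feynman rules give at order `e²`; no
1PI/all-orders claim, no `ε → 0` or «convergent» claim (print's *"−δm² + Σ^ε is convergent"* is the CONTINUUM statement proved in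
§§2–3 of the paper / Prop. 1, not here), translation invariance of the kernels is not used (every statement is per base point `y`; §12 converts row sums into the action on constants).  (iv) The
counterterm curve is any `C²`-near-`0` function with `ct(0) = ct′(0) = 0` (hypotheses `HasDerivAt` everywhere for `ct`, `ct′` and
continuity of `ct″` at `0` — harmless for print's polynomials); BRICK 8's `Gins`/`hasDerivAt_twoPt_zero_mass` are cited, not
imported (module unbuilt on the farm at filing; the sum `Σ_zη^dC₀(x′,z)C₀(z,x)` is written out).  Mathlib + the cited tree files only.

References: [Balaban1983Higgs3] T. Bałaban, CMP 88 (1983) 411–445, (1.7) p. 413, (1.19)–(1.22) p. 416, (1.23) p. 417;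
[Balaban1982Higgs1] T. Bałaban, CMP 85 (1982) 603–626, (1.7)–(1.11) pp. 604–605 (the lattice action, Feynman gauge);
[GlimmJaffeQP1987] J. Glimm, A. Jaffe, *Quantum Physics* (2nd ed., Springer 1987), §8.2–8.5, §9.1 (Gaussian integration by parts /
Wick's theorem / perturbation series; mass renormalization in perturbation theory).
-/

noncomputable section

open scoped BigOperators InnerProductSpace Topology

namespace Literature.MathematicalPhysics.QuantumFieldTheory.Balaban1983to89.B3Eq123RenormalizationConditions

open _root_.MeasureTheory _root_.Filter
open LatticeFieldCalculus B3WT223Instance B3WTPropagator B3WTCovariance B3WickVertexCalculus B3Eq122ChargeWick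
  B3Eq123Counterterms B3Sect3ScalarSelfEnergy

variable {P : Params} {j N : ℕ} (C : HiggsLattice.ChargeData N) (η w c m2 μ2 : ℝ)

/-! ## §1 The counterterm is a mass shift: `e^{−S^ε}` with `δm²` is BRICK 7's joint weight at scalar mass `m² + δm²` -/

omit C in
/-- **`e^{−½⟨φ,(−Δ^η_A+(M+t))φ⟩} = e^{−½⟨φ,(−Δ^η_A+M)φ⟩}·e^{−½tΣ_xη^d∣φ(x)∣²}`** — the counterterm `Σ_xε^d·½δm²∣φ(x)∣²` of
(1.20) factors off the Gaussian weight (the mass term is `M²·massForm`). [cite: Balaban1983Higgs3, (1.20) p.416] -/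
theorem weight_mass_add (C' : HiggsLattice.ChargeData N) (M t : ℝ) (A : VecField P j ℝ) (φ : Cfg P j N) :
    weight C' η w c (M + t) A φ = weight C' η w c M A φ * Real.exp (-(1 / 2 : ℝ) * t * massForm w φ) := by
  unfold weight quadForm
  rw [← Real.exp_add]
  congr 1
  ring

/-- **THE INTEGRAND OF (1.19) WITH THE COUNTERTERM `δm² = t`** (`λ = 0`): BRICK 7's joint weight at scalar mass `m² + t` is
`J_e(m²)·e^{−½tΣ_xη^d∣φ(x)∣²}`. [cite: Balaban1983Higgs3, (1.19)–(1.20) p.416] -/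
theorem J_mass_add (t e : ℝ) (p : JCfg P j N) :
    J C η w c (m2 + t) μ2 e p = J C η w c m2 μ2 e p * Real.exp (-(1 / 2 : ℝ) * t * massForm w p.2) := by
  unfold J
  rw [weight_mass_add]
  ring

/-! ## §2 The counterterm INSERTED AS A POWER SERIES IN THE CHARGE: the weight along a mass curve `m² + δm²(e)` and its
`e`-derivatives (the insertions `D₁ − ½δm²′·Σ∣φ∣²`, `D₂ − ½δm²″·Σ∣φ∣² − δm²′·Σ∣φ∣²·D₁ + ¼(δm²′)²(Σ∣φ∣²)²`) -/

/-- **`d/de e^{−S^ε_e}` ALONG THE COUNTERTERM CURVE**: for a counterterm `δm²(e) = ct e` with `ct′ = ct'`,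
`d/de J_e(m²+ct(e)) = [D₁(e) − ½ct′(e)Σ_xη^d∣φ(x)∣²]·J_e(m²+ct(e))` — BRICK 7's charge insertion `D₁` plus the derivative of the
mass vertex (1.7). [cite: Balaban1983Higgs3, (1.19)–(1.20) p.416, p.417 («we insert this into Σ^ε»)] -/
theorem hasDerivAt_J_massCurve {ct ct' : ℝ → ℝ} {e : ℝ} (hd : HasDerivAt ct (ct' e) e) (p : JCfg P j N) :
    HasDerivAt (fun s : ℝ => J C η w c (m2 + ct s) μ2 s p)
      ((D1 C η w c e (toVec p.1) p.2 - 1 / 2 * ct' e * massForm w p.2) * J C η w c (m2 + ct e) μ2 e p) e := by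
  have hfun : (fun s : ℝ => J C η w c (m2 + ct s) μ2 s p) =
      fun s => WA η w c μ2 p.1 * weight (Ce C s) η w c m2 (toVec p.1) p.2 *
        Real.exp (-(1 / 2 : ℝ) * ct s * massForm w p.2) := by
    funext s
    rw [J_mass_add]
    rfl
  rw [hfun]
  have hW := (hasDerivAt_weight C η w c m2 (toVec p.1) p.2 e).const_mul (WA η w c μ2 p.1)
  have hE : HasDerivAt (fun s : ℝ => Real.exp (-(1 / 2 : ℝ) * ct s * massForm w p.2))
      (Real.exp (-(1 / 2 : ℝ) * ct e * massForm w p.2) * (-(1 / 2 : ℝ) * ct' e * massForm w p.2)) e :=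
    ((hd.const_mul (-(1 / 2 : ℝ))).mul_const (massForm w p.2)).exp
  have h := hW.mul hE
  refine h.congr_deriv ?_
  rw [J_mass_add]
  simp only [J]
  ring

/-- **THE SECOND DERIVATIVE ALONG THE CURVE**: with `ct″ = ct''`,
`d/de([D₁(e) − ½ct′Σ∣φ∣²]·J_e(m²+ct(e))) = [D₂(e) − ½ct″Σ∣φ∣² − ct′Σ∣φ∣²·D₁(e) + ¼ct′²(Σ∣φ∣²)²]·J_e(m²+ct(e))`.
[cite: Balaban1983Higgs3, (1.19)–(1.20) p.416, p.417] -/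
theorem hasDerivAt_D1_J_massCurve {ct ct' ct'' : ℝ → ℝ} {e : ℝ} (hd : HasDerivAt ct (ct' e) e)
    (hd' : HasDerivAt ct' (ct'' e) e) (p : JCfg P j N) :
    HasDerivAt (fun s : ℝ => (D1 C η w c s (toVec p.1) p.2 - 1 / 2 * ct' s * massForm w p.2) * J C η w c (m2 + ct s) μ2 s p)
      ((D2 C η w c e (toVec p.1) p.2 - 1 / 2 * ct'' e * massForm w p.2
          - ct' e * massForm w p.2 * D1 C η w c e (toVec p.1) p.2 + 1 / 4 * ct' e ^ 2 * massForm w p.2 ^ 2) *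
        J C η w c (m2 + ct e) μ2 e p) e := by
  have hD : HasDerivAt (fun s : ℝ => D1 C η w c s (toVec p.1) p.2 - 1 / 2 * ct' s * massForm w p.2)
      ((∑ b : PBond P j, w * (c ^ 2 * ((η * toVec p.1 b) ^ 2 *
          ⟪p.2 b.src, C.q (C.q ((Ce C e).U η (toVec p.1 b) (p.2 b.tgt)))⟫_ℝ)))
        - 1 / 2 * ct'' e * massForm w p.2) e :=
    (hasDerivAt_D1 C η w c (toVec p.1) p.2 e).sub ((hd'.const_mul (1 / 2 : ℝ)).mul_const (massForm w p.2))
  have h : HasDerivAt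
      (fun s : ℝ => (D1 C η w c s (toVec p.1) p.2 - 1 / 2 * ct' s * massForm w p.2) * J C η w c (m2 + ct s) μ2 s p)
      (((∑ b : PBond P j, w * (c ^ 2 * ((η * toVec p.1 b) ^ 2 *
          ⟪p.2 b.src, C.q (C.q ((Ce C e).U η (toVec p.1 b) (p.2 b.tgt)))⟫_ℝ)))
        - 1 / 2 * ct'' e * massForm w p.2) * J C η w c (m2 + ct e) μ2 e p
        + (D1 C η w c e (toVec p.1) p.2 - 1 / 2 * ct' e * massForm w p.2) *
          ((D1 C η w c e (toVec p.1) p.2 - 1 / 2 * ct' e * massForm w p.2) * J C η w c (m2 + ct e) μ2 e p)) e :=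
    hD.mul (hasDerivAt_J_massCurve C η w c m2 μ2 hd p)
  refine h.congr_deriv ?_
  simp only [D2]
  ring

/-! ## §3 Bounds: along the curve the weight is dominated by BRICK 7's majorant at half the mass -/

omit C η w c m2 μ2 in
/-- `|A_b| ≤ sup|A|`. [folklore] -/
private theorem abs_toVec_le (A : Cfg P j P.d) (b : PBond P j) : |toVec A b| ≤ ‖A‖ := by
  rw [toVec_apply]
  calc |⟪A b.src, EuclideanSpace.basisFun (Fin P.d) ℝ b.dir⟫_ℝ|
      ≤ ‖A b.src‖ * ‖EuclideanSpace.basisFun (Fin P.d) ℝ b.dir‖ := abs_real_inner_le_norm _ _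
    _ = ‖A b.src‖ := by rw [(EuclideanSpace.basisFun (Fin P.d) ℝ).orthonormal.1, mul_one]
    _ ≤ ‖A‖ := norm_le_pi_norm A b.src

omit C η w c m2 μ2 in
/-- `t^n ≤ e^{n t}` for `t ≥ 0`. [folklore] -/
private theorem pow_le_exp_mul {t : ℝ} (ht : 0 ≤ t) (n : ℕ) : t ^ n ≤ Real.exp (n * t) := by
  have h1 : t ≤ Real.exp t := by linarith [Real.add_one_le_exp t]
  calc t ^ n ≤ Real.exp t ^ n := pow_le_pow_left₀ ht h1 n
    _ = Real.exp (n * t) := by rw [← Real.exp_nat_mul]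

omit C η w c m2 μ2 in
/-- `X^a Y^b ≤ e^{2X}e^{4Y}` for `X, Y ≥ 0`, `a ≤ 2`, `b ≤ 4` (the monomials of the insertions). [folklore] -/
private theorem monomial_le_exp {X Y : ℝ} (hX : 0 ≤ X) (hY : 0 ≤ Y) {a b : ℕ} (ha : a ≤ 2) (hb : b ≤ 4) :
    X ^ a * Y ^ b ≤ Real.exp (2 * X) * Real.exp (4 * Y) := by
  have hXa : X ^ a ≤ Real.exp (2 * X) := by
    rcases Nat.lt_or_ge 0 a with ha0 | ha0
    · calc X ^ a ≤ Real.exp (a * X) := pow_le_exp_mul hX a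
        _ ≤ Real.exp (2 * X) := Real.exp_le_exp.mpr (by
            have : (a : ℝ) ≤ 2 := by exact_mod_cast ha
            nlinarith)
    · have : a = 0 := by omega
      subst this
      simpa using Real.one_le_exp (by positivity : (0:ℝ) ≤ 2 * X)
  have hYb : Y ^ b ≤ Real.exp (4 * Y) := by
    rcases Nat.lt_or_ge 0 b with hb0 | hb0
    · calc Y ^ b ≤ Real.exp (b * Y) := pow_le_exp_mul hY b
        _ ≤ Real.exp (4 * Y) := Real.exp_le_exp.mpr (by
            have : (b : ℝ) ≤ 4 := by exact_mod_cast hb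
            nlinarith)
    · have : b = 0 := by omega
      subst this
      simpa using Real.one_le_exp (by positivity : (0:ℝ) ≤ 4 * Y)
  exact mul_le_mul hXa hYb (pow_nonneg hY _) (Real.exp_pos _).le

omit C η c m2 μ2 in
/-- `Σ_xη^d∣φ(x)∣² ≤ η^d·∣T∣·sup∣φ∣²` (the mass term of (1.20) against the sup norm). [cite: Balaban1983Higgs3, (1.20) p.416] -/
theorem massForm_le (hw : 0 ≤ w) (φ : Cfg P j N) :
    massForm w φ ≤ w * Fintype.card (Site P j) * ‖φ‖ ^ 2 := by
  unfold massForm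
  calc ∑ x : Site P j, w * ‖φ x‖ ^ 2 ≤ ∑ _x : Site P j, w * ‖φ‖ ^ 2 :=
        Finset.sum_le_sum fun x _ => mul_le_mul_of_nonneg_left
          (pow_le_pow_left₀ (norm_nonneg _) (norm_le_pi_norm φ x) 2) hw
    _ = w * Fintype.card (Site P j) * ‖φ‖ ^ 2 := by
        rw [Finset.sum_const, Finset.card_univ, nsmul_eq_mul]; ring

omit C η c m2 μ2 in
/-- the mass term `Σ_xη^d∣φ(x)∣²` of (1.20) is an observable of exponential-linear growth (integrable against the Gaussian with
its polynomial companions). [cite: Balaban1983Higgs3, (1.20) p.416] -/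
theorem expGrowth_massForm : ExpGrowth (fun φ : Cfg P j N => massForm w φ) := by
  unfold massForm
  exact ExpGrowth.sum _ fun x _ => (ExpGrowth.norm_sq_apply x).const_mul w

omit C μ2 in
/-- `K₁ ≥ 0`. [folklore] -/
private theorem K1_nonneg' : 0 ≤ K1 P j η w c := by unfold K1; exact Finset.sum_nonneg fun _ _ => by positivity

omit C μ2 in
/-- `K₂ ≥ 0`. [folklore] -/
private theorem K2_nonneg' : 0 ≤ K2 P j η w c := by unfold K2; exact Finset.sum_nonneg fun _ _ => by positivity

/-- **ALONG THE CURVE THE SCALAR WEIGHT IS DOMINATED BY THE FREE GAUSSIAN OF HALF THE MASS**: if `∣ct(e)∣ ≤ m²/2` then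
`J_e(m²+ct(e))(A,φ) ≤ W_A(A)·e^{−(m²η^d/4)Σ_x∣φ(x)∣²}` (uniformly in `e` and `A`: `∣U∣ = 1`). [cite: Balaban1983Higgs3, (1.20) p.416] -/
theorem J_massCurve_le (hw : 0 ≤ w) {t : ℝ} (ht : |t| ≤ m2 / 2) (e : ℝ) (p : JCfg P j N) :
    J C η w c (m2 + t) μ2 e p ≤ WA η w c μ2 p.1 * Real.exp (-(m2 / 2 * w / 2) * ∑ x : Site P j, ‖p.2 x‖ ^ 2) := by
  unfold J
  refine mul_le_mul_of_nonneg_left ?_ (WA_pos η w c μ2 p.1).le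
  refine (weight_Ce_le C η w c (m2 + t) hw e _ _).trans (Real.exp_le_exp.mpr ?_)
  have hs : 0 ≤ w * ∑ x : Site P j, ‖p.2 x‖ ^ 2 := mul_nonneg hw (Finset.sum_nonneg fun _ _ => sq_nonneg _)
  have hm : m2 / 2 ≤ m2 + t := by have := neg_abs_le t; linarith
  nlinarith

/-- **THE BOUND OF THE FIRST INSERTION** on the curve (`∣ct′∣ ≤ B`):
`∣D₁(e) − ½ct′(e)Σ∣φ∣²∣ ≤ (K₁ + ½Bη^d∣T∣)·e^{2sup∣A∣}e^{2sup∣φ∣}`. [cite: Balaban1983Higgs3, (1.19)–(1.20) p.416] -/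
theorem abs_D1_massCurve_le (hw : 0 ≤ w) {B s : ℝ} (hs : |s| ≤ B) (e : ℝ) (p : JCfg P j N) :
    |D1 C η w c e (toVec p.1) p.2 - 1 / 2 * s * massForm w p.2| ≤
      (K1 P j η w c + 1 / 2 * B * (w * Fintype.card (Site P j))) * (Real.exp (2 * ‖p.1‖) * Real.exp (4 * ‖p.2‖)) := by
  have hD := abs_D1_le C η w c e (toVec p.1) p.2 (a := ‖p.1‖) (abs_toVec_le p.1)
  have hK1 := K1_nonneg' (P := P) (j := j) η w c
  have hB : 0 ≤ B := (abs_nonneg s).trans hs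
  have hmF := massForm_le (P := P) (j := j) (N := N) w hw p.2
  have hmF0 := massForm_nonneg (P := P) (j := j) (N := N) (w := w) hw p.2
  have h12 : ‖p.1‖ * ‖p.2‖ ^ 2 ≤ Real.exp (2 * ‖p.1‖) * Real.exp (4 * ‖p.2‖) := by
    simpa using monomial_le_exp (norm_nonneg p.1) (norm_nonneg p.2) (a := 1) (b := 2) (by norm_num) (by norm_num)
  have h02 : ‖p.2‖ ^ 2 ≤ Real.exp (2 * ‖p.1‖) * Real.exp (4 * ‖p.2‖) := by
    simpa using monomial_le_exp (norm_nonneg p.1) (norm_nonneg p.2) (a := 0) (b := 2) (by norm_num) (by norm_num)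
  calc |D1 C η w c e (toVec p.1) p.2 - 1 / 2 * s * massForm w p.2|
      ≤ |D1 C η w c e (toVec p.1) p.2| + |1 / 2 * s * massForm w p.2| := abs_sub _ _
    _ ≤ K1 P j η w c * (‖p.1‖ * ‖p.2‖ ^ 2) + 1 / 2 * B * (w * Fintype.card (Site P j) * ‖p.2‖ ^ 2) := by
        refine add_le_add hD ?_
        rw [abs_mul, abs_mul, abs_of_nonneg hmF0, abs_of_pos (by norm_num : (0:ℝ) < 1 / 2)]
        exact mul_le_mul (mul_le_mul_of_nonneg_left hs (by norm_num)) hmF hmF0 (by positivity)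
    _ ≤ K1 P j η w c * (Real.exp (2 * ‖p.1‖) * Real.exp (4 * ‖p.2‖))
        + 1 / 2 * B * (w * Fintype.card (Site P j) * (Real.exp (2 * ‖p.1‖) * Real.exp (4 * ‖p.2‖))) := by
        gcongr
    _ = (K1 P j η w c + 1 / 2 * B * (w * Fintype.card (Site P j))) * (Real.exp (2 * ‖p.1‖) * Real.exp (4 * ‖p.2‖)) := by
        ring

/-- **THE BOUND OF THE SECOND INSERTION** on the curve (`∣ct′∣, ∣ct″∣ ≤ B`): every monomial has degree `≤ 2` in `sup∣A∣` and
`≤ 4` in `sup∣φ∣`, so `∣D₂ − ½ct″Σ∣φ∣² − ct′Σ∣φ∣²D₁ + ¼ct′²(Σ∣φ∣²)²∣ ≤ K·e^{2sup∣A∣}e^{4sup∣φ∣}`.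
[cite: Balaban1983Higgs3, (1.19)–(1.20) p.416] -/
theorem abs_D2_massCurve_le (hw : 0 ≤ w) {B s s' : ℝ} (hs : |s| ≤ B) (hs' : |s'| ≤ B) (e : ℝ) (p : JCfg P j N) :
    |D2 C η w c e (toVec p.1) p.2 - 1 / 2 * s' * massForm w p.2
        - s * massForm w p.2 * D1 C η w c e (toVec p.1) p.2 + 1 / 4 * s ^ 2 * massForm w p.2 ^ 2| ≤
      (K2 P j η w c + K1 P j η w c ^ 2 + 1 / 2 * B * (w * Fintype.card (Site P j))
          + B * (w * Fintype.card (Site P j)) * K1 P j η w c + 1 / 4 * B ^ 2 * (w * Fintype.card (Site P j)) ^ 2) *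
        (Real.exp (2 * ‖p.1‖) * Real.exp (4 * ‖p.2‖)) := by
  set X : ℝ := ‖p.1‖ with hX
  set Y : ℝ := ‖p.2‖ with hY
  set E : ℝ := Real.exp (2 * X) * Real.exp (4 * Y) with hE
  set V : ℝ := w * Fintype.card (Site P j) with hV
  have hX0 : 0 ≤ X := norm_nonneg _
  have hY0 : 0 ≤ Y := norm_nonneg _
  have hV0 : 0 ≤ V := by positivity
  have hK1 := K1_nonneg' (P := P) (j := j) η w c
  have hK2 := K2_nonneg' (P := P) (j := j) η w c
  have hB : 0 ≤ B := (abs_nonneg s).trans hs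
  have hmF := massForm_le (P := P) (j := j) (N := N) w hw p.2
  have hmF0 := massForm_nonneg (P := P) (j := j) (N := N) (w := w) hw p.2
  have hD1 := abs_D1_le C η w c e (toVec p.1) p.2 (a := X) (abs_toVec_le p.1)
  have hD2 := abs_D2_le C η w c e (toVec p.1) p.2 (a := X) (abs_toVec_le p.1)
  have m22 : X ^ 2 * Y ^ 2 ≤ E := monomial_le_exp hX0 hY0 (by norm_num) (by norm_num)
  have m24 : X ^ 2 * Y ^ 4 ≤ E := monomial_le_exp hX0 hY0 (by norm_num) (by norm_num)
  have m02 : Y ^ 2 ≤ E := by simpa using monomial_le_exp hX0 hY0 (a := 0) (b := 2) (by norm_num) (by norm_num)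
  have m14 : X * Y ^ 4 ≤ E := by simpa using monomial_le_exp hX0 hY0 (a := 1) (b := 4) (by norm_num) (by norm_num)
  have m04 : Y ^ 4 ≤ E := by simpa using monomial_le_exp hX0 hY0 (a := 0) (b := 4) (by norm_num) (by norm_num)
  -- the four pieces
  have h1 : |D2 C η w c e (toVec p.1) p.2| ≤ (K2 P j η w c + K1 P j η w c ^ 2) * E := by
    calc |D2 C η w c e (toVec p.1) p.2| ≤ K2 P j η w c * (X ^ 2 * Y ^ 2) + (K1 P j η w c * (X * Y ^ 2)) ^ 2 := hD2
      _ = K2 P j η w c * (X ^ 2 * Y ^ 2) + K1 P j η w c ^ 2 * (X ^ 2 * Y ^ 4) := by ring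
      _ ≤ K2 P j η w c * E + K1 P j η w c ^ 2 * E := by gcongr
      _ = (K2 P j η w c + K1 P j η w c ^ 2) * E := by ring
  have h2 : |1 / 2 * s' * massForm w p.2| ≤ 1 / 2 * B * V * E := by
    rw [abs_mul, abs_mul, abs_of_nonneg hmF0, abs_of_pos (by norm_num : (0:ℝ) < 1 / 2)]
    calc 1 / 2 * |s'| * massForm w p.2 ≤ 1 / 2 * B * (V * Y ^ 2) :=
          mul_le_mul (mul_le_mul_of_nonneg_left hs' (by norm_num)) hmF hmF0 (by positivity)
      _ ≤ 1 / 2 * B * (V * E) := by gcongr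
      _ = 1 / 2 * B * V * E := by ring
  have h3 : |s * massForm w p.2 * D1 C η w c e (toVec p.1) p.2| ≤ B * V * K1 P j η w c * E := by
    rw [abs_mul, abs_mul, abs_of_nonneg hmF0]
    calc |s| * massForm w p.2 * |D1 C η w c e (toVec p.1) p.2|
        ≤ B * (V * Y ^ 2) * (K1 P j η w c * (X * Y ^ 2)) :=
          mul_le_mul (mul_le_mul hs hmF hmF0 hB) hD1 (abs_nonneg _) (by positivity)
      _ = B * V * K1 P j η w c * (X * Y ^ 4) := by ring
      _ ≤ B * V * K1 P j η w c * E := by gcongr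
  have h4 : |1 / 4 * s ^ 2 * massForm w p.2 ^ 2| ≤ 1 / 4 * B ^ 2 * V ^ 2 * E := by
    rw [abs_mul, abs_mul, abs_of_pos (by norm_num : (0:ℝ) < 1 / 4), abs_of_nonneg (sq_nonneg _),
      abs_of_nonneg (sq_nonneg _)]
    have hs2 : s ^ 2 ≤ B ^ 2 := by
      have := sq_abs s; nlinarith [abs_nonneg s]
    calc 1 / 4 * s ^ 2 * massForm w p.2 ^ 2 ≤ 1 / 4 * B ^ 2 * (V * Y ^ 2) ^ 2 := by
          gcongr
      _ = 1 / 4 * B ^ 2 * V ^ 2 * Y ^ 4 := by ring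
      _ ≤ 1 / 4 * B ^ 2 * V ^ 2 * E := by gcongr
  calc |D2 C η w c e (toVec p.1) p.2 - 1 / 2 * s' * massForm w p.2
        - s * massForm w p.2 * D1 C η w c e (toVec p.1) p.2 + 1 / 4 * s ^ 2 * massForm w p.2 ^ 2|
      ≤ |D2 C η w c e (toVec p.1) p.2| + |1 / 2 * s' * massForm w p.2|
        + |s * massForm w p.2 * D1 C η w c e (toVec p.1) p.2| + |1 / 4 * s ^ 2 * massForm w p.2 ^ 2| := by
        calc _ ≤ |D2 C η w c e (toVec p.1) p.2 - 1 / 2 * s' * massForm w p.2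
                  - s * massForm w p.2 * D1 C η w c e (toVec p.1) p.2| + |1 / 4 * s ^ 2 * massForm w p.2 ^ 2| :=
              abs_add_le _ _
          _ ≤ |D2 C η w c e (toVec p.1) p.2 - 1 / 2 * s' * massForm w p.2|
                + |s * massForm w p.2 * D1 C η w c e (toVec p.1) p.2| + |1 / 4 * s ^ 2 * massForm w p.2 ^ 2| := by
              linarith [abs_sub (D2 C η w c e (toVec p.1) p.2 - 1 / 2 * s' * massForm w p.2)
                (s * massForm w p.2 * D1 C η w c e (toVec p.1) p.2)]
          _ ≤ _ := by
              linarith [abs_sub (D2 C η w c e (toVec p.1) p.2) (1 / 2 * s' * massForm w p.2)]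
    _ ≤ (K2 P j η w c + K1 P j η w c ^ 2) * E + 1 / 2 * B * V * E + B * V * K1 P j η w c * E
        + 1 / 4 * B ^ 2 * V ^ 2 * E := by linarith
    _ = (K2 P j η w c + K1 P j η w c ^ 2 + 1 / 2 * B * V + B * V * K1 P j η w c + 1 / 4 * B ^ 2 * V ^ 2) * E := by
        ring


/-! ## §4 Differentiation under `∫dA∫dφ` ALONG THE COUNTERTERM CURVE — dominated convergence on the ball `∣e∣ < r` where
`∣ct∣ ≤ m²/2`, `∣ct′∣ ≤ B`, `∣ct″∣ ≤ B` (every integrand is BRICK 7's at the positive mass `m² + ct(e)`, so all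
integrability comes from BRICK 7; the majorant is BRICK 7's product majorant at mass `m²/2`) -/

omit C η w c μ2 in
/-- on the ball the running mass `m² + ct(e)` stays `≥ m²/2 > 0`. [cite: Balaban1983Higgs3, (1.20) p.416] -/
theorem mass_pos_of_abs_le (hm : 0 < m2) {t : ℝ} (ht : |t| ≤ m2 / 2) : 0 < m2 + t := by
  have := neg_abs_le t
  linarith

omit C η w c m2 μ2 in
/-- membership in the ball `∣e∣ < r` in metric form. [folklore] -/
private theorem abs_lt_of_mem_ball {r e : ℝ} (he : e ∈ Metric.ball (0 : ℝ) r) : |e| < r := by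
  rwa [Metric.mem_ball, dist_zero_right, Real.norm_eq_abs] at he

omit C η w c m2 μ2 in
/-- the ball `∣e∣ < r` is a neighbourhood of each of its points. [folklore] -/
private theorem ball_mem_nhds_of_abs_lt {r e₀ : ℝ} (he₀ : |e₀| < r) : Metric.ball (0 : ℝ) r ∈ 𝓝 e₀ :=
  Metric.isOpen_ball.mem_nhds (by rwa [Metric.mem_ball, dist_zero_right, Real.norm_eq_abs])

/-- the first-derivative integrand along the curve is integrable (BRICK 7 at mass `m² + ct(e)`).
[cite: Balaban1983Higgs3, (1.19)–(1.21) p.416] -/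
theorem integrable_D1_J_massCurve (hw : 0 < w) (hm : 0 < m2) (hμ : 0 < μ2) {F : Cfg P j N → ℝ} (hF : ExpGrowth F)
    {t s : ℝ} (ht : |t| ≤ m2 / 2) (e : ℝ) :
    Integrable (fun p : JCfg P j N =>
      (D1 C η w c e (toVec p.1) p.2 - 1 / 2 * s * massForm w p.2) * J C η w c (m2 + t) μ2 e p * F p.2) := by
  have hpos := mass_pos_of_abs_le m2 hm ht
  have h1 := (hasDerivAt_integral_J_mul C η w c (m2 + t) μ2 hw hpos hμ hF e).1
  have h2 := integrable_J_mul C η w c (m2 + t) μ2 hw hpos hμ ((expGrowth_massForm (P := P) (j := j) (N := N) w).mul hF) e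
  refine (h1.sub (h2.const_mul (1 / 2 * s))).congr (Filter.Eventually.of_forall fun p => ?_)
  simp only [Pi.sub_apply]
  ring

/-- the second-derivative integrand along the curve is integrable (BRICK 7 at mass `m² + ct(e)`).
[cite: Balaban1983Higgs3, (1.19)–(1.21) p.416] -/
theorem integrable_D2_J_massCurve (hw : 0 < w) (hm : 0 < m2) (hμ : 0 < μ2) {F : Cfg P j N → ℝ} (hF : ExpGrowth F)
    {t s s' : ℝ} (ht : |t| ≤ m2 / 2) (e : ℝ) :
    Integrable (fun p : JCfg P j N =>
      (D2 C η w c e (toVec p.1) p.2 - 1 / 2 * s' * massForm w p.2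
          - s * massForm w p.2 * D1 C η w c e (toVec p.1) p.2 + 1 / 4 * s ^ 2 * massForm w p.2 ^ 2) *
        J C η w c (m2 + t) μ2 e p * F p.2) := by
  have hpos := mass_pos_of_abs_le m2 hm ht
  have hmF := expGrowth_massForm (P := P) (j := j) (N := N) w
  have ha := (hasDerivAt_integral_D1_J_mul C η w c (m2 + t) μ2 hw hpos hμ hF e).1
  have hb := integrable_J_mul C η w c (m2 + t) μ2 hw hpos hμ (hmF.mul hF) e
  have hc := (hasDerivAt_integral_J_mul C η w c (m2 + t) μ2 hw hpos hμ (hmF.mul hF) e).1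
  have hd := integrable_J_mul C η w c (m2 + t) μ2 hw hpos hμ (hmF.mul (hmF.mul hF)) e
  refine (((ha.sub (hb.const_mul (1 / 2 * s'))).sub (hc.const_mul s)).add (hd.const_mul (1 / 4 * s ^ 2))).congr
    (Filter.Eventually.of_forall fun p => ?_)
  simp only [Pi.sub_apply, Pi.add_apply]
  ring

/-- the joint weight is positive at every mass. [cite: Balaban1983Higgs3, (1.19) p.416] -/
theorem J_pos' (M e : ℝ) (p : JCfg P j N) : 0 < J C η w c M μ2 e p := by
  unfold J
  exact mul_pos (WA_pos η w c μ2 p.1) (weight_pos _ _)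

/-- **DIFFERENTIATION UNDER `∫dA∫dφ` ALONG THE CURVE, FIRST ORDER**: for a counterterm `ct` differentiable on `∣e∣ < r` with
`∣ct∣ ≤ m²/2`, `∣ct′∣ ≤ B` there, and an observable `F` of the scalar field of exponential-linear growth,
`d/de ∫e^{−S^ε_e}F = ∫[D₁(e) − ½ct′(e)Σ_xη^d∣φ(x)∣²]e^{−S^ε_e}F` at every `∣e₀∣ < r`, `S^ε_e` = (1.20) at `λ = 0` with `δm² = ct(e)`
— dominated differentiation, majorant `(K₁ + ½Bη^d∣T∣)K_F·Φ_{κ+4}` at mass `m²/2`. [cite: Balaban1983Higgs3, (1.19)–(1.21) p.416, p.417] -/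
theorem hasDerivAt_integral_J_massCurve (hw : 0 < w) (hm : 0 < m2) (hμ : 0 < μ2) {F : Cfg P j N → ℝ} (hF : ExpGrowth F)
    {ct ct' : ℝ → ℝ} {r B : ℝ} (hd : ∀ e, |e| < r → HasDerivAt ct (ct' e) e)
    (hct : ∀ e, |e| < r → |ct e| ≤ m2 / 2) (hct' : ∀ e, |e| < r → |ct' e| ≤ B) {e₀ : ℝ} (he₀ : |e₀| < r) :
    Integrable (fun p : JCfg P j N => (D1 C η w c e₀ (toVec p.1) p.2 - 1 / 2 * ct' e₀ * massForm w p.2) *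
        J C η w c (m2 + ct e₀) μ2 e₀ p * F p.2) ∧
    HasDerivAt (fun e => ∫ p : JCfg P j N, J C η w c (m2 + ct e) μ2 e p * F p.2)
      (∫ p : JCfg P j N, (D1 C η w c e₀ (toVec p.1) p.2 - 1 / 2 * ct' e₀ * massForm w p.2) *
        J C η w c (m2 + ct e₀) μ2 e₀ p * F p.2) e₀ := by
  obtain ⟨hFc, K, κ, hK, hκ, hFb⟩ := id hF
  have hball := ball_mem_nhds_of_abs_lt he₀
  have hI0 : ∀ e, |e| < r → Integrable (fun p : JCfg P j N => J C η w c (m2 + ct e) μ2 e p * F p.2) := fun e he =>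
    integrable_J_mul C η w c (m2 + ct e) μ2 hw (mass_pos_of_abs_le m2 hm (hct e he)) hμ hF e
  have hbound := (integrable_majorant (P := P) (j := j) (N := N) η w c (m2 / 2) μ2 hw (half_pos hm) hμ (κ + 4)).const_mul
    ((K1 P j η w c + 1 / 2 * B * (w * Fintype.card (Site P j))) * K)
  refine hasDerivAt_integral_of_dominated_loc_of_deriv_le
    (F := fun e p => J C η w c (m2 + ct e) μ2 e p * F p.2)
    (F' := fun e p => (D1 C η w c e (toVec p.1) p.2 - 1 / 2 * ct' e * massForm w p.2) *
      J C η w c (m2 + ct e) μ2 e p * F p.2)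
    hball (Filter.eventually_of_mem hball fun e he => (hI0 e (abs_lt_of_mem_ball he)).aestronglyMeasurable)
    (hI0 e₀ he₀) (integrable_D1_J_massCurve C η w c m2 μ2 hw hm hμ hF (hct e₀ he₀) e₀).aestronglyMeasurable
    (Filter.Eventually.of_forall fun p e he => ?_) hbound (Filter.Eventually.of_forall fun p e he => ?_)
  · -- the bound on the ball
    have he' := abs_lt_of_mem_ball he
    have hJ0 := J_pos' C η w c μ2 (m2 + ct e) e p
    rw [Real.norm_eq_abs, abs_mul, abs_mul, abs_of_pos hJ0]
    have hD := abs_D1_massCurve_le C η w c hw.le (hct' e he') e p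
    have hJ := J_massCurve_le C η w c m2 μ2 hw.le (hct e he') e p
    have hWA : 0 ≤ WA η w c μ2 p.1 := (WA_pos η w c μ2 p.1).le
    have hc1 : 0 ≤ (K1 P j η w c + 1 / 2 * B * (w * Fintype.card (Site P j))) *
        (Real.exp (2 * ‖p.1‖) * Real.exp (4 * ‖p.2‖)) := (abs_nonneg _).trans hD
    have hc2 : 0 ≤ (K1 P j η w c + 1 / 2 * B * (w * Fintype.card (Site P j))) *
        (Real.exp (2 * ‖p.1‖) * Real.exp (4 * ‖p.2‖)) *
        (WA η w c μ2 p.1 * Real.exp (-(m2 / 2 * w / 2) * ∑ x : Site P j, ‖p.2 x‖ ^ 2)) :=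
      mul_nonneg hc1 (mul_nonneg hWA (Real.exp_pos _).le)
    have hκ4 : Real.exp (4 * ‖p.2‖) * Real.exp (κ * ‖p.2‖) = Real.exp ((κ + 4) * ‖p.2‖) := by
      rw [← Real.exp_add]; ring_nf
    calc |D1 C η w c e (toVec p.1) p.2 - 1 / 2 * ct' e * massForm w p.2| * J C η w c (m2 + ct e) μ2 e p * |F p.2|
        ≤ ((K1 P j η w c + 1 / 2 * B * (w * Fintype.card (Site P j))) * (Real.exp (2 * ‖p.1‖) * Real.exp (4 * ‖p.2‖))) *
            (WA η w c μ2 p.1 * Real.exp (-(m2 / 2 * w / 2) * ∑ x : Site P j, ‖p.2 x‖ ^ 2)) * (K * Real.exp (κ * ‖p.2‖)) :=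
          mul_le_mul (mul_le_mul hD hJ hJ0.le hc1) (hFb p.2) (abs_nonneg _) hc2
      _ = (K1 P j η w c + 1 / 2 * B * (w * Fintype.card (Site P j))) * K *
            ((WA η w c μ2 p.1 * Real.exp (2 * ‖p.1‖)) *
              ((Real.exp (4 * ‖p.2‖) * Real.exp (κ * ‖p.2‖)) * Real.exp (-(m2 / 2 * w / 2) * ∑ x : Site P j, ‖p.2 x‖ ^ 2))) := by
          ring
      _ = (K1 P j η w c + 1 / 2 * B * (w * Fintype.card (Site P j))) * K *
            ((WA η w c μ2 p.1 * Real.exp (2 * ‖p.1‖)) *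
              (Real.exp ((κ + 4) * ‖p.2‖) * Real.exp (-(m2 / 2 * w / 2) * ∑ x : Site P j, ‖p.2 x‖ ^ 2))) := by rw [hκ4]
  · exact (hasDerivAt_J_massCurve C η w c m2 μ2 (hd e (abs_lt_of_mem_ball he)) p).mul_const (F p.2)

/-- **DIFFERENTIATION UNDER `∫dA∫dφ` ALONG THE CURVE, SECOND ORDER**:
`d/de ∫[D₁(e) − ½ct′Σ∣φ∣²]e^{−S^ε_e}F = ∫[D₂(e) − ½ct″Σ∣φ∣² − ct′Σ∣φ∣²D₁(e) + ¼ct′²(Σ∣φ∣²)²]e^{−S^ε_e}F` at every `∣e₀∣ < r`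
(`∣ct″∣ ≤ B` too; majorant `K·K_F·Φ_{κ+4}` at mass `m²/2`). [cite: Balaban1983Higgs3, (1.19)–(1.21) p.416, p.417] -/
theorem hasDerivAt_integral_D1_J_massCurve (hw : 0 < w) (hm : 0 < m2) (hμ : 0 < μ2) {F : Cfg P j N → ℝ}
    (hF : ExpGrowth F) {ct ct' ct'' : ℝ → ℝ} {r B : ℝ} (hd : ∀ e, |e| < r → HasDerivAt ct (ct' e) e)
    (hd' : ∀ e, |e| < r → HasDerivAt ct' (ct'' e) e) (hct : ∀ e, |e| < r → |ct e| ≤ m2 / 2)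
    (hct' : ∀ e, |e| < r → |ct' e| ≤ B) (hct'' : ∀ e, |e| < r → |ct'' e| ≤ B) {e₀ : ℝ} (he₀ : |e₀| < r) :
    Integrable (fun p : JCfg P j N =>
      (D2 C η w c e₀ (toVec p.1) p.2 - 1 / 2 * ct'' e₀ * massForm w p.2
          - ct' e₀ * massForm w p.2 * D1 C η w c e₀ (toVec p.1) p.2 + 1 / 4 * ct' e₀ ^ 2 * massForm w p.2 ^ 2) *
        J C η w c (m2 + ct e₀) μ2 e₀ p * F p.2) ∧
    HasDerivAt (fun e => ∫ p : JCfg P j N, (D1 C η w c e (toVec p.1) p.2 - 1 / 2 * ct' e * massForm w p.2) *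
        J C η w c (m2 + ct e) μ2 e p * F p.2)
      (∫ p : JCfg P j N, (D2 C η w c e₀ (toVec p.1) p.2 - 1 / 2 * ct'' e₀ * massForm w p.2
          - ct' e₀ * massForm w p.2 * D1 C η w c e₀ (toVec p.1) p.2 + 1 / 4 * ct' e₀ ^ 2 * massForm w p.2 ^ 2) *
        J C η w c (m2 + ct e₀) μ2 e₀ p * F p.2) e₀ := by
  obtain ⟨hFc, K, κ, hK, hκ, hFb⟩ := id hF
  have hball := ball_mem_nhds_of_abs_lt he₀
  have hbound := (integrable_majorant (P := P) (j := j) (N := N) η w c (m2 / 2) μ2 hw (half_pos hm) hμ (κ + 4)).const_mul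
    ((K2 P j η w c + K1 P j η w c ^ 2 + 1 / 2 * B * (w * Fintype.card (Site P j))
        + B * (w * Fintype.card (Site P j)) * K1 P j η w c + 1 / 4 * B ^ 2 * (w * Fintype.card (Site P j)) ^ 2) * K)
  refine hasDerivAt_integral_of_dominated_loc_of_deriv_le
    (F := fun e p => (D1 C η w c e (toVec p.1) p.2 - 1 / 2 * ct' e * massForm w p.2) *
      J C η w c (m2 + ct e) μ2 e p * F p.2)
    (F' := fun e p => (D2 C η w c e (toVec p.1) p.2 - 1 / 2 * ct'' e * massForm w p.2
          - ct' e * massForm w p.2 * D1 C η w c e (toVec p.1) p.2 + 1 / 4 * ct' e ^ 2 * massForm w p.2 ^ 2) *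
        J C η w c (m2 + ct e) μ2 e p * F p.2)
    hball (Filter.eventually_of_mem hball fun e he =>
      (integrable_D1_J_massCurve C η w c m2 μ2 hw hm hμ hF (hct e (abs_lt_of_mem_ball he)) e).aestronglyMeasurable)
    (integrable_D1_J_massCurve C η w c m2 μ2 hw hm hμ hF (hct e₀ he₀) e₀)
    (integrable_D2_J_massCurve C η w c m2 μ2 hw hm hμ hF (hct e₀ he₀) e₀).aestronglyMeasurable
    (Filter.Eventually.of_forall fun p e he => ?_) hbound (Filter.Eventually.of_forall fun p e he => ?_)
  · -- the bound on the ball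
    have he' := abs_lt_of_mem_ball he
    have hJ0 := J_pos' C η w c μ2 (m2 + ct e) e p
    rw [Real.norm_eq_abs, abs_mul, abs_mul, abs_of_pos hJ0]
    have hD := abs_D2_massCurve_le C η w c hw.le (hct' e he') (hct'' e he') e p
    have hJ := J_massCurve_le C η w c m2 μ2 hw.le (hct e he') e p
    have hWA : 0 ≤ WA η w c μ2 p.1 := (WA_pos η w c μ2 p.1).le
    set Ktot : ℝ := K2 P j η w c + K1 P j η w c ^ 2 + 1 / 2 * B * (w * Fintype.card (Site P j))
        + B * (w * Fintype.card (Site P j)) * K1 P j η w c + 1 / 4 * B ^ 2 * (w * Fintype.card (Site P j)) ^ 2 with hKtot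
    have hc1 : 0 ≤ Ktot * (Real.exp (2 * ‖p.1‖) * Real.exp (4 * ‖p.2‖)) := (abs_nonneg _).trans hD
    have hc2 : 0 ≤ Ktot * (Real.exp (2 * ‖p.1‖) * Real.exp (4 * ‖p.2‖)) *
        (WA η w c μ2 p.1 * Real.exp (-(m2 / 2 * w / 2) * ∑ x : Site P j, ‖p.2 x‖ ^ 2)) :=
      mul_nonneg hc1 (mul_nonneg hWA (Real.exp_pos _).le)
    have hκ4 : Real.exp (4 * ‖p.2‖) * Real.exp (κ * ‖p.2‖) = Real.exp ((κ + 4) * ‖p.2‖) := by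
      rw [← Real.exp_add]; ring_nf
    calc |D2 C η w c e (toVec p.1) p.2 - 1 / 2 * ct'' e * massForm w p.2
            - ct' e * massForm w p.2 * D1 C η w c e (toVec p.1) p.2 + 1 / 4 * ct' e ^ 2 * massForm w p.2 ^ 2| *
          J C η w c (m2 + ct e) μ2 e p * |F p.2|
        ≤ (Ktot * (Real.exp (2 * ‖p.1‖) * Real.exp (4 * ‖p.2‖))) *
            (WA η w c μ2 p.1 * Real.exp (-(m2 / 2 * w / 2) * ∑ x : Site P j, ‖p.2 x‖ ^ 2)) * (K * Real.exp (κ * ‖p.2‖)) :=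
          mul_le_mul (mul_le_mul hD hJ hJ0.le hc1) (hFb p.2) (abs_nonneg _) hc2
      _ = Ktot * K * ((WA η w c μ2 p.1 * Real.exp (2 * ‖p.1‖)) *
            ((Real.exp (4 * ‖p.2‖) * Real.exp (κ * ‖p.2‖)) * Real.exp (-(m2 / 2 * w / 2) * ∑ x : Site P j, ‖p.2 x‖ ^ 2))) := by
          ring
      _ = Ktot * K * ((WA η w c μ2 p.1 * Real.exp (2 * ‖p.1‖)) *
            (Real.exp ((κ + 4) * ‖p.2‖) * Real.exp (-(m2 / 2 * w / 2) * ∑ x : Site P j, ‖p.2 x‖ ^ 2))) := by rw [hκ4]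
  · have he' := abs_lt_of_mem_ball he
    exact (hasDerivAt_D1_J_massCurve C η w c m2 μ2 (hd e he') (hd' e he') p).mul_const (F p.2)


/-! ## §5 (1.19) WITH THE COUNTERTERM `δm² = ct(e)` IN THE ACTION (1.20), AS A FUNCTION OF THE CHARGE: the quotient
`G^{ct}_{e,ab}(x,x′) = N(e)/Z(e)` is differentiable near `e = 0`, `G′(0) = 0`, and the order-`e²` coefficient exists -/

omit C η w c μ2 in
/-- **a ball on which the curve is controlled**: if `ct` is `C²` near `0` in the sense `ct′ = ct'`, `ct″ = ct''` with `ct''`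
continuous at `0`, and `ct(0) = 0`, then on some `∣e∣ < r`: `∣ct∣ ≤ m²/2`, `∣ct′∣ ≤ B`, `∣ct″∣ ≤ B`. [folklore] -/
private theorem exists_ball_bounds (hm : 0 < m2) {ct ct' ct'' : ℝ → ℝ} (hd : ∀ e, HasDerivAt ct (ct' e) e)
    (hd' : ∀ e, HasDerivAt ct' (ct'' e) e) (hc'' : ContinuousAt ct'' 0) (h0 : ct 0 = 0) :
    ∃ r B : ℝ, 0 < r ∧ (∀ e, |e| < r → |ct e| ≤ m2 / 2) ∧ (∀ e, |e| < r → |ct' e| ≤ B) ∧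
      (∀ e, |e| < r → |ct'' e| ≤ B) := by
  have h1 : ∀ᶠ e in 𝓝 (0:ℝ), dist (ct e) (ct 0) < m2 / 2 :=
    Metric.tendsto_nhds.mp (hd 0).continuousAt (m2 / 2) (half_pos hm)
  have h2 : ∀ᶠ e in 𝓝 (0:ℝ), dist (ct' e) (ct' 0) < 1 := Metric.tendsto_nhds.mp (hd' 0).continuousAt 1 one_pos
  have h3 : ∀ᶠ e in 𝓝 (0:ℝ), dist (ct'' e) (ct'' 0) < 1 := Metric.tendsto_nhds.mp hc'' 1 one_pos
  obtain ⟨r, hr, hball⟩ := Metric.eventually_nhds_iff.mp (h1.and (h2.and h3))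
  have hmem : ∀ e : ℝ, |e| < r → dist e 0 < r := fun e he => by rwa [Real.dist_eq, sub_zero]
  refine ⟨r, max (|ct' 0| + 1) (|ct'' 0| + 1), hr, fun e he => ?_, fun e he => ?_, fun e he => ?_⟩
  · have h := (hball (hmem e he)).1
    rw [Real.dist_eq, h0, sub_zero] at h
    exact h.le
  · have h := (hball (hmem e he)).2.1
    rw [Real.dist_eq] at h
    have := abs_sub_abs_le_abs_sub (ct' e) (ct' 0)
    exact le_max_of_le_left (by linarith)
  · have h := (hball (hmem e he)).2.2
    rw [Real.dist_eq] at h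
    have := abs_sub_abs_le_abs_sub (ct'' e) (ct'' 0)
    exact le_max_of_le_right (by linarith)

/-- **FIRST-ORDER PERTURBATION THEORY IN THE CHARGE WITH THE COUNTERTERM INSERTED**: on the ball, `G^{ct}_e = N(e)/Z(e)`,
`N(e) = ∫e^{−S^ε_e}φ_a(x)φ_b(x′)`, `Z(e) = ∫e^{−S^ε_e}` (`δm² = ct(e)` in `S^ε_e`), is differentiable with
`(G^{ct})′ = (N′Z − NZ′)/Z²`, `N′ = ∫[D₁ − ½ct′Σ∣φ∣²]e^{−S^ε_e}φ_aφ_b`. [cite: Balaban1983Higgs3, (1.19)–(1.21) p.416, p.417] -/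
theorem hasDerivAt_twoPt_massCurve_of_ball (hw : 0 < w) (hm : 0 < m2) (hμ : 0 < μ2) (a b : Fin N) (x x' : Site P j)
    {ct ct' : ℝ → ℝ} {r B : ℝ} (hd : ∀ e, |e| < r → HasDerivAt ct (ct' e) e)
    (hct : ∀ e, |e| < r → |ct e| ≤ m2 / 2) (hct' : ∀ e, |e| < r → |ct' e| ≤ B) {e₀ : ℝ} (he₀ : |e₀| < r) :
    HasDerivAt (fun e => twoPt C η w c (m2 + ct e) μ2 e a b x x')
      (((∫ p : JCfg P j N, (D1 C η w c e₀ (toVec p.1) p.2 - 1 / 2 * ct' e₀ * massForm w p.2) *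
            J C η w c (m2 + ct e₀) μ2 e₀ p * legs a b x x' p.2) *
          (∫ p : JCfg P j N, J C η w c (m2 + ct e₀) μ2 e₀ p * (1 : ℝ))
        - (∫ p : JCfg P j N, J C η w c (m2 + ct e₀) μ2 e₀ p * legs a b x x' p.2) *
          (∫ p : JCfg P j N, (D1 C η w c e₀ (toVec p.1) p.2 - 1 / 2 * ct' e₀ * massForm w p.2) *
            J C η w c (m2 + ct e₀) μ2 e₀ p * (1 : ℝ))) /
        (∫ p : JCfg P j N, J C η w c (m2 + ct e₀) μ2 e₀ p * (1 : ℝ)) ^ 2) e₀ := by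
  have hN := (hasDerivAt_integral_J_massCurve C η w c m2 μ2 hw hm hμ (expGrowth_legs a b x x') hd hct hct' he₀).2
  have hZ := (hasDerivAt_integral_J_massCurve (P := P) (j := j) C η w c m2 μ2 hw hm hμ (ExpGrowth.const (1 : ℝ))
    hd hct hct' he₀).2
  have hZ0 : (∫ p : JCfg P j N, J C η w c (m2 + ct e₀) μ2 e₀ p * (1 : ℝ)) ≠ 0 := by
    simp only [mul_one]
    exact (integral_J_pos C η w c (m2 + ct e₀) μ2 hw (mass_pos_of_abs_le m2 hm (hct e₀ he₀)) hμ e₀).ne'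
  have h := hN.div hZ hZ0
  simp only [twoPt_eq]
  exact h

/-- **THE ORDER-`e` TERM VANISHES ALSO WITH THE COUNTERTERM**: at `e = 0` (where `ct = ct′ = 0`) the first-derivative integrals
are BRICK 7's `∫D₁(0)e^{−S_0}F = 0` (one vector leg against the even Gaussian). [cite: Balaban1983Higgs3, (1.21) p.416] -/
theorem integral_D1_J_massCurve_zero (hw : 0 < w) (hm : 0 < m2) (hμ : 0 < μ2) {F : Cfg P j N → ℝ} (hF : ExpGrowth F)
    {ct ct' : ℝ → ℝ} (h0 : ct 0 = 0) (h0' : ct' 0 = 0) :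
    ∫ p : JCfg P j N, (D1 C η w c 0 (toVec p.1) p.2 - 1 / 2 * ct' 0 * massForm w p.2) *
      J C η w c (m2 + ct 0) μ2 0 p * F p.2 = 0 := by
  simp only [h0, h0', add_zero, mul_zero, zero_mul, sub_zero]
  exact integral_D1_J_zero C η w c m2 μ2 hw hm hμ hF

/-- **THE ORDER-`e²` COEFFICIENT WITH THE COUNTERTERM EXISTS**: the first derivative `(N′Z − NZ′)/Z²` is differentiable at `e = 0`
with derivative `(N″(0)Z(0) − N(0)Z″(0))/Z(0)²`, **`N″(0) = ∫[D₂(0) − ½ct″(0)Σ_xη^d∣φ(x)∣²]e^{−S_0}φ_aφ_b`**,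
`Z″(0) = ∫[D₂(0) − ½ct″(0)Σ∣φ∣²]e^{−S_0}` — BRICK 7's second insertion `D₂(0)` plus, NEW, the mass-renormalization vertex (1.7)
`−½δm²_{(2)}Σ_xε^d∣φ(x)∣²` with `δm²_{(2)} = ct″(0)` (= `2δm²_{(2,0)}`); the `ct′`-terms vanish with `ct′(0) = 0`.
[cite: Balaban1983Higgs3, (1.7) p.413, (1.19)–(1.21) p.416, p.417] -/
theorem hasDerivAt_deriv_twoPt_massCurve_zero_of_ball (hw : 0 < w) (hm : 0 < m2) (hμ : 0 < μ2) (a b : Fin N)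
    (x x' : Site P j) {ct ct' ct'' : ℝ → ℝ} {r B : ℝ} (hr : 0 < r) (hd : ∀ e, |e| < r → HasDerivAt ct (ct' e) e)
    (hd' : ∀ e, |e| < r → HasDerivAt ct' (ct'' e) e) (hct : ∀ e, |e| < r → |ct e| ≤ m2 / 2)
    (hct' : ∀ e, |e| < r → |ct' e| ≤ B) (hct'' : ∀ e, |e| < r → |ct'' e| ≤ B) (h0 : ct 0 = 0) (h0' : ct' 0 = 0) :
    HasDerivAt (fun e =>
      ((∫ p : JCfg P j N, (D1 C η w c e (toVec p.1) p.2 - 1 / 2 * ct' e * massForm w p.2) *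
            J C η w c (m2 + ct e) μ2 e p * legs a b x x' p.2) *
          (∫ p : JCfg P j N, J C η w c (m2 + ct e) μ2 e p * (1 : ℝ))
        - (∫ p : JCfg P j N, J C η w c (m2 + ct e) μ2 e p * legs a b x x' p.2) *
          (∫ p : JCfg P j N, (D1 C η w c e (toVec p.1) p.2 - 1 / 2 * ct' e * massForm w p.2) *
            J C η w c (m2 + ct e) μ2 e p * (1 : ℝ))) /
        (∫ p : JCfg P j N, J C η w c (m2 + ct e) μ2 e p * (1 : ℝ)) ^ 2)
      (((∫ p : JCfg P j N, (D2 C η w c 0 (toVec p.1) p.2 - 1 / 2 * ct'' 0 * massForm w p.2) *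
            J C η w c m2 μ2 0 p * legs a b x x' p.2) *
          (∫ p : JCfg P j N, J C η w c m2 μ2 0 p * (1 : ℝ))
        - (∫ p : JCfg P j N, J C η w c m2 μ2 0 p * legs a b x x' p.2) *
          (∫ p : JCfg P j N, (D2 C η w c 0 (toVec p.1) p.2 - 1 / 2 * ct'' 0 * massForm w p.2) *
            J C η w c m2 μ2 0 p * (1 : ℝ))) /
        (∫ p : JCfg P j N, J C η w c m2 μ2 0 p * (1 : ℝ)) ^ 2) 0 := by
  have h00 : |(0 : ℝ)| < r := by rwa [abs_zero]
  have hN := (hasDerivAt_integral_J_massCurve C η w c m2 μ2 hw hm hμ (expGrowth_legs a b x x') hd hct hct' h00).2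
  have hZ := (hasDerivAt_integral_J_massCurve (P := P) (j := j) C η w c m2 μ2 hw hm hμ (ExpGrowth.const (1 : ℝ))
    hd hct hct' h00).2
  have hN' := (hasDerivAt_integral_D1_J_massCurve C η w c m2 μ2 hw hm hμ (expGrowth_legs a b x x')
    hd hd' hct hct' hct'' h00).2
  have hZ' := (hasDerivAt_integral_D1_J_massCurve (P := P) (j := j) C η w c m2 μ2 hw hm hμ (ExpGrowth.const (1 : ℝ))
    hd hd' hct hct' hct'' h00).2
  have hZ0 : (∫ p : JCfg P j N, J C η w c (m2 + ct 0) μ2 0 p * (1 : ℝ)) ≠ 0 := by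
    simp only [mul_one]
    exact (integral_J_pos C η w c (m2 + ct 0) μ2 hw (mass_pos_of_abs_le m2 hm (hct 0 h00)) hμ 0).ne'
  have hnum := (hN'.mul hZ).sub (hN.mul hZ')
  have hden := hZ.pow 2
  have h := hnum.div hden (pow_ne_zero 2 hZ0)
  refine h.congr_deriv ?_
  rw [integral_D1_J_massCurve_zero C η w c m2 μ2 hw hm hμ (expGrowth_legs a b x x') h0 h0',
    integral_D1_J_massCurve_zero (P := P) (j := j) C η w c m2 μ2 hw hm hμ (ExpGrowth.const (1 : ℝ)) h0 h0']
  simp only [h0, h0', add_zero, mul_zero, zero_mul, sub_zero, ne_eq, OfNat.ofNat_ne_zero, not_false_eq_true,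
    zero_pow, Pi.pow_apply, Pi.mul_apply, Pi.sub_apply, mul_one]
  -- freeze the four integrals (so that `field_simp`/`ring` do not normalize inside the integrands)
  set N2 : ℝ := ∫ p : JCfg P j N, (D2 C η w c 0 (toVec p.1) p.2 - 1 / 2 * ct'' 0 * massForm w p.2) *
    J C η w c m2 μ2 0 p * legs a b x x' p.2 with hN2
  set Z2 : ℝ := ∫ p : JCfg P j N, (D2 C η w c 0 (toVec p.1) p.2 - 1 / 2 * ct'' 0 * massForm w p.2) *
    J C η w c m2 μ2 0 p with hZ2
  set N0 : ℝ := ∫ p : JCfg P j N, J C η w c m2 μ2 0 p * legs a b x x' p.2 with hN0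
  set Z0 : ℝ := ∫ p : JCfg P j N, J C η w c m2 μ2 0 p with hZ0
  have hZ0' : Z0 ≠ 0 := (integral_J_pos C η w c m2 μ2 hw hm hμ 0).ne'
  field_simp
  ring

/-- **THE ORDER-`e²` COEFFICIENT OF (1.19) WITH THE COUNTERTERM, in Mathlib's `iteratedDeriv`** (for a counterterm `C²` near
`0` with `ct(0) = ct′(0) = 0` — print's `δm² = Σ_{2≤α≤4}e^αδm²_{(α,0)}` at `λ = 0` is such a curve):
`iteratedDeriv 2 G^{ct} 0 = (N″(0)Z(0) − N(0)Z″(0))/Z(0)²` with the insertions of the previous theorem.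
[cite: Balaban1983Higgs3, (1.19)–(1.21) p.416, p.417] -/
theorem iteratedDeriv_two_twoPt_massCurve_raw (hw : 0 < w) (hm : 0 < m2) (hμ : 0 < μ2) (a b : Fin N) (x x' : Site P j)
    {ct ct' ct'' : ℝ → ℝ} (hd : ∀ e, HasDerivAt ct (ct' e) e) (hd' : ∀ e, HasDerivAt ct' (ct'' e) e)
    (hc'' : ContinuousAt ct'' 0) (h0 : ct 0 = 0) (h0' : ct' 0 = 0) :
    iteratedDeriv 2 (fun e => twoPt C η w c (m2 + ct e) μ2 e a b x x') 0 =
      ((∫ p : JCfg P j N, (D2 C η w c 0 (toVec p.1) p.2 - 1 / 2 * ct'' 0 * massForm w p.2) *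
            J C η w c m2 μ2 0 p * legs a b x x' p.2) *
          (∫ p : JCfg P j N, J C η w c m2 μ2 0 p * (1 : ℝ))
        - (∫ p : JCfg P j N, J C η w c m2 μ2 0 p * legs a b x x' p.2) *
          (∫ p : JCfg P j N, (D2 C η w c 0 (toVec p.1) p.2 - 1 / 2 * ct'' 0 * massForm w p.2) *
            J C η w c m2 μ2 0 p * (1 : ℝ))) /
        (∫ p : JCfg P j N, J C η w c m2 μ2 0 p * (1 : ℝ)) ^ 2 := by
  obtain ⟨r, B, hr, hct, hct', hct''⟩ := exists_ball_bounds m2 hm hd hd' hc'' h0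
  have hdr : ∀ e, |e| < r → HasDerivAt ct (ct' e) e := fun e _ => hd e
  have hdr' : ∀ e, |e| < r → HasDerivAt ct' (ct'' e) e := fun e _ => hd' e
  have h00 : |(0 : ℝ)| < r := by rwa [abs_zero]
  have hev : deriv (fun e => twoPt C η w c (m2 + ct e) μ2 e a b x x') =ᶠ[𝓝 0] fun e =>
      ((∫ p : JCfg P j N, (D1 C η w c e (toVec p.1) p.2 - 1 / 2 * ct' e * massForm w p.2) *
            J C η w c (m2 + ct e) μ2 e p * legs a b x x' p.2) *
          (∫ p : JCfg P j N, J C η w c (m2 + ct e) μ2 e p * (1 : ℝ))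
        - (∫ p : JCfg P j N, J C η w c (m2 + ct e) μ2 e p * legs a b x x' p.2) *
          (∫ p : JCfg P j N, (D1 C η w c e (toVec p.1) p.2 - 1 / 2 * ct' e * massForm w p.2) *
            J C η w c (m2 + ct e) μ2 e p * (1 : ℝ))) /
        (∫ p : JCfg P j N, J C η w c (m2 + ct e) μ2 e p * (1 : ℝ)) ^ 2 :=
    Filter.eventually_of_mem (ball_mem_nhds_of_abs_lt h00) fun e he =>
      (hasDerivAt_twoPt_massCurve_of_ball C η w c m2 μ2 hw hm hμ a b x x' hdr hct hct' (abs_lt_of_mem_ball he)).deriv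
  rw [iteratedDeriv_succ, iteratedDeriv_one, hev.deriv_eq]
  exact (hasDerivAt_deriv_twoPt_massCurve_zero_of_ball C η w c m2 μ2 hw hm hμ a b x x' hr hdr hdr' hct hct' hct''
    h0 h0').deriv

/-! ## §6 Wick's theorem for the mass vertex against the two legs: the connected part of `⟨Σ_zη^d∣φ(z)∣²·φ_a(x)φ_b(x′)⟩` is
`2Σ_zη^dC₀(x′,z)C₀(z,x)δ_{ab}` — the free line with ONE mass insertion; the MAIN THEOREM -/

/-- **THE CONNECTED MASS INSERTION** (free scalar Gaussian `W₀ = e^{−½⟨φ,(−Δ^η_0+m²)φ⟩}`, `Z₀ = ∫W₀`):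
`Z₀·∫W₀(Σ_zη^d∣φ(z)∣²)φ_a(x)φ_b(x′) − (∫W₀φ_a(x)φ_b(x′))·(∫W₀Σ_zη^d∣φ(z)∣²) = Z₀²·δ_{ab}·2Σ_zη^dC₀(x′,z)C₀(z,x)` — the vacuum
loop `N·C₀(z,z)` cancels, the two legs enter the two fields of the vertex in either order (factor `2`): the kernel of
`C₀·𝟙·C₀`, i.e. the `n = 1` term `C₀(−δm²)C₀` of (1.21) per unit `−δm²`. [cite: Balaban1983Higgs3, (1.7) p.413, (1.21) p.416]
[cite: GlimmJaffeQP1987, §8.2–8.3 (Wick)] -/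
theorem cov_massForm_legs (hw : 0 < w) (hm : 0 < m2) (a b : Fin N) (x x' : Site P j) :
    (∫ φ : Cfg P j N, weight C η w c m2 (0 : VecField P j ℝ) φ * (massForm w φ * legs a b x x' φ)) *
        (∫ φ : Cfg P j N, weight C η w c m2 (0 : VecField P j ℝ) φ)
      - (∫ φ : Cfg P j N, weight C η w c m2 (0 : VecField P j ℝ) φ * legs a b x x' φ) *
        (∫ φ : Cfg P j N, weight C η w c m2 (0 : VecField P j ℝ) φ * massForm w φ) =
      (∫ φ : Cfg P j N, weight C η w c m2 (0 : VecField P j ℝ) φ) ^ 2 *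
        (⟪EuclideanSpace.basisFun (Fin N) ℝ a, EuclideanSpace.basisFun (Fin N) ℝ b⟫_ℝ *
          (2 * ∑ z : Site P j, w * (G w c m2 x' z * G w c m2 z x))) := by
  set Q : EuclideanSpace ℝ (Fin N) →L[ℝ] EuclideanSpace ℝ (Fin N) := ContinuousLinearMap.id ℝ _ with hQ
  -- the mass vertex is the current `⟪φ(z), 1·φ(z)⟫`
  have hcur := fun z : Site P j => integral_legs_cur C η w c m2 hw hm a b x x' z z Q
  have hint : ∀ z : Site P j, Integrable (fun φ : Cfg P j N => weight C η w c m2 (0 : VecField P j ℝ) φ *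
      (w * (⟪φ x, EuclideanSpace.basisFun (Fin N) ℝ a⟫_ℝ * ⟪φ x', EuclideanSpace.basisFun (Fin N) ℝ b⟫_ℝ *
        ⟪φ z, Q (φ z)⟫_ℝ))) := fun z =>
    ((((ExpGrowth.inner_apply x (EuclideanSpace.basisFun (Fin N) ℝ a)).mul
      (ExpGrowth.inner_apply x' (EuclideanSpace.basisFun (Fin N) ℝ b))).mul
      (ExpGrowth.inner_op_apply z z Q)).const_mul w).integrable C η w c m2 hw hm
  have hintm : ∀ z : Site P j, Integrable (fun φ : Cfg P j N => weight C η w c m2 (0 : VecField P j ℝ) φ *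
      (w * ⟪φ z, Q (φ z)⟫_ℝ)) := fun z =>
    ((ExpGrowth.inner_op_apply z z Q).const_mul w).integrable C η w c m2 hw hm
  -- ∫W₀ Σ∣φ∣²·legs
  have e1 : (fun φ : Cfg P j N => weight C η w c m2 (0 : VecField P j ℝ) φ * (massForm w φ * legs a b x x' φ)) =
      fun φ => ∑ z : Site P j, weight C η w c m2 (0 : VecField P j ℝ) φ *
        (w * (⟪φ x, EuclideanSpace.basisFun (Fin N) ℝ a⟫_ℝ * ⟪φ x', EuclideanSpace.basisFun (Fin N) ℝ b⟫_ℝ *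
          ⟪φ z, Q (φ z)⟫_ℝ)) := by
    funext φ
    simp only [massForm, legs, hQ, ContinuousLinearMap.coe_id', id_eq, real_inner_self_eq_norm_sq]
    rw [Finset.sum_mul, Finset.mul_sum]
    exact Finset.sum_congr rfl fun z _ => by ring
  have I1 : ∫ φ : Cfg P j N, weight C η w c m2 (0 : VecField P j ℝ) φ * (massForm w φ * legs a b x x' φ) =
      ∑ z : Site P j, w * ((∫ φ : Cfg P j N, weight C η w c m2 (0 : VecField P j ℝ) φ) *
        (G w c m2 x' x * ⟪EuclideanSpace.basisFun (Fin N) ℝ a, EuclideanSpace.basisFun (Fin N) ℝ b⟫_ℝ *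
            (G w c m2 z z * trE Q)
          + G w c m2 z x * G w c m2 z x' *
            ⟪EuclideanSpace.basisFun (Fin N) ℝ a, Q (EuclideanSpace.basisFun (Fin N) ℝ b)⟫_ℝ
          + G w c m2 z x * G w c m2 z x' *
            ⟪EuclideanSpace.basisFun (Fin N) ℝ b, Q (EuclideanSpace.basisFun (Fin N) ℝ a)⟫_ℝ)) := by
    rw [e1, integral_finsetSum _ fun z _ => hint z]
    refine Finset.sum_congr rfl fun z _ => ?_
    rw [← hcur z, ← integral_const_mul]
    exact integral_congr_ae (Filter.Eventually.of_forall fun φ => by ring)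
  -- ∫W₀ Σ∣φ∣²
  have e2 : (fun φ : Cfg P j N => weight C η w c m2 (0 : VecField P j ℝ) φ * massForm w φ) =
      fun φ => ∑ z : Site P j, weight C η w c m2 (0 : VecField P j ℝ) φ * (w * ⟪φ z, Q (φ z)⟫_ℝ) := by
    funext φ
    simp only [massForm, hQ, ContinuousLinearMap.coe_id', id_eq, real_inner_self_eq_norm_sq]
    rw [Finset.mul_sum]
  have I2 : ∫ φ : Cfg P j N, weight C η w c m2 (0 : VecField P j ℝ) φ * massForm w φ =
      ∑ z : Site P j, w * ((∫ φ : Cfg P j N, weight C η w c m2 (0 : VecField P j ℝ) φ) * (G w c m2 z z * trE Q)) := by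
    rw [e2, integral_finsetSum _ fun z _ => hintm z]
    refine Finset.sum_congr rfl fun z _ => ?_
    rw [← moment2_op C η w c m2 hw hm z z Q, ← integral_const_mul]
    exact integral_congr_ae (Filter.Eventually.of_forall fun φ => by ring)
  -- ∫W₀ legs
  have I3 : ∫ φ : Cfg P j N, weight C η w c m2 (0 : VecField P j ℝ) φ * legs a b x x' φ =
      (∫ φ : Cfg P j N, weight C η w c m2 (0 : VecField P j ℝ) φ) *
        (G w c m2 x x' * ⟪EuclideanSpace.basisFun (Fin N) ℝ a, EuclideanSpace.basisFun (Fin N) ℝ b⟫_ℝ) := by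
    simp only [legs]
    exact moment2 C η w c m2 hw hm x x' _ _
  rw [I1, I2, I3]
  simp only [hQ, ContinuousLinearMap.coe_id', id_eq]
  rw [G_symm w c m2 x' x, real_inner_comm (EuclideanSpace.basisFun (Fin N) ℝ a) (EuclideanSpace.basisFun (Fin N) ℝ b)]
  simp only [Finset.mul_sum, Finset.sum_mul]
  rw [← Finset.sum_sub_distrib]
  refine Finset.sum_congr rfl fun z _ => ?_
  rw [G_symm w c m2 z x']
  ring

/-- at `e = 0` a joint integral of a scalar observable factorizes off the vector-field partition function `Z_A = ∫W_A`
(BRICK 7's `J_zero`, Fubini). [cite: Balaban1983Higgs3, (1.20) p.416] -/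
theorem integral_J_zero_mul (g : Cfg P j N → ℝ) :
    ∫ p : JCfg P j N, J C η w c m2 μ2 0 p * g p.2 =
      (∫ A : Cfg P j P.d, WA η w c μ2 A * (1 : ℝ)) *
        ∫ φ : Cfg P j N, weight C η w c m2 (0 : VecField P j ℝ) φ * g φ := by
  rw [← integral_prod_WA_W0 C η w c m2 μ2 (fun _ => (1 : ℝ)) g]
  exact integral_congr_ae (Filter.Eventually.of_forall fun p => by dsimp only; rw [J_zero]; ring)

/-- the connected mass insertion on the JOINT free measure at `e = 0` (the vector field integrates out):
`Z·∫e^{−S_0}(Σ_zη^d∣φ(z)∣²)φ_aφ_b − N·∫e^{−S_0}Σ_zη^d∣φ(z)∣² = Z²·δ_{ab}·2Σ_zη^dC₀(x′,z)C₀(z,x)`.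
[cite: Balaban1983Higgs3, (1.7) p.413, (1.21) p.416] -/
theorem cov_massForm_legs_J (hw : 0 < w) (hm : 0 < m2) (a b : Fin N) (x x' : Site P j) :
    (∫ p : JCfg P j N, J C η w c m2 μ2 0 p * (massForm w p.2 * legs a b x x' p.2)) *
        (∫ p : JCfg P j N, J C η w c m2 μ2 0 p * (1 : ℝ))
      - (∫ p : JCfg P j N, J C η w c m2 μ2 0 p * legs a b x x' p.2) *
        (∫ p : JCfg P j N, J C η w c m2 μ2 0 p * (massForm w p.2 * (1 : ℝ))) =
      (∫ p : JCfg P j N, J C η w c m2 μ2 0 p * (1 : ℝ)) ^ 2 *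
        (⟪EuclideanSpace.basisFun (Fin N) ℝ a, EuclideanSpace.basisFun (Fin N) ℝ b⟫_ℝ *
          (2 * ∑ z : Site P j, w * (G w c m2 x' z * G w c m2 z x))) := by
  have h := cov_massForm_legs C η w c m2 hw hm a b x x'
  have r1 : ∫ p : JCfg P j N, J C η w c m2 μ2 0 p * (massForm w p.2 * legs a b x x' p.2) =
      (∫ A : Cfg P j P.d, WA η w c μ2 A * (1 : ℝ)) *
        ∫ φ : Cfg P j N, weight C η w c m2 (0 : VecField P j ℝ) φ * (massForm w φ * legs a b x x' φ) :=
    integral_J_zero_mul C η w c m2 μ2 (fun φ => massForm w φ * legs a b x x' φ)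
  have r2 : ∫ p : JCfg P j N, J C η w c m2 μ2 0 p * (1 : ℝ) =
      (∫ A : Cfg P j P.d, WA η w c μ2 A * (1 : ℝ)) * ∫ φ : Cfg P j N, weight C η w c m2 (0 : VecField P j ℝ) φ * (1 : ℝ) :=
    integral_J_zero_mul C η w c m2 μ2 (fun _ => (1 : ℝ))
  have r3 : ∫ p : JCfg P j N, J C η w c m2 μ2 0 p * legs a b x x' p.2 =
      (∫ A : Cfg P j P.d, WA η w c μ2 A * (1 : ℝ)) *
        ∫ φ : Cfg P j N, weight C η w c m2 (0 : VecField P j ℝ) φ * legs a b x x' φ :=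
    integral_J_zero_mul C η w c m2 μ2 (legs a b x x')
  have r4 : ∫ p : JCfg P j N, J C η w c m2 μ2 0 p * (massForm w p.2 * (1 : ℝ)) =
      (∫ A : Cfg P j P.d, WA η w c μ2 A * (1 : ℝ)) *
        ∫ φ : Cfg P j N, weight C η w c m2 (0 : VecField P j ℝ) φ * (massForm w φ * (1 : ℝ)) :=
    integral_J_zero_mul C η w c m2 μ2 (fun φ => massForm w φ * (1 : ℝ))
  rw [r1, r2, r3, r4]
  simp only [mul_one]
  linear_combination (∫ A : Cfg P j P.d, WA η w c μ2 A) ^ 2 * h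

/-- **MAIN THEOREM — THE ORDER-`e²` COEFFICIENT OF (1.19) WITH THE COUNTERTERM INSERTED IN (1.20).** For every counterterm
`δm² = ct(e)`, `C²` near `e = 0` with `ct(0) = ct′(0) = 0` — print p. 417: *"we write δm² = Σ_{2≤α+2β≤4}e^αλ^βδm²_{(α,β)} and we
insert this into Σ^ε"*, here at `λ = 0` —
**`d²/de²∣₀ G^{ct}_{ab}(x,x′) = d²/de²∣₀ G_{ab}(x,x′) − ct″(0)·δ_{ab}·Σ_zη^dC₀(x′,z)C₀(z,x)`**:
BRICK 7's order-`e²` coefficient (② + ④ and the `Σ₁/Σ₂` companions) PLUS the `n = 1` term `C₀(−δm²)C₀` of (1.21) at order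
`e²`, `δm²∣_{e²} = ct″(0)/2 = δm²_{(2,0)}` — the letter `−δm²` of the bracket of (1.21), DERIVED from (1.19)/(1.20) (only
`δm²_{(2,0)}` of the inserted series enters at this order; `Σ_zη^dC₀(x′,z)C₀(z,x)` = BRICK 8's `Gins`).
[cite: Balaban1983Higgs3, (1.19)–(1.21) p.416, (1.23) p.417] -/
theorem iteratedDeriv_two_twoPt_massCurve (hw : 0 < w) (hm : 0 < m2) (hμ : 0 < μ2) (a b : Fin N) (x x' : Site P j)
    {ct ct' ct'' : ℝ → ℝ} (hd : ∀ e, HasDerivAt ct (ct' e) e) (hd' : ∀ e, HasDerivAt ct' (ct'' e) e)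
    (hc'' : ContinuousAt ct'' 0) (h0 : ct 0 = 0) (h0' : ct' 0 = 0) :
    iteratedDeriv 2 (fun e => twoPt C η w c (m2 + ct e) μ2 e a b x x') 0 =
      iteratedDeriv 2 (fun e => twoPt C η w c m2 μ2 e a b x x') 0
        - ct'' 0 * (⟪EuclideanSpace.basisFun (Fin N) ℝ a, EuclideanSpace.basisFun (Fin N) ℝ b⟫_ℝ *
            ∑ z : Site P j, w * (G w c m2 x' z * G w c m2 z x)) := by
  rw [iteratedDeriv_two_twoPt_massCurve_raw C η w c m2 μ2 hw hm hμ a b x x' hd hd' hc'' h0 h0',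
    iteratedDeriv_two_twoPt C η w c m2 μ2 hw hm hμ a b x x']
  have hmF := expGrowth_massForm (P := P) (j := j) (N := N) w
  have iDl := (hasDerivAt_integral_D1_J_mul C η w c m2 μ2 hw hm hμ (expGrowth_legs a b x x') 0).1
  have iDo := (hasDerivAt_integral_D1_J_mul (P := P) (j := j) C η w c m2 μ2 hw hm hμ (ExpGrowth.const (1 : ℝ)) 0).1
  have iml := integrable_J_mul C η w c m2 μ2 hw hm hμ (hmF.mul (expGrowth_legs a b x x')) 0
  have imo := integrable_J_mul (P := P) (j := j) C η w c m2 μ2 hw hm hμ (hmF.mul (ExpGrowth.const (1 : ℝ))) 0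
  have hsplitN : ∫ p : JCfg P j N, (D2 C η w c 0 (toVec p.1) p.2 - 1 / 2 * ct'' 0 * massForm w p.2) *
        J C η w c m2 μ2 0 p * legs a b x x' p.2 =
      (∫ p : JCfg P j N, D2 C η w c 0 (toVec p.1) p.2 * J C η w c m2 μ2 0 p * legs a b x x' p.2)
        - 1 / 2 * ct'' 0 * ∫ p : JCfg P j N, J C η w c m2 μ2 0 p * (massForm w p.2 * legs a b x x' p.2) := by
    rw [← integral_const_mul, ← integral_sub iDl (iml.const_mul _)]
    exact integral_congr_ae (Filter.Eventually.of_forall fun p => by ring)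
  have hsplitZ : ∫ p : JCfg P j N, (D2 C η w c 0 (toVec p.1) p.2 - 1 / 2 * ct'' 0 * massForm w p.2) *
        J C η w c m2 μ2 0 p * (1 : ℝ) =
      (∫ p : JCfg P j N, D2 C η w c 0 (toVec p.1) p.2 * J C η w c m2 μ2 0 p * (1 : ℝ))
        - 1 / 2 * ct'' 0 * ∫ p : JCfg P j N, J C η w c m2 μ2 0 p * (massForm w p.2 * (1 : ℝ)) := by
    rw [← integral_const_mul, ← integral_sub iDo (imo.const_mul _)]
    exact integral_congr_ae (Filter.Eventually.of_forall fun p => by ring)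
  rw [hsplitN, hsplitZ]
  have hcov := cov_massForm_legs_J C η w c m2 μ2 hw hm a b x x'
  have hZ0 : (∫ p : JCfg P j N, J C η w c m2 μ2 0 p * (1 : ℝ)) ≠ 0 := by
    simp only [mul_one]
    exact (integral_J_pos C η w c m2 μ2 hw hm hμ 0).ne'
  set Z0 : ℝ := ∫ p : JCfg P j N, J C η w c m2 μ2 0 p * (1 : ℝ) with hZ0def
  set A : ℝ := ∫ p : JCfg P j N, D2 C η w c 0 (toVec p.1) p.2 * J C η w c m2 μ2 0 p * legs a b x x' p.2 with hA
  set Bz : ℝ := ∫ p : JCfg P j N, D2 C η w c 0 (toVec p.1) p.2 * J C η w c m2 μ2 0 p * (1 : ℝ) with hBz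
  set N0 : ℝ := ∫ p : JCfg P j N, J C η w c m2 μ2 0 p * legs a b x x' p.2 with hN0
  set I1 : ℝ := ∫ p : JCfg P j N, J C η w c m2 μ2 0 p * (massForm w p.2 * legs a b x x' p.2) with hI1
  set I4 : ℝ := ∫ p : JCfg P j N, J C η w c m2 μ2 0 p * (massForm w p.2 * (1 : ℝ)) with hI4
  set S : ℝ := ∑ z : Site P j, w * (G w c m2 x' z * G w c m2 z x) with hS
  set ip : ℝ := ⟪EuclideanSpace.basisFun (Fin N) ℝ a, EuclideanSpace.basisFun (Fin N) ℝ b⟫_ℝ with hip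
  have key : (A - 1 / 2 * ct'' 0 * I1) * Z0 - N0 * (Bz - 1 / 2 * ct'' 0 * I4) =
      (A * Z0 - N0 * Bz) - 1 / 2 * ct'' 0 * (Z0 ^ 2 * (ip * (2 * S))) := by
    linear_combination (-(1 / 2 : ℝ) * ct'' 0) * hcov
  rw [key]
  field_simp


/-! ## §7 THE STRUCTURE (1.21) AT ORDER `e²` WITH ALL FIVE LETTERS: `C₀[(−δm²) + Σ + ∂*Σ₁ + Σ₁*∂ + ∂*Σ₂∂]C₀` — the new
letter `−δm²∣_{e²} = −(ct″(0)/2)e²` is p26's `delta` kernel between two free propagators -/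

omit C η μ2 in
/-- **the `−δm²` letter is a `δ^ε` kernel between two free propagators**: for a constant `r`,
`Σ_{y,y′}η^{2d}C₀(x,y)·(r·δ^η(y−y′))·C₀(y′,x′) = r·Σ_zη^dC₀(x′,z)C₀(z,x)` (`δ^η = η^{−d}𝟙`, p26's `delta`; `C₀` symmetric).
[cite: Balaban1983Higgs3, (1.21)–(1.22) p.416] -/
theorem sum_G_delta_G (hw : w ≠ 0) (r : ℝ) (x x' : Site P j) :
    ∑ y : Site P j, ∑ y' : Site P j, w * w * (G w c m2 x y * (r * delta w y y') * G w c m2 y' x') =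
      r * ∑ z : Site P j, w * (G w c m2 x' z * G w c m2 z x) := by
  have hin : ∀ y : Site P j, ∑ y' : Site P j, w * w * (G w c m2 x y * (r * delta w y y') * G w c m2 y' x') =
      w * (r * (G w c m2 x y * G w c m2 y x')) := by
    intro y
    simp only [delta, mul_ite, mul_zero, ite_mul, zero_mul, Finset.sum_ite_eq, Finset.mem_univ, if_true]
    field_simp
  rw [Finset.sum_congr rfl fun y _ => hin y, Finset.mul_sum]
  exact Finset.sum_congr rfl fun y _ => by rw [G_symm w c m2 x y, G_symm w c m2 y x']; ring

/-- **THE ORDER-`e²` TERM OF (1.19) WITH THE COUNTERTERM HAS THE STRUCTURE OF THE `n = 1` TERM OF (1.21) WITH ALL FIVE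
LETTERS.** In BRICK 7's setting (`cη = 1`, Feynman gauge; p26's (1.22)-data `D` with `D.e = e`, `D.q2 = (q²)_{ab}`, `D.C0 = C₀`,
`D.C = C^ε`, `D.w = η^d`, `D.c = c`) and for a counterterm curve `ct` as in §6:
`(e²/2)·d²/de²∣₀G^{ct}_{ab}(x,x′) = Σ_{y,y′}η^{2d}C₀(x,y)[−(ct″(0)/2)e²·δ_{ab}·δ^ε + sig2 D + sig4 D](y,y′)C₀(y′,x′) + Σ_{y,y′,μ}η^{2d}[
(∂_μC₀)(y,x)Σ₁,μ(y,y′)C₀(y′,x′) + C₀(x,y)Σ₁,μ(y′,y)(∂_μC₀)(y′,x′) + (∂_μC₀)(y,x)Σ₂(y,y′)(∂_μC₀)(y′,x′)]` — BRICK 7's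
`secondOrder_eq_structure121` (② + ④ = `Σ^ε∣_{e²}`, `Σ₁,μ = sgOne`, `Σ₂ = sgTwo`) with, NEW, the `−δm²` letter at order `e²`:
`δm²∣_{e²} = (ct″(0)/2)e² = e²δm²_{(2,0)}`. [cite: Balaban1983Higgs3, (1.21)–(1.22) p.416, (1.23) p.417] -/
theorem secondOrder_massCurve_eq_structure121 (hw : 0 < w) (hm : 0 < m2) (hμ : 0 < μ2) (hcη : c * η = 1) (e : ℝ)
    (a b : Fin N) (D : SEData P j) (he : D.e = e)
    (hq : D.q2 = ⟪EuclideanSpace.basisFun (Fin N) ℝ a, C.q (C.q (EuclideanSpace.basisFun (Fin N) ℝ b))⟫_ℝ)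
    (hC0 : D.C0 = G w c m2) (hC : D.C = G w c μ2) (hwD : D.w = w) (hcD : D.c = c)
    {ct ct' ct'' : ℝ → ℝ} (hd : ∀ e, HasDerivAt ct (ct' e) e) (hd' : ∀ e, HasDerivAt ct' (ct'' e) e)
    (hc'' : ContinuousAt ct'' 0) (h0 : ct 0 = 0) (h0' : ct' 0 = 0) (x x' : Site P j) :
    e ^ 2 / 2 * iteratedDeriv 2 (fun s => twoPt C η w c (m2 + ct s) μ2 s a b x x') 0 =
      (∑ y : Site P j, ∑ y' : Site P j, w * w * (G w c m2 x y *
          (sig2 D y y' + sig4 D y y'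
            + (-(ct'' 0 / 2 * e ^ 2) *
                ⟪EuclideanSpace.basisFun (Fin N) ℝ a, EuclideanSpace.basisFun (Fin N) ℝ b⟫_ℝ) * delta w y y') *
          G w c m2 y' x'))
      + ∑ y : Site P j, ∑ y' : Site P j, ∑ μ : Fin P.d, w * w *
          (d1Kernel c μ (G w c m2) y x *
              sgOne η w c m2 μ2 e ⟪EuclideanSpace.basisFun (Fin N) ℝ a, C.q (C.q (EuclideanSpace.basisFun (Fin N) ℝ b))⟫_ℝ
                μ y y' * G w c m2 y' x'
            + G w c m2 x y *
              sgOne η w c m2 μ2 e ⟪EuclideanSpace.basisFun (Fin N) ℝ a, C.q (C.q (EuclideanSpace.basisFun (Fin N) ℝ b))⟫_ℝ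
                μ y' y * d1Kernel c μ (G w c m2) y' x'
            + d1Kernel c μ (G w c m2) y x *
              sgTwo w c m2 μ2 e ⟪EuclideanSpace.basisFun (Fin N) ℝ a, C.q (C.q (EuclideanSpace.basisFun (Fin N) ℝ b))⟫_ℝ
                y y' * d1Kernel c μ (G w c m2) y' x') := by
  rw [iteratedDeriv_two_twoPt_massCurve C η w c m2 μ2 hw hm hμ a b x x' hd hd' hc'' h0 h0', mul_sub,
    secondOrder_eq_structure121 C η w c m2 μ2 hw hm hμ hcη e a b D he hq hC0 hC hwD hcD x x']
  have hsplit : (∑ y : Site P j, ∑ y' : Site P j, w * w * (G w c m2 x y *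
          (sig2 D y y' + sig4 D y y'
            + (-(ct'' 0 / 2 * e ^ 2) *
                ⟪EuclideanSpace.basisFun (Fin N) ℝ a, EuclideanSpace.basisFun (Fin N) ℝ b⟫_ℝ) * delta w y y') *
          G w c m2 y' x')) =
      (∑ y : Site P j, ∑ y' : Site P j, w * w * (G w c m2 x y * (sig2 D y y' + sig4 D y y') * G w c m2 y' x'))
        + ∑ y : Site P j, ∑ y' : Site P j, w * w * (G w c m2 x y *
            ((-(ct'' 0 / 2 * e ^ 2) *
                ⟪EuclideanSpace.basisFun (Fin N) ℝ a, EuclideanSpace.basisFun (Fin N) ℝ b⟫_ℝ) * delta w y y') *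
            G w c m2 y' x') := by
    rw [← Finset.sum_add_distrib]
    refine Finset.sum_congr rfl fun y _ => ?_
    rw [← Finset.sum_add_distrib]
    exact Finset.sum_congr rfl fun y' _ => by ring
  rw [hsplit, sum_G_delta_G w c m2 hw.ne']
  ring

omit C η μ2 in
/-- `kernelOp` is additive in the kernel. [cite: Balaban1983Higgs3, (3.9) p.435] -/
theorem kernelOp_add_kernel (K K' : Kernel P j) (f : SiteField P j ℝ) (x : Site P j) :
    kernelOp w (fun y y' => K y y' + K' y y') f x = kernelOp w K f x + kernelOp w K' f x := by
  simp only [kernelOp, ← Finset.sum_add_distrib]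
  exact Finset.sum_congr rfl fun _ _ => by ring

omit C η μ2 in
/-- `kernelOp` is additive in the function. [cite: Balaban1983Higgs3, (3.9) p.435] -/
theorem kernelOp_add_fun (K : Kernel P j) (f g : SiteField P j ℝ) (x : Site P j) :
    kernelOp w K (fun y => f y + g y) x = kernelOp w K f x + kernelOp w K g x := by
  simp only [kernelOp, ← Finset.sum_add_distrib]
  exact Finset.sum_congr rfl fun _ _ => by ring

omit C η μ2 in
/-- **the `−δm²` letter as an operator**: the kernel `r·Σ_zη^dC₀(x′,z)C₀(z,x)` acts as `C₀∘(r·)∘C₀` — the `n = 1` term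
`C₀(−δm²)C₀` of (1.21) with `−δm² = r`. [cite: Balaban1983Higgs3, (1.21) p.416] -/
theorem kernelOp_G_const_G (r : ℝ) (f : SiteField P j ℝ) (x : Site P j) :
    kernelOp w (fun y y' => r * ∑ z : Site P j, w * (G w c m2 y' z * G w c m2 z y)) f x =
      kernelOp w (G w c m2) (fun z => r * kernelOp w (G w c m2) f z) x := by
  simp only [kernelOp, Finset.mul_sum, Finset.sum_mul]
  rw [Finset.sum_comm]
  refine Finset.sum_congr rfl fun z _ => Finset.sum_congr rfl fun y' _ => ?_
  rw [G_symm w c m2 y' z, G_symm w c m2 z x]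
  ring

/-- **(1.21) AT ORDER `e²` AS OPERATORS, WITH THE COUNTERTERM.** In r15's vocabulary (`kernelOp η^d K`, `pdiff`/`pdiffAdj` =
`∂^η_μ`/`∂^{η*}_μ`), for every test function `f`:
`(e²/2)G^{ct}″(0) f = C₀[(−δm²∣_{e²})·(C₀f) + Σ(C₀f) + Σ_μ(∂^{η*}_μΣ₁,μ(C₀f) + Σ₁,μ^*∂^η_μ(C₀f) + ∂^{η*}_μΣ₂∂^η_μ(C₀f))]`,
`δm²∣_{e²} = (ct″(0)/2)e²·δ_{ab}` — the `n = 1` term `C₀^ε[(−δm² + Σ^ε + ∂^{ε*}Σ₁^ε + Σ₁^{ε*}∂^ε + ∂^{ε*}Σ₂^ε∂^ε)C₀^ε]` of (1.21) at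
order `e²λ⁰`, ALL FIVE LETTERS DERIVED from (1.19)/(1.20) (BRICK 7's `secondOrder_structure121_op` supplied the four `Σ`-letters at
`δm² = 0`). [cite: Balaban1983Higgs3, (1.21) p.416, (1.23) p.417] -/
theorem secondOrder_massCurve_structure121_op (hw : 0 < w) (hm : 0 < m2) (hμ : 0 < μ2) (hcη : c * η = 1) (e : ℝ)
    (a b : Fin N) (D : SEData P j) (he : D.e = e)
    (hq : D.q2 = ⟪EuclideanSpace.basisFun (Fin N) ℝ a, C.q (C.q (EuclideanSpace.basisFun (Fin N) ℝ b))⟫_ℝ)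
    (hC0 : D.C0 = G w c m2) (hC : D.C = G w c μ2) (hwD : D.w = w) (hcD : D.c = c)
    {ct ct' ct'' : ℝ → ℝ} (hd : ∀ e, HasDerivAt ct (ct' e) e) (hd' : ∀ e, HasDerivAt ct' (ct'' e) e)
    (hc'' : ContinuousAt ct'' 0) (h0 : ct 0 = 0) (h0' : ct' 0 = 0) (f : SiteField P j ℝ) :
    kernelOp w (fun x x' => e ^ 2 / 2 * iteratedDeriv 2 (fun s => twoPt C η w c (m2 + ct s) μ2 s a b x x') 0) f =
      kernelOp w (G w c m2)
        (fun y => (-(ct'' 0 / 2 * e ^ 2) *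
              ⟪EuclideanSpace.basisFun (Fin N) ℝ a, EuclideanSpace.basisFun (Fin N) ℝ b⟫_ℝ) *
            kernelOp w (G w c m2) f y
          + (kernelOp w (sig2 D + sig4 D) (kernelOp w (G w c m2) f) y
          + ∑ μ : Fin P.d,
            (pdiffAdj c μ (kernelOp w
                (sgOne η w c m2 μ2 e ⟪EuclideanSpace.basisFun (Fin N) ℝ a, C.q (C.q (EuclideanSpace.basisFun (Fin N) ℝ b))⟫_ℝ μ)
                (kernelOp w (G w c m2) f)) y
              + kernelOp w (fun y₁ y₂ =>
                  sgOne η w c m2 μ2 e ⟪EuclideanSpace.basisFun (Fin N) ℝ a, C.q (C.q (EuclideanSpace.basisFun (Fin N) ℝ b))⟫_ℝ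
                    μ y₂ y₁) (pdiff c μ (kernelOp w (G w c m2) f)) y
              + pdiffAdj c μ (kernelOp w
                  (sgTwo w c m2 μ2 e ⟪EuclideanSpace.basisFun (Fin N) ℝ a, C.q (C.q (EuclideanSpace.basisFun (Fin N) ℝ b))⟫_ℝ)
                  (pdiff c μ (kernelOp w (G w c m2) f))) y))) := by
  have hK := secondOrder_structure121_op C η w c m2 μ2 hw hm hμ hcη e a b D he hq hC0 hC hwD hcD f
  -- the kernel splits: BRICK 7's kernel plus the `−δm²` letter
  have hker : (fun x x' : Site P j => e ^ 2 / 2 * iteratedDeriv 2 (fun s => twoPt C η w c (m2 + ct s) μ2 s a b x x') 0) =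
      fun x x' => (e ^ 2 / 2 * iteratedDeriv 2 (fun s => twoPt C η w c m2 μ2 s a b x x') 0)
        + (-(ct'' 0 / 2 * e ^ 2) * ⟪EuclideanSpace.basisFun (Fin N) ℝ a, EuclideanSpace.basisFun (Fin N) ℝ b⟫_ℝ) *
          ∑ z : Site P j, w * (G w c m2 x' z * G w c m2 z x) := by
    funext x x'
    rw [iteratedDeriv_two_twoPt_massCurve C η w c m2 μ2 hw hm hμ a b x x' hd hd' hc'' h0 h0']
    ring
  funext x
  rw [hker, kernelOp_add_kernel, hK, kernelOp_G_const_G, ← kernelOp_add_fun]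
  refine Finset.sum_congr rfl fun y _ => ?_
  simp only [Pi.add_apply, Finset.sum_apply]
  ring


/-! ## §8 PRINT'S COUNTERTERM `δm² = e²δm²_{(2,0)}` (the weight-2, `β = 0` term of the inserted series): the quadratic curve -/

omit C η w c m2 μ2 in
/-- the quadratic counterterm curve `e ↦ δ·e²` and its derivative `2δe`. [folklore] -/
private theorem hasDerivAt_quadratic (δ e : ℝ) : HasDerivAt (fun s : ℝ => δ * s ^ 2) (δ * (2 * e)) e := by
  have h := (hasDerivAt_pow 2 e).const_mul δ
  simpa [pow_one] using h

omit C η w c m2 μ2 in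
/-- derivative of the linear function `e ↦ δ·(2e)`. [folklore] -/
private theorem hasDerivAt_quadratic' (δ e : ℝ) : HasDerivAt (fun s : ℝ => δ * (2 * s)) (δ * 2) e := by
  have h := ((hasDerivAt_id e).const_mul (2 : ℝ)).const_mul δ
  simpa using h

/-- **THE ORDER-`e²` COEFFICIENT OF (1.19) WITH PRINT'S COUNTERTERM `δm² = e²δm²_{(2,0)}` INSERTED IN (1.20)**:
`d²/de²∣₀G^{δm²}_{ab}(x,x′) = d²/de²∣₀G_{ab}(x,x′) − 2δm²_{(2,0)}·δ_{ab}·Σ_zη^dC₀(x′,z)C₀(z,x)`, i.e. the order-`e²` Taylor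
coefficient is BRICK 7's (② + ④ + companions) plus `C₀(−δm²_{(2,0)})C₀` — §6 at `ct(e) = δm²_{(2,0)}e²`.
[cite: Balaban1983Higgs3, (1.19)–(1.21) p.416, (1.23) p.417] -/
theorem iteratedDeriv_two_twoPt_quadraticCounterterm (hw : 0 < w) (hm : 0 < m2) (hμ : 0 < μ2) (δ : ℝ) (a b : Fin N)
    (x x' : Site P j) :
    iteratedDeriv 2 (fun e => twoPt C η w c (m2 + δ * e ^ 2) μ2 e a b x x') 0 =
      iteratedDeriv 2 (fun e => twoPt C η w c m2 μ2 e a b x x') 0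
        - 2 * δ * (⟪EuclideanSpace.basisFun (Fin N) ℝ a, EuclideanSpace.basisFun (Fin N) ℝ b⟫_ℝ *
            ∑ z : Site P j, w * (G w c m2 x' z * G w c m2 z x)) := by
  have h := iteratedDeriv_two_twoPt_massCurve C η w c m2 μ2 hw hm hμ a b x x' (ct := fun s => δ * s ^ 2)
    (ct' := fun s => δ * (2 * s)) (ct'' := fun _ => δ * 2) (hasDerivAt_quadratic δ) (hasDerivAt_quadratic' δ)
    continuousAt_const (by simp) (by simp)
  rw [h]
  ring

/-! ## §9 PRINT'S DEFINING EQUATIONS OF `δm²_{(α,β)}` (p. 417) FOR THE DERIVED WEIGHT-2 SELF-ENERGY —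
«−δm²_{(α,β)} + Σ_{x∈T_ε}ε^dΣ^ε_{(α,β)}(x) = 0» ⟺ the inserted counterterm is p26's typed (1.23) term -/

omit C η c m2 μ2 in
/-- **the row sum of `K + r·δ^ε` is `δm²_K + r`**: `Σ_{x′}ε^d[K(x,x′) + rδ^ε(x−x′)] = Σ_{x′}ε^dK(x,x′) + r` (r15's
`dm2Graph ε^d K x = Σ_{x′}ε^dK(x,x′)` = print's «δm²_G = Σ_{x′∈T_ε}ε^dΣ^ε_G(x−x′)»). [cite: Balaban1983Higgs3, (1.23) p.417] -/
theorem rowsum_add_delta (hw : w ≠ 0) (K : Kernel P j) (r : ℝ) (y : Site P j) :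
    ∑ y' : Site P j, w * (K y y' + r * delta w y y') = B3Sect1TwoPoint.dm2Graph w K y + r := by
  simp only [B3Sect1TwoPoint.dm2Graph, mul_add, Finset.sum_add_distrib]
  congr 1
  simp only [delta, mul_ite, mul_zero, Finset.sum_ite_eq, Finset.mem_univ, if_true]
  field_simp

/-- **PRINT'S EQUATION AT `(α,β) = (2,0)` FOR THE DERIVED SELF-ENERGY.** P. 417: *"The mass renormalization counterterm δm² is
chosen in such a way that −δm² + Σ^ε is convergent. … usually it is defined as a solution of the equation −δm² +
Σ_{x∈T_ε}ε^dΣ^ε(x) = 0. … The counterterms δm²_{(α,β)} are defined by the equations −δm²_{(α,β)} + Σ_{x∈T_ε}ε^dΣ^ε_{(α,β)}(x) =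
0."* By §7 the order-`e²` mass-type insertion of `G^{ct}` DERIVED from (1.19)/(1.20) is the kernel `K_{(2)} = −r·δ^ε + sig2 D +
sig4 D` between two free propagators, `r = δm²∣_{e²}·δ_{ab}` (`= (ct″(0)/2)e²δ_{ab}`, `= e²δm²_{(2,0)}` for print's counterterm; at
`a = b` the factor `δ_{ab}` is `1`). Print's equation for it — the vanishing of its row sums `Σ_{x′}ε^dK_{(2)}(x,x′)` («−δm² +
Σ_{x′}ε^dΣ^ε(x−x′)») — holds IF AND ONLY IF the inserted `r` is p26's typed (1.23) term ② + ④, `ct2 D + ct4 D` — the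
renormalization condition now attached to the derived two-point function, not only to the displayed formula.
[cite: Balaban1983Higgs3, (1.23) p.417] -/
theorem condition_20_iff (D : SEData P j) (hwD : D.w = w) (hw : w ≠ 0) (r : ℝ) :
    (∀ y : Site P j, ∑ y' : Site P j, w * ((sig2 D + sig4 D) y y' + (-r) * delta w y y') = 0) ↔
      ∀ y : Site P j, r = ct2 D y + ct4 D y := by
  refine forall_congr' fun y => ?_
  rw [rowsum_add_delta w hw, dm2Graph_add]
  simp only [ct2, ct4, hwD]
  constructor <;> intro h <;> linarith

/-- **THE SOLUTION `δm²_{(2,0)}e²` EXPLICITLY** (r15's request: the derived (2,0)-equation fixes the counterterm as a function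
of the lattice data): the equation holds iff `r = e²dC^ε(y,y)q² − e²Σ_{x′}ε^dΣ_μq²(∂^ε_μC^ε_0∂^{ε*}_μ)(y,x′)C^ε(y,x′)` for every
`y` — the second and fourth displayed terms of (1.23) (p26's `ct2_eq`, `ct4_eq`; `ε ≠ 0`; `C^ε(0)` = the diagonal value
`C^ε(y,y)`). [cite: Balaban1983Higgs3, (1.23) p.417] -/
theorem condition_20_iff_explicit (D : SEData P j) (hwD : D.w = w) (hw : w ≠ 0) (hε : D.ε ≠ 0) (r : ℝ) :
    (∀ y : Site P j, ∑ y' : Site P j, w * ((sig2 D + sig4 D) y y' + (-r) * delta w y y') = 0) ↔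
      ∀ y : Site P j, r = D.e ^ 2 * (P.d : ℝ) * D.C y y * D.q2
        + -(D.e ^ 2) * ∑ x' : Site P j, D.w * ∑ μ : Fin P.d, D.q2 * dKernel D.c μ D.C0 y x' * D.C y x' := by
  rw [condition_20_iff w D hwD hw r]
  refine forall_congr' fun y => ?_
  rw [ct2_eq D hε, ct4_eq D]

/-- **PRINT'S EQUATION AT `(α,β) = (0,1)` FOR THE DERIVED SELF-ENERGY** (the `e = 0` sector, §10 below derives the kernel
`−r·δ^ε + sig1 D` with `r = λδm²_{(0,1)}δ_{ab}`): the row sums of `−r·δ^ε + sig1 D` vanish iff `r` is p26's typed (1.23) term ①,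
`ct1 D` (`= −4(N+2)λC^ε_0(0)`). [cite: Balaban1983Higgs3, (1.23) p.417] -/
theorem condition_01_iff (D : SEData P j) (hwD : D.w = w) (hw : w ≠ 0) (r : ℝ) :
    (∀ y : Site P j, ∑ y' : Site P j, w * (sig1 D y y' + (-r) * delta w y y') = 0) ↔
      ∀ y : Site P j, r = ct1 D y := by
  refine forall_congr' fun y => ?_
  rw [rowsum_add_delta w hw]
  simp only [ct1, hwD]
  constructor <;> intro h <;> linarith

/-- the `(0,1)` solution explicitly: `r = −4(N+2)λC^ε_0(y,y)` (p26's `ct1_eq`). [cite: Balaban1983Higgs3, (1.23) p.417] -/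
theorem condition_01_iff_explicit (D : SEData P j) (hwD : D.w = w) (hw : w ≠ 0) (hε : D.ε ≠ 0) (r : ℝ) :
    (∀ y : Site P j, ∑ y' : Site P j, w * (sig1 D y y' + (-r) * delta w y y') = 0) ↔
      ∀ y : Site P j, r = -4 * ((D.N : ℝ) + 2) * D.lam * D.C0 y y := by
  rw [condition_01_iff w D hwD hw r]
  refine forall_congr' fun y => ?_
  rw [ct1_eq D hε]

/-- **«δm²₁ denote a sum of terms δm²_{(α,β)} of the order α + 2β = 2»** (p. 417) RECOVERED AS THE SOLUTION: if the inserted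
weight-2 counterterms `r₁ = λδm²_{(0,1)}`, `r₂ = e²δm²_{(2,0)}` satisfy print's two weight-2 equations for the DERIVED
self-energies, then `r₁ + r₂` is p26's typed `dm2One D = ct1 D + ct2 D + ct4 D` (the weight-2 index set is `{(0,1),(2,0)}`,
p26's `idx123_filter_le_two`). [cite: Balaban1983Higgs3, (1.23) p.417] -/
theorem dm2One_eq_of_conditions (D : SEData P j) (hwD : D.w = w) (hw : w ≠ 0) {r₁ r₂ : ℝ}
    (h01 : ∀ y : Site P j, ∑ y' : Site P j, w * (sig1 D y y' + (-r₁) * delta w y y') = 0)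
    (h20 : ∀ y : Site P j, ∑ y' : Site P j, w * ((sig2 D + sig4 D) y y' + (-r₂) * delta w y y') = 0)
    (y : Site P j) : r₁ + r₂ = dm2One D y := by
  rw [dm2One, (condition_01_iff w D hwD hw r₁).mp h01 y, (condition_20_iff w D hwD hw r₂).mp h20 y]
  ring

/-- **CONVERSELY, p26's `dm2One` SOLVES THE DERIVED WEIGHT-2 EQUATIONS** (print: *"This equation can be solved recursively"* —
the weight-2 step): with `r₁ = ct1 D y₀`, `r₂ = ct2 D y₀ + ct4 D y₀` (any base point `y₀`; the counterterms are constants for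
translation-invariant propagators, p26's `ct_const`) both row-sum equations hold at `y₀`.
[cite: Balaban1983Higgs3, (1.23) p.417] -/
theorem conditions_at_dm2One (D : SEData P j) (hwD : D.w = w) (hw : w ≠ 0) (y₀ : Site P j) :
    (∑ y' : Site P j, w * (sig1 D y₀ y' + (-ct1 D y₀) * delta w y₀ y') = 0) ∧
      ∑ y' : Site P j, w * ((sig2 D + sig4 D) y₀ y' + (-(ct2 D y₀ + ct4 D y₀)) * delta w y₀ y') = 0 := by
  refine ⟨?_, ?_⟩
  · rw [rowsum_add_delta w hw]
    simp only [ct1, hwD]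
    ring
  · rw [rowsum_add_delta w hw, dm2Graph_add]
    simp only [ct2, ct4, hwD]
    ring


/-! ## §10 THE `λ`-DIRECTION, `(α,β) = (0,1)`, AT `e = 0`: the counterterm `λδm²_{(0,1)}` inserted in the `λ∣φ∣⁴` two-point
function of BRICK 1 (`B3Eq122FirstOrderWick`), the right-derivative at `λ = 0⁺` -/

/-- **THE COUNTERTERM IS A MASS SHIFT, `λ`-direction**: (1.20) at `e = 0` with `δm² = λδ₁` —
`e^{−½⟨φ,(−Δ^η+m²)φ⟩}·e^{−λ[Σ_yη^d∣φ(y)∣⁴ + ½δ₁Σ_yη^d∣φ(y)∣²]} = e^{−½⟨φ,(−Δ^η+m²+λδ₁)φ⟩}·e^{−λΣ_yη^d∣φ(y)∣⁴}`: BRICK 1's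
integrand at the running mass `m² + λδm²_{(0,1)}`. [cite: Balaban1983Higgs3, (1.20) p.416, (1.23) p.417] -/
theorem weight_mul_exp_massCurve (lam δ₁ : ℝ) (φ : Cfg P j N) :
    weight C η w c m2 (0 : VecField P j ℝ) φ *
        Real.exp (-(lam * ((∑ y : Site P j, w * ‖φ y‖ ^ 4) + 1 / 2 * δ₁ * massForm w φ))) =
      weight C η w c (m2 + lam * δ₁) (0 : VecField P j ℝ) φ * Real.exp (-(lam * ∑ y : Site P j, w * ‖φ y‖ ^ 4)) := by
  rw [weight_mass_add, mul_assoc (weight C η w c m2 _ φ), ← Real.exp_add]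
  congr 1
  congr 1
  ring

omit C η c m2 μ2 in
/-- the shifted interaction per unit `λ`, `Σ_yη^d(∣φ(y)∣⁴ + ½δ₁∣φ(y)∣²)`, is bounded below (`t⁴ + ½δ₁t² ≥ −δ₁²/16`) — the
hypothesis of BRICK 1's one-sided dominated differentiation `hasDerivWithinAt_gaussInt_exp_neg_of_le` for the interaction of (1.20) with
the counterterm `λδm²_{(0,1)}`. [cite: Balaban1983Higgs3, (1.20) p.416] -/
theorem neg_le_V_massCurve (hw : 0 ≤ w) (δ₁ : ℝ) (φ : Cfg P j N) :
    -(Fintype.card (Site P j) * w * (δ₁ ^ 2 / 16)) ≤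
      (∑ y : Site P j, w * ‖φ y‖ ^ 4) + 1 / 2 * δ₁ * massForm w φ := by
  unfold massForm
  have hy : ∀ y : Site P j, -(w * (δ₁ ^ 2 / 16)) ≤ w * ‖φ y‖ ^ 4 + 1 / 2 * δ₁ * (w * ‖φ y‖ ^ 2) := fun y => by
    have h : 0 ≤ w * (‖φ y‖ ^ 2 + δ₁ / 4) ^ 2 := mul_nonneg hw (sq_nonneg _)
    nlinarith
  calc -(Fintype.card (Site P j) * w * (δ₁ ^ 2 / 16)) = ∑ _y : Site P j, -(w * (δ₁ ^ 2 / 16)) := by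
        rw [Finset.sum_const, Finset.card_univ, nsmul_eq_mul]; ring
    _ ≤ ∑ y : Site P j, (w * ‖φ y‖ ^ 4 + 1 / 2 * δ₁ * (w * ‖φ y‖ ^ 2)) := Finset.sum_le_sum fun y _ => hy y
    _ = (∑ y : Site P j, w * ‖φ y‖ ^ 4) + 1 / 2 * δ₁ * ∑ y : Site P j, w * ‖φ y‖ ^ 2 := by
        rw [Finset.sum_add_distrib, Finset.mul_sum]

/-- **FIRST-ORDER PERTURBATION THEORY IN `λ` WITH THE COUNTERTERM `λδm²_{(0,1)}` INSERTED** (`e = 0`): the two-point function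
`G_λ,ab(x,x′) = ∫We^{−λ[V+½δ₁Σ∣φ∣²]}φ_a(x)φ_b(x′)/∫We^{−λ[V+½δ₁Σ∣φ∣²]}`, `V = Σ_yη^d∣φ(y)∣⁴`, `λ ≥ 0`, is right-differentiable at
`λ = 0⁺` with derivative `−δ_{ab}[4(N+2)Σ_yη^dC₀(y,y)C₀(x,y)C₀(x′,y) + δ₁Σ_zη^dC₀(x′,z)C₀(z,x)]` — BRICK 1's tadpole ① PLUS the
mass insertion `C₀(−δm²_{(0,1)})C₀`: the `n = 1` term of (1.21) at order `λ` with the letters `−δm²` and `Σ^ε`.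
[cite: Balaban1983Higgs3, (1.19)–(1.22) p.416, (1.23) p.417] [cite: GlimmJaffeQP1987, §8.4–8.5] -/
theorem hasDerivWithinAt_twoPointPhi4_massCurve (hw : 0 < w) (hm : 0 < m2) (δ₁ : ℝ) (a b : Fin N) (x x' : Site P j) :
    HasDerivWithinAt
      (fun lam : ℝ => (∫ φ : Cfg P j N, weight C η w c m2 (0 : VecField P j ℝ) φ *
          (Real.exp (-(lam * ((∑ y : Site P j, w * ‖φ y‖ ^ 4) + 1 / 2 * δ₁ * massForm w φ))) *
            (⟪φ x, EuclideanSpace.basisFun (Fin N) ℝ a⟫_ℝ * ⟪φ x', EuclideanSpace.basisFun (Fin N) ℝ b⟫_ℝ))) /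
        ∫ φ : Cfg P j N, weight C η w c m2 (0 : VecField P j ℝ) φ *
          (Real.exp (-(lam * ((∑ y : Site P j, w * ‖φ y‖ ^ 4) + 1 / 2 * δ₁ * massForm w φ))) * 1))
      (-(⟪EuclideanSpace.basisFun (Fin N) ℝ a, EuclideanSpace.basisFun (Fin N) ℝ b⟫_ℝ *
        (4 * (N + 2) * ∑ y : Site P j, w * (G w c m2 y y * (G w c m2 x y * G w c m2 x' y))
          + δ₁ * ∑ z : Site P j, w * (G w c m2 x' z * G w c m2 z x))))
      (Set.Ici 0) 0 := by
  have hV : ExpGrowth (fun φ : Cfg P j N => (∑ y : Site P j, w * ‖φ y‖ ^ 4) + 1 / 2 * δ₁ * massForm w φ) :=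
    (B3Eq122FirstOrderWick.expGrowth_V w).add ((expGrowth_massForm (P := P) (j := j) (N := N) w).const_mul (1 / 2 * δ₁))
  have hVK := neg_le_V_massCurve (P := P) (j := j) (N := N) w hw.le δ₁
  have hF := B3Eq122FirstOrderWick.expGrowth_legs (P := P) (j := j) (N := N) a b x x'
  have hnum := B3Eq122FirstOrderWick.hasDerivWithinAt_gaussInt_exp_neg_of_le C η w c m2 hw hm hV hVK hF
  have hden := B3Eq122FirstOrderWick.hasDerivWithinAt_gaussInt_exp_neg_of_le C η w c m2 hw hm hV hVK
    (ExpGrowth.const (1 : ℝ))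
  have hZ : 0 < ∫ φ : Cfg P j N, weight C η w c m2 (0 : VecField P j ℝ) φ := B3WT226Traces.Z_pos C η w c m2 hw hm
  have hden0 : (∫ φ : Cfg P j N, weight C η w c m2 (0 : VecField P j ℝ) φ *
      (Real.exp (-(0 * ((∑ y : Site P j, w * ‖φ y‖ ^ 4) + 1 / 2 * δ₁ * massForm w φ))) * 1)) =
      ∫ φ : Cfg P j N, weight C η w c m2 (0 : VecField P j ℝ) φ :=
    integral_congr_ae (Filter.Eventually.of_forall fun φ => by
      simp only [zero_mul, neg_zero, Real.exp_zero, mul_one])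
  have hnum0 : (∫ φ : Cfg P j N, weight C η w c m2 (0 : VecField P j ℝ) φ *
      (Real.exp (-(0 * ((∑ y : Site P j, w * ‖φ y‖ ^ 4) + 1 / 2 * δ₁ * massForm w φ))) *
        (⟪φ x, EuclideanSpace.basisFun (Fin N) ℝ a⟫_ℝ * ⟪φ x', EuclideanSpace.basisFun (Fin N) ℝ b⟫_ℝ))) =
      ∫ φ : Cfg P j N, weight C η w c m2 (0 : VecField P j ℝ) φ *
        (⟪φ x, EuclideanSpace.basisFun (Fin N) ℝ a⟫_ℝ * ⟪φ x', EuclideanSpace.basisFun (Fin N) ℝ b⟫_ℝ) :=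
    integral_congr_ae (Filter.Eventually.of_forall fun φ => by
      simp only [zero_mul, neg_zero, Real.exp_zero, one_mul])
  have h := hnum.div hden (by rw [hden0]; exact hZ.ne')
  refine h.congr_deriv ?_
  rw [hden0, hnum0]
  -- split the shifted interaction
  have hV4 := B3Eq122FirstOrderWick.expGrowth_V (P := P) (j := j) (N := N) w
  have hmF := expGrowth_massForm (P := P) (j := j) (N := N) w
  have i1 := ((hV4.mul hF).integrable C η w c m2 hw hm)
  have i2 := ((hmF.mul hF).integrable C η w c m2 hw hm)
  have i3 := (hV4.integrable C η w c m2 hw hm)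
  have i4 := (hmF.integrable C η w c m2 hw hm)
  have hs1 : ∫ φ : Cfg P j N, weight C η w c m2 (0 : VecField P j ℝ) φ *
        (((∑ y : Site P j, w * ‖φ y‖ ^ 4) + 1 / 2 * δ₁ * massForm w φ) *
          (⟪φ x, EuclideanSpace.basisFun (Fin N) ℝ a⟫_ℝ * ⟪φ x', EuclideanSpace.basisFun (Fin N) ℝ b⟫_ℝ)) =
      (∫ φ : Cfg P j N, weight C η w c m2 (0 : VecField P j ℝ) φ * ((∑ y : Site P j, w * ‖φ y‖ ^ 4) *
          (⟪φ x, EuclideanSpace.basisFun (Fin N) ℝ a⟫_ℝ * ⟪φ x', EuclideanSpace.basisFun (Fin N) ℝ b⟫_ℝ)))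
        + 1 / 2 * δ₁ * ∫ φ : Cfg P j N, weight C η w c m2 (0 : VecField P j ℝ) φ * (massForm w φ *
          (⟪φ x, EuclideanSpace.basisFun (Fin N) ℝ a⟫_ℝ * ⟪φ x', EuclideanSpace.basisFun (Fin N) ℝ b⟫_ℝ)) := by
    rw [← integral_const_mul, ← integral_add i1 (i2.const_mul _)]
    exact integral_congr_ae (Filter.Eventually.of_forall fun φ => by ring)
  have hs2 : ∫ φ : Cfg P j N, weight C η w c m2 (0 : VecField P j ℝ) φ *
        (((∑ y : Site P j, w * ‖φ y‖ ^ 4) + 1 / 2 * δ₁ * massForm w φ) * 1) =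
      (∫ φ : Cfg P j N, weight C η w c m2 (0 : VecField P j ℝ) φ * ∑ y : Site P j, w * ‖φ y‖ ^ 4)
        + 1 / 2 * δ₁ * ∫ φ : Cfg P j N, weight C η w c m2 (0 : VecField P j ℝ) φ * massForm w φ := by
    rw [← integral_const_mul, ← integral_add i3 (i4.const_mul _)]
    exact integral_congr_ae (Filter.Eventually.of_forall fun φ => by ring)
  rw [hs1, hs2]
  have hc1 := B3Eq122FirstOrderWick.cov_V_legs C η w c m2 hw hm a b x x'
  have hc2 := cov_massForm_legs C η w c m2 hw hm a b x x'
  simp only [legs] at hc2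
  set Z : ℝ := ∫ φ : Cfg P j N, weight C η w c m2 (0 : VecField P j ℝ) φ with hZdef
  set NV : ℝ := ∫ φ : Cfg P j N, weight C η w c m2 (0 : VecField P j ℝ) φ * ((∑ y : Site P j, w * ‖φ y‖ ^ 4) *
    (⟪φ x, EuclideanSpace.basisFun (Fin N) ℝ a⟫_ℝ * ⟪φ x', EuclideanSpace.basisFun (Fin N) ℝ b⟫_ℝ)) with hNV
  set Nm : ℝ := ∫ φ : Cfg P j N, weight C η w c m2 (0 : VecField P j ℝ) φ * (massForm w φ *
    (⟪φ x, EuclideanSpace.basisFun (Fin N) ℝ a⟫_ℝ * ⟪φ x', EuclideanSpace.basisFun (Fin N) ℝ b⟫_ℝ)) with hNm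
  set NL : ℝ := ∫ φ : Cfg P j N, weight C η w c m2 (0 : VecField P j ℝ) φ *
    (⟪φ x, EuclideanSpace.basisFun (Fin N) ℝ a⟫_ℝ * ⟪φ x', EuclideanSpace.basisFun (Fin N) ℝ b⟫_ℝ) with hNL
  set IV : ℝ := ∫ φ : Cfg P j N, weight C η w c m2 (0 : VecField P j ℝ) φ * ∑ y : Site P j, w * ‖φ y‖ ^ 4 with hIV
  set Im : ℝ := ∫ φ : Cfg P j N, weight C η w c m2 (0 : VecField P j ℝ) φ * massForm w φ with hIm
  rw [div_eq_iff (pow_ne_zero 2 hZ.ne')]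
  linear_combination (-1 : ℝ) * hc1 + (-(1 / 2 : ℝ) * δ₁) * hc2

/-- **DICTIONARY AT ORDER `λ`: THE DERIVED KERNEL IS `−λδm²_{(0,1)}·δ^ε + sig1 D` BETWEEN TWO FREE PROPAGATORS** (per `δ_{ab}`;
p26's (1.22)-data `D` with `D.C0 = C₀`, `D.N = N`, `D.w = η^d`; BRICK 1's `deriv_eq_C0_sig1_C0` supplied the `sig1` part):
`λ·[−4(N+2)Σ_yη^dC₀(y,y)C₀(x,y)C₀(x′,y) − δ₁Σ_zη^dC₀(x′,z)C₀(z,x)] = Σ_{y,y′}η^{2d}C₀(x,y)[sig1 D − λδ₁·δ^ε](y,y′)C₀(y′,x′)` — the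
bracket `(−δm² + Σ^ε)` of (1.21) at order `λ` (no `Σ₁`, `Σ₂` at this order). [cite: Balaban1983Higgs3, (1.21)–(1.23) pp.416–417] -/
theorem derivWithin_massCurve_eq_C0_sig1_delta_C0 (hw : 0 < w) (D : SEData P j) (hC0 : D.C0 = G w c m2) (hN : D.N = N)
    (hwD : D.w = w) (δ₁ : ℝ) (x x' : Site P j) :
    D.lam * (-(4 * (N + 2) * ∑ y : Site P j, w * (G w c m2 y y * (G w c m2 x y * G w c m2 x' y))
          + δ₁ * ∑ z : Site P j, w * (G w c m2 x' z * G w c m2 z x))) =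
      ∑ y : Site P j, ∑ y' : Site P j, w * w *
        (G w c m2 x y * (sig1 D y y' + (-(D.lam * δ₁)) * delta w y y') * G w c m2 y' x') := by
  have hsplit : (∑ y : Site P j, ∑ y' : Site P j, w * w *
        (G w c m2 x y * (sig1 D y y' + (-(D.lam * δ₁)) * delta w y y') * G w c m2 y' x')) =
      (∑ y : Site P j, ∑ y' : Site P j, w * w * (G w c m2 x y * sig1 D y y' * G w c m2 y' x'))
        + ∑ y : Site P j, ∑ y' : Site P j, w * w * (G w c m2 x y * ((-(D.lam * δ₁)) * delta w y y') * G w c m2 y' x') := by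
    rw [← Finset.sum_add_distrib]
    refine Finset.sum_congr rfl fun y _ => ?_
    rw [← Finset.sum_add_distrib]
    exact Finset.sum_congr rfl fun y' _ => by ring
  rw [hsplit, ← B3Eq122FirstOrderWick.deriv_eq_C0_sig1_C0 w c m2 hw D hC0 hN hwD x x',
    sum_G_delta_G w c m2 hw.ne']
  ring


/-! ## §11 PRINT'S TRUNCATED SERIES `δm² = Σ_{2≤α+2β≤4}e^αλ^βδm²_{(α,β)}` AT `λ = 0` (r15's typed `B3Sect1TwoPoint.dm2Of123`):
only `δm²_{(2,0)}` enters the order-`e²` coefficient -/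

omit C η w c m2 μ2 in
/-- **r15's typed (1.23) series at `λ = 0` is the polynomial `δm²_{(2,0)}e² + δm²_{(3,0)}e³ + δm²_{(4,0)}e⁴`** (the index set
`{(2,0),(3,0),(4,0),(0,1),(1,1),(2,1),(0,2)}`, `B3Sect1TwoPoint.idx123_eq`; the `β ≥ 1` terms carry `λ^β = 0`).
[cite: Balaban1983Higgs3, (1.23) p.417] -/
theorem dm2Of123_lam_zero {X : Type*} [Fintype X] (e epsd : ℝ) (S : ℕ → ℕ → X → ℝ) :
    B3Sect1TwoPoint.dm2Of123 e 0 epsd S =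
      B3Sect1TwoPoint.dm2Coeff epsd S 2 0 * e ^ 2 + B3Sect1TwoPoint.dm2Coeff epsd S 3 0 * e ^ 3
        + B3Sect1TwoPoint.dm2Coeff epsd S 4 0 * e ^ 4 := by
  simp [B3Sect1TwoPoint.dm2Of123, B3Sect1TwoPoint.idx123_eq]
  ring

omit C η w c m2 μ2 in
/-- the polynomial `δ₂e² + δ₃e³ + δ₄e⁴` and its first derivative. [folklore] -/
private theorem hasDerivAt_series (δ₂ δ₃ δ₄ e : ℝ) :
    HasDerivAt (fun s : ℝ => δ₂ * s ^ 2 + δ₃ * s ^ 3 + δ₄ * s ^ 4)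
      (δ₂ * (2 * e) + δ₃ * (3 * e ^ 2) + δ₄ * (4 * e ^ 3)) e := by
  have h : HasDerivAt (fun s : ℝ => δ₂ * s ^ 2 + δ₃ * s ^ 3 + δ₄ * s ^ 4)
      (δ₂ * ((2 : ℕ) * e ^ (2 - 1)) + δ₃ * ((3 : ℕ) * e ^ (3 - 1)) + δ₄ * ((4 : ℕ) * e ^ (4 - 1))) e :=
    (((hasDerivAt_pow 2 e).const_mul δ₂).add ((hasDerivAt_pow 3 e).const_mul δ₃)).add
      ((hasDerivAt_pow 4 e).const_mul δ₄)
  refine h.congr_deriv ?_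
  norm_num

omit C η w c m2 μ2 in
/-- … and its second derivative. [folklore] -/
private theorem hasDerivAt_series' (δ₂ δ₃ δ₄ e : ℝ) :
    HasDerivAt (fun s : ℝ => δ₂ * (2 * s) + δ₃ * (3 * s ^ 2) + δ₄ * (4 * s ^ 3))
      (δ₂ * 2 + δ₃ * (3 * (2 * e)) + δ₄ * (4 * (3 * e ^ 2))) e := by
  have h : HasDerivAt (fun s : ℝ => δ₂ * (2 * s) + δ₃ * (3 * s ^ 2) + δ₄ * (4 * s ^ 3))
      (δ₂ * (2 * 1) + δ₃ * (3 * ((2 : ℕ) * e ^ (2 - 1))) + δ₄ * (4 * ((3 : ℕ) * e ^ (3 - 1)))) e :=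
    ((((hasDerivAt_id' e).const_mul (2 : ℝ)).const_mul δ₂).add
      (((hasDerivAt_pow 2 e).const_mul (3 : ℝ)).const_mul δ₃)).add (((hasDerivAt_pow 3 e).const_mul (4 : ℝ)).const_mul δ₄)
  refine h.congr_deriv ?_
  norm_num

/-- **WITH PRINT'S COUNTERTERM SERIES (1.23) INSERTED (at `λ = 0`: `δm²(e) = Σ_{α=2}^{4}e^αδm²_{(α,0)}`, r15's `dm2Of123 e 0 ε^d
Σ^ε_{(·,·)}` for ANY supplied coefficients) ONLY `δm²_{(2,0)}` ENTERS THE ORDER-`e²` COEFFICIENT OF (1.19)**: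
`d²/de²∣₀G^{δm²}_{ab}(x,x′) = d²/de²∣₀G_{ab}(x,x′) − 2δm²_{(2,0)}·δ_{ab}·Σ_zη^dC₀(x′,z)C₀(z,x)`, `δm²_{(2,0)} = dm2Coeff ε^d Σ^ε 2 0 =
Σ_xε^dΣ^ε_{(2,0)}(x)` — print's *"we insert this into Σ^ε. This gives us an expansion of Σ^ε in coupling constants and we take a
sum of terms of order ≦ 4"*, at order `2`. [cite: Balaban1983Higgs3, (1.19)–(1.21) p.416, (1.23) p.417] -/
theorem iteratedDeriv_two_twoPt_dm2Of123 (hw : 0 < w) (hm : 0 < m2) (hμ : 0 < μ2) {X : Type*} [Fintype X]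
    (epsd : ℝ) (S : ℕ → ℕ → X → ℝ) (a b : Fin N) (x x' : Site P j) :
    iteratedDeriv 2 (fun e => twoPt C η w c (m2 + B3Sect1TwoPoint.dm2Of123 e 0 epsd S) μ2 e a b x x') 0 =
      iteratedDeriv 2 (fun e => twoPt C η w c m2 μ2 e a b x x') 0
        - 2 * B3Sect1TwoPoint.dm2Coeff epsd S 2 0 *
          (⟪EuclideanSpace.basisFun (Fin N) ℝ a, EuclideanSpace.basisFun (Fin N) ℝ b⟫_ℝ *
            ∑ z : Site P j, w * (G w c m2 x' z * G w c m2 z x)) := by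
  have hfun : (fun e => twoPt C η w c (m2 + B3Sect1TwoPoint.dm2Of123 e 0 epsd S) μ2 e a b x x') =
      fun e => twoPt C η w c (m2 + (B3Sect1TwoPoint.dm2Coeff epsd S 2 0 * e ^ 2
        + B3Sect1TwoPoint.dm2Coeff epsd S 3 0 * e ^ 3 + B3Sect1TwoPoint.dm2Coeff epsd S 4 0 * e ^ 4)) μ2 e a b x x' := by
    funext e
    rw [dm2Of123_lam_zero]
  rw [hfun]
  have h := iteratedDeriv_two_twoPt_massCurve C η w c m2 μ2 hw hm hμ a b x x'
    (ct := fun s => B3Sect1TwoPoint.dm2Coeff epsd S 2 0 * s ^ 2 + B3Sect1TwoPoint.dm2Coeff epsd S 3 0 * s ^ 3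
      + B3Sect1TwoPoint.dm2Coeff epsd S 4 0 * s ^ 4)
    (ct' := fun s => B3Sect1TwoPoint.dm2Coeff epsd S 2 0 * (2 * s) + B3Sect1TwoPoint.dm2Coeff epsd S 3 0 * (3 * s ^ 2)
      + B3Sect1TwoPoint.dm2Coeff epsd S 4 0 * (4 * s ^ 3))
    (ct'' := fun s => B3Sect1TwoPoint.dm2Coeff epsd S 2 0 * 2 + B3Sect1TwoPoint.dm2Coeff epsd S 3 0 * (3 * (2 * s))
      + B3Sect1TwoPoint.dm2Coeff epsd S 4 0 * (4 * (3 * s ^ 2)))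
    (hasDerivAt_series _ _ _) (hasDerivAt_series' _ _ _) (by fun_prop) (by simp) (by simp)
  rw [h]
  simp only [mul_zero, add_zero, ne_eq, OfNat.ofNat_ne_zero, not_false_eq_true, zero_pow]
  ring


/-! ## §12 THE ZERO-MOMENTUM READING: print's equation for the derived kernel `K` ⟺ the `n = 1` term `C₀KC₀` of (1.21)
annihilates the constants (the free propagator has constant row sums `Σ_{x′}η^dC₀(x,x′) = 1/m²`) -/

omit C η μ2 in
/-- the scalar form against the constant function: `⟨a,(−Δ^η+M²)𝟙⟩ = M²Σ_xη^da(x)` (the lattice Laplacian kills constants).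
[cite: Balaban1983Higgs3, (2.25) p.431] -/
theorem sform_const_right (a : Site P j → ℝ) : sform w c m2 a (fun _ => (1 : ℝ)) = m2 * ∑ x : Site P j, w * a x := by
  unfold sform
  simp only [sub_self, mul_zero, Finset.sum_const_zero, zero_add, mul_one]

open Matrix in
omit C η μ2 in
/-- `(−Δ^η+M²)𝟙 = M²𝟙` in matrix form: `K𝟙 = (M²η^d)𝟙`. [cite: Balaban1983Higgs3, (2.25) p.431] -/
theorem Ks_mulVec_one (y : Site P j) : ((Ks w c m2).mulVec fun _ : Site P j => (1 : ℝ)) y = m2 * w := by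
  have h := sform_eq_dotProduct w c m2 (Pi.single y 1) (fun _ : Site P j => (1 : ℝ))
  rw [sform_const_right, single_dotProduct, one_mul] at h
  rw [← h]
  simp only [Pi.single_apply, mul_ite, mul_one, mul_zero, Finset.sum_ite_eq', Finset.mem_univ, if_true]

open Matrix in
omit C η μ2 in
/-- **THE FREE PROPAGATOR HAS CONSTANT ROW SUMS `Σ_{x′}η^dC^η_{M²}(x,x′) = 1/M²`** (zero momentum: `C₀𝟙 = M^{−2}𝟙`).
[cite: Balaban1983Higgs3, (2.26) p.431] -/
theorem sum_G_row (hw : 0 < w) (hm : 0 < m2) (x : Site P j) : ∑ x' : Site P j, w * G w c m2 x x' = 1 / m2 := by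
  have hGK : G w c m2 * Ks w c m2 = (1 : Matrix (Site P j) (Site P j) ℝ) :=
    Matrix.nonsing_inv_mul _ ((Matrix.isUnit_iff_isUnit_det _).mp (Ks_posDef w c m2 hw hm).isUnit)
  have h1 : ((G w c m2).mulVec ((Ks w c m2).mulVec fun _ : Site P j => (1 : ℝ))) x = 1 := by
    rw [Matrix.mulVec_mulVec, hGK, Matrix.one_mulVec]
  have h2 : ((Ks w c m2).mulVec fun _ : Site P j => (1 : ℝ)) = fun _ => m2 * w :=
    funext fun y => Ks_mulVec_one (P := P) (j := j) w c m2 y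
  rw [h2] at h1
  simp only [Matrix.mulVec, dotProduct] at h1
  have h3 : ∑ x' : Site P j, w * G w c m2 x x' = (1 / m2) * ∑ x' : Site P j, G w c m2 x x' * (m2 * w) := by
    rw [Finset.mul_sum]
    exact Finset.sum_congr rfl fun x' _ => by field_simp
  rw [h3, h1, mul_one]

omit C η μ2 in
/-- **row sums of a sandwiched kernel**: `Σ_{x′}η^d·Σ_{y,y′}η^{2d}C₀(x,y)K(y,y′)C₀(y′,x′) = (1/M²)·Σ_yη^dC₀(x,y)·[Σ_{y′}η^dK(y,y′)]` —
the `n = 1` term `C₀KC₀` of (1.21) applied to the constant function sees only the row sums of `K`.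
[cite: Balaban1983Higgs3, (1.21) p.416, (1.23) p.417] -/
theorem rowsum_G_K_G (hw : 0 < w) (hm : 0 < m2) (K : Kernel P j) (x : Site P j) :
    ∑ x' : Site P j, w * ∑ y : Site P j, ∑ y' : Site P j, w * w * (G w c m2 x y * K y y' * G w c m2 y' x') =
      1 / m2 * ∑ y : Site P j, w * G w c m2 x y * ∑ y' : Site P j, w * K y y' := by
  have hrow := fun y' : Site P j => sum_G_row w c m2 hw hm y'
  calc ∑ x' : Site P j, w * ∑ y : Site P j, ∑ y' : Site P j, w * w * (G w c m2 x y * K y y' * G w c m2 y' x')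
      = ∑ y : Site P j, ∑ y' : Site P j, w * w * (G w c m2 x y * K y y') * ∑ x' : Site P j, w * G w c m2 y' x' := by
        simp only [Finset.mul_sum]
        rw [Finset.sum_comm]
        refine Finset.sum_congr rfl fun y _ => ?_
        rw [Finset.sum_comm]
        exact Finset.sum_congr rfl fun y' _ => Finset.sum_congr rfl fun x' _ => by ring
    _ = 1 / m2 * ∑ y : Site P j, w * G w c m2 x y * ∑ y' : Site P j, w * K y y' := by
        simp only [hrow, Finset.mul_sum]
        exact Finset.sum_congr rfl fun y _ => Finset.sum_congr rfl fun y' _ => by ring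

open Matrix in
omit C η μ2 in
/-- **THE ZERO-MOMENTUM FORM OF PRINT'S EQUATION.** For any kernel `K` (here: the derived weight-2 mass-type insertions
`−r·δ^ε + sig1 D`, `−r·δ^ε + sig2 D + sig4 D`): the row sums `Σ_{x′}ε^dK(x,x′)` vanish for every `x` — print's «−δm² +
Σ_{x′}ε^dΣ^ε(x−x′) = 0» — IF AND ONLY IF the `n = 1` term `C₀KC₀` of (1.21) annihilates the constants,
`Σ_{x′}η^d(C₀KC₀)(x,x′) = 0` for every `x` (the renormalized mass-type insertion vanishes at zero momentum; `C₀` is invertible with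
row sums `1/m²`). [cite: Balaban1983Higgs3, (1.21) p.416, (1.23) p.417] -/
theorem rowsum_zero_iff_sandwich (hw : 0 < w) (hm : 0 < m2) (K : Kernel P j) :
    (∀ y : Site P j, ∑ y' : Site P j, w * K y y' = 0) ↔
      ∀ x : Site P j, ∑ x' : Site P j, w * ∑ y : Site P j, ∑ y' : Site P j,
        w * w * (G w c m2 x y * K y y' * G w c m2 y' x') = 0 := by
  constructor
  · intro h x
    rw [rowsum_G_K_G w c m2 hw hm K x]
    simp only [h, mul_zero, Finset.sum_const_zero]
  · intro h
    -- `C₀(η^d·r) = 0` with `r` the row sums forces `r = 0` (apply `K·` on the left: `KC₀ = 1`)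
    have hG : ∀ x : Site P j, ((G w c m2).mulVec fun y => w * ∑ y' : Site P j, w * K y y') x = 0 := by
      intro x
      have hx := h x
      rw [rowsum_G_K_G w c m2 hw hm K x] at hx
      have hm0 : (1 / m2 : ℝ) ≠ 0 := by positivity
      have hs : ∑ y : Site P j, w * G w c m2 x y * ∑ y' : Site P j, w * K y y' = 0 := by
        rcases mul_eq_zero.mp hx with h0 | h0
        · exact absurd h0 hm0
        · exact h0
      simp only [Matrix.mulVec, dotProduct]
      rw [← hs]
      exact Finset.sum_congr rfl fun y _ => by ring
    have hv : ((G w c m2).mulVec fun y => w * ∑ y' : Site P j, w * K y y') = 0 := funext hG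
    have hK : (Ks w c m2).mulVec ((G w c m2).mulVec fun y => w * ∑ y' : Site P j, w * K y y') =
        fun y => w * ∑ y' : Site P j, w * K y y' := by
      rw [Matrix.mulVec_mulVec, Ks_mul_G w c m2 hw hm, Matrix.one_mulVec]
    rw [hv, Matrix.mulVec_zero] at hK
    intro y
    have hy := congrFun hK y
    simp only [Pi.zero_apply] at hy
    have : w * ∑ y' : Site P j, w * K y y' = 0 := hy.symm
    rcases mul_eq_zero.mp this with h0 | h0
    · exact absurd h0 hw.ne'
    · exact h0


/-! ## §13 (v1.1) WEIGHT 3: THE ODD ORDERS IN `e` VANISH BY THE REFLECTION `A ↦ −A` — print's indices `(3,0)` and `(1,1)` -/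

omit C η w c m2 μ2 in
/-- `(−A)_b = −A_b`. [cite: Balaban1982Higgs1, (1.4) p.604] -/
theorem toVec_neg (A : Cfg P j P.d) : toVec (-A) = -toVec A := by
  funext b
  rw [Pi.neg_apply, toVec_apply, toVec_apply, Pi.neg_apply, inner_neg_left]

omit μ2 in
/-- **charge conjugation on the weight**: `U_{−e}(A_b) = exp(qη(−e)A_b) = exp(qηe(−A)_b) = U_e((−A)_b)`, so
`e^{−½⟨φ,(−Δ^η_{A}+m²)φ⟩}∣_{charge −e} = e^{−½⟨φ,(−Δ^η_{−A}+m²)φ⟩}∣_{charge e}`. [cite: Balaban1982Higgs1, (1.7) p.605] -/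
theorem weight_Ce_neg (e : ℝ) (A : VecField P j ℝ) (φ : Cfg P j N) :
    weight (Ce C (-e)) η w c m2 A φ = weight (Ce C e) η w c m2 (-A) φ := by
  unfold weight quadForm covLaplaceForm covDerivScalar
  simp only [HiggsLattice.ChargeData.Urep_apply, Ce_U, Pi.neg_apply, mul_neg, neg_mul]

omit C m2 in
/-- the Feynman-gauge vector-field Gaussian `e^{−½⟨A,(−Δ^η+μ₀²)A⟩}` of (1.20) is even in `A`. [cite: Balaban1983Higgs3, (1.20) p.416] -/
theorem WA_neg (A : Cfg P j P.d) : WA η w c μ2 (-A) = WA η w c μ2 A := by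
  unfold WA weight quadForm covLaplaceForm covDerivScalar massForm
  simp only [HiggsLattice.ChargeData.Urep_apply, Pi.zero_apply, HiggsLattice.ChargeData.U_zero, Pi.neg_apply,
    one_apply_eq_self, norm_neg, ← neg_sub', smul_neg]

/-- **`e^{−S^ε_{−e}(A,φ)} = e^{−S^ε_{e}(−A,φ)}`**: the joint weight of (1.19)–(1.20) at charge `−e` is the joint weight at charge `e`
reflected in the vector field. [cite: Balaban1983Higgs3, (1.19)–(1.20) p.416] -/
theorem J_neg_charge (e : ℝ) (p : JCfg P j N) :
    J C η w c m2 μ2 (-e) p = J C η w c m2 μ2 e (-p.1, p.2) := by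
  unfold J
  dsimp only
  rw [WA_neg, weight_Ce_neg, toVec_neg]

omit C η w c m2 μ2 in
/-- the reflection `A ↦ −A` of the vector field preserves the Lebesgue measure `dA` (sitewise `−1 ∈ O(d)`). [folklore] -/
private theorem measurePreserving_negVec :
    MeasurePreserving (fun A : Cfg P j P.d => -A) volume volume :=
  volume_preserving_pi (α' := fun _ : Site P j => EuclideanSpace ℝ (Fin P.d))
    (β' := fun _ : Site P j => EuclideanSpace ℝ (Fin P.d)) (f := fun _ v => -v)
    fun _ => (LinearIsometryEquiv.neg ℝ (E := EuclideanSpace ℝ (Fin P.d))).measurePreserving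

omit C η w c m2 μ2 in
/-- … hence `(A, φ) ↦ (−A, φ)` preserves `dA dφ`: `∫dA dφ g(−A,φ) = ∫dA dφ g(A,φ)`. [folklore] -/
private theorem integral_comp_negVec (g : JCfg P j N → ℝ) :
    ∫ p : JCfg P j N, g (-p.1, p.2) = ∫ p : JCfg P j N, g p := by
  have he : MeasurePreserving
      ((MeasurableEquiv.neg (Cfg P j P.d)).prodCongr (MeasurableEquiv.refl (Cfg P j N)))
      (volume : Measure (JCfg P j N)) (volume : Measure (JCfg P j N)) :=
    (measurePreserving_negVec (P := P) (j := j)).prod (MeasurePreserving.id (volume : Measure (Cfg P j N)))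
  have h := he.integral_comp' g
  exact h

/-- **CHARGE CONJUGATION**: `∫dA dφ e^{−S^ε_{−e}}F(φ) = ∫dA dφ e^{−S^ε_{e}}F(φ)` for every observable of the scalar field alone
(substitute `A ↦ −A`). [cite: Balaban1983Higgs3, (1.19)–(1.20) p.416] -/
theorem integral_J_neg_charge (e : ℝ) (F : Cfg P j N → ℝ) :
    ∫ p : JCfg P j N, J C η w c m2 μ2 (-e) p * F p.2 = ∫ p : JCfg P j N, J C η w c m2 μ2 e p * F p.2 := by
  simp_rw [J_neg_charge]
  exact integral_comp_negVec (fun p => J C η w c m2 μ2 e p * F p.2)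

/-- **(1.19) IS EVEN IN THE CHARGE**: `G_{−e,ab}(x,x′) = G_{e,ab}(x,x′)` at every scalar mass. [cite: Balaban1983Higgs3, (1.19)–(1.20) p.416] -/
theorem twoPt_neg_charge (e : ℝ) (a b : Fin N) (x x' : Site P j) :
    twoPt C η w c m2 μ2 (-e) a b x x' = twoPt C η w c m2 μ2 e a b x x' := by
  unfold twoPt
  have h1 := integral_J_neg_charge C η w c m2 μ2 e (fun _ : Cfg P j N => (1 : ℝ))
  simp only [mul_one] at h1
  have h2 := integral_J_neg_charge C η w c m2 μ2 e (legs a b x x')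
  simp only [legs] at h2
  rw [h1, h2]

omit C η w c m2 μ2 in
/-- the derivative of an even function is odd (in Mathlib's total `deriv`). [folklore] -/
private theorem deriv_neg_of_even {f : ℝ → ℝ} (hf : ∀ s, f (-s) = f s) (s : ℝ) : deriv f (-s) = -deriv f s := by
  have h := deriv_comp_neg f s
  have hfe : (fun x => f (-x)) = f := funext hf
  rw [hfe] at h
  linarith

omit C η w c m2 μ2 in
/-- the derivative of an odd function is even. [folklore] -/
private theorem deriv_neg_of_odd {g : ℝ → ℝ} (hg : ∀ s, g (-s) = -g s) (s : ℝ) : deriv g (-s) = deriv g s := by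
  have h := deriv_comp_neg g s
  have hge : (fun x => g (-x)) = -g := funext hg
  rw [hge, deriv.neg] at h
  linarith

omit C η w c m2 μ2 in
/-- the even-order derivatives of an even function are even. [folklore] -/
private theorem iteratedDeriv_even_of_even {f : ℝ → ℝ} (hf : ∀ s, f (-s) = f s) (k : ℕ) (s : ℝ) :
    iteratedDeriv (2 * k) f (-s) = iteratedDeriv (2 * k) f s := by
  induction k generalizing s with
  | zero => simpa using hf s
  | succ k ih =>
    have h2 : 2 * (k + 1) = 2 * k + 1 + 1 := by ring
    rw [h2, iteratedDeriv_succ, iteratedDeriv_succ]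
    exact deriv_neg_of_odd (deriv_neg_of_even ih) s

omit C η w c m2 μ2 in
/-- **the odd-order derivatives of an even function vanish at `0`**. [folklore] -/
private theorem iteratedDeriv_odd_eq_zero_of_even {f : ℝ → ℝ} (hf : ∀ s, f (-s) = f s) (k : ℕ) :
    iteratedDeriv (2 * k + 1) f 0 = 0 := by
  rw [iteratedDeriv_succ]
  have h := deriv_neg_of_even (iteratedDeriv_even_of_even hf k) 0
  rw [neg_zero] at h
  linarith

/-- **ALL ODD ORDERS IN `e` OF (1.19) WITH AN EVEN COUNTERTERM INSERTED VANISH**: for `δm² = ct(e)` with `ct(−e) = ct(e)`,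
`d^{2k+1}/de^{2k+1}∣₀ G^{ct}_{ab}(x,x′) = 0` — the reflection `A ↦ −A` (`−1 ∈ O(d)` sitewise preserves `dA` and the vector-field
Gaussian of (1.20), and conjugates the charge, `U_{−e}(A) = U_e(−A)`).  In particular the `e¹` coefficient (consistent with §5) and
the `e³` coefficient: print's index `(3,0)`. [cite: Balaban1983Higgs3, (1.19)–(1.20) p.416, (1.23) p.417] -/
theorem iteratedDeriv_odd_twoPt_massCurve (a b : Fin N) (x x' : Site P j) {ct : ℝ → ℝ} (hct : ∀ e, ct (-e) = ct e) (k : ℕ) :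
    iteratedDeriv (2 * k + 1) (fun e => twoPt C η w c (m2 + ct e) μ2 e a b x x') 0 = 0 :=
  iteratedDeriv_odd_eq_zero_of_even (fun e => by simp only [hct, twoPt_neg_charge]) k

/-- **PRINT'S INDEX `(3,0)`: THE ORDER-`e³` COEFFICIENT OF THE FULL TWO-POINT FUNCTION (1.19) VANISHES for the symmetric
insertion.**  With r15's typed series (1.23) inserted at `λ = 0`, `δm²(e) = δm²_{(2,0)}e² + δm²_{(3,0)}e³ + δm²_{(4,0)}e⁴`
(`dm2Of123_lam_zero`), and `δm²_{(3,0)} = 0` (hypothesis `h30`), the inserted counterterm is even in `e` and the order-`e³` coefficient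
of (1.19) vanishes — so print's defining equation at `(3,0)`, «`−δm²_{(3,0)} + Σ_{x∈T_ε}ε^dΣ^ε_{(3,0)}(x) = 0`», is consistent with
`δm²_{(3,0)} = 0`, as (1.23) (no `e³` term) has it.  The 1PI letter `Σ^ε_{(3,0)}` of (1.21) is NOT extracted here (at order `e³` the
bracket of (1.21) is not decomposed into its letters in this file; referee D-g79-2). [cite: Balaban1983Higgs3, (1.23) p.417] -/
theorem iteratedDeriv_three_twoPt_dm2Of123 {X : Type*} [Fintype X] (epsd : ℝ) (S : ℕ → ℕ → X → ℝ)
    (h30 : B3Sect1TwoPoint.dm2Coeff epsd S 3 0 = 0) (a b : Fin N) (x x' : Site P j) :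
    iteratedDeriv 3 (fun e => twoPt C η w c (m2 + B3Sect1TwoPoint.dm2Of123 e 0 epsd S) μ2 e a b x x') 0 = 0 := by
  have hct : ∀ e : ℝ, B3Sect1TwoPoint.dm2Of123 (-e) 0 epsd S = B3Sect1TwoPoint.dm2Of123 e 0 epsd S := fun e => by
    rw [dm2Of123_lam_zero, dm2Of123_lam_zero, h30]
    ring
  exact iteratedDeriv_odd_twoPt_massCurve C η w c m2 μ2 a b x x' hct 1

/-- **THE JOINT `(e,λ)` TWO-POINT FUNCTION (1.19) WITH `λΣ_yη^d∣φ(y)∣⁴` AND A COUNTERTERM `δm² = ct(e,λ)` IS EVEN IN `e`** for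
every `λ` when `ct(−e,λ) = ct(e,λ)`: `G^{ct}_{−e,λ} = G^{ct}_{e,λ}`. [cite: Balaban1983Higgs3, (1.19)–(1.20) p.416] -/
theorem twoPtJoint_neg_charge (lam : ℝ) {ct : ℝ → ℝ → ℝ} (hct : ∀ e l, ct (-e) l = ct e l) (e : ℝ) (a b : Fin N)
    (x x' : Site P j) :
    (∫ p : JCfg P j N, J C η w c (m2 + ct (-e) lam) μ2 (-e) p *
        (Real.exp (-(lam * ∑ y : Site P j, w * ‖p.2 y‖ ^ 4)) * legs a b x x' p.2)) /
      (∫ p : JCfg P j N, J C η w c (m2 + ct (-e) lam) μ2 (-e) p *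
        Real.exp (-(lam * ∑ y : Site P j, w * ‖p.2 y‖ ^ 4))) =
    (∫ p : JCfg P j N, J C η w c (m2 + ct e lam) μ2 e p *
        (Real.exp (-(lam * ∑ y : Site P j, w * ‖p.2 y‖ ^ 4)) * legs a b x x' p.2)) /
      (∫ p : JCfg P j N, J C η w c (m2 + ct e lam) μ2 e p *
        Real.exp (-(lam * ∑ y : Site P j, w * ‖p.2 y‖ ^ 4))) := by
  rw [hct, integral_J_neg_charge C η w c (m2 + ct e lam) μ2 e
      (fun φ => Real.exp (-(lam * ∑ y : Site P j, w * ‖φ y‖ ^ 4)) * legs a b x x' φ),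
    integral_J_neg_charge C η w c (m2 + ct e lam) μ2 e (fun φ => Real.exp (-(lam * ∑ y : Site P j, w * ‖φ y‖ ^ 4)))]

/-- **PRINT'S INDEX `(1,1)` (and every odd order in `e` at every `λ`): THE `e¹λ¹` COEFFICIENT OF THE FULL TWO-POINT FUNCTION
(1.19) VANISHES for an `e`-even insertion.**  For the joint family with an `e`-even counterterm inserted, (i) every odd `e`-derivative
at `e = 0` vanishes AT EVERY `λ ≥ 0`, and (ii) so does every odd `e`-derivative at `0` of the right `λ`-derivative at `λ = 0⁺` (the
order «`λ` first»): the `e¹λ¹` coefficient of (1.19) vanishes in both orders of differentiation — consistent with `δm²_{(1,1)} = 0` in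
print's equation at `(1,1)` and with (1.23) displaying no `eλ` term; the 1PI letter `Σ^ε_{(1,1)}` of (1.21) is NOT extracted here
(referee D-g79-2).
(By the reflection symmetry alone, in Mathlib's total `deriv`/`derivWithin`; the EXISTENCE of these derivatives away from
`(e,λ) = (0,0)` — dominated differentiation as in §4 / BRICK 1 with the extra factor `e^{−λV} ≤ 1` — is not re-proved here.)
[cite: Balaban1983Higgs3, (1.19)–(1.20) p.416, (1.23) p.417] -/
theorem iteratedDeriv_odd_twoPtJoint_massCurve {ct : ℝ → ℝ → ℝ} (hct : ∀ e l, ct (-e) l = ct e l) (a b : Fin N)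
    (x x' : Site P j) (k : ℕ) :
    (∀ lam : ℝ, iteratedDeriv (2 * k + 1) (fun e =>
        (∫ p : JCfg P j N, J C η w c (m2 + ct e lam) μ2 e p *
            (Real.exp (-(lam * ∑ y : Site P j, w * ‖p.2 y‖ ^ 4)) * legs a b x x' p.2)) /
          (∫ p : JCfg P j N, J C η w c (m2 + ct e lam) μ2 e p *
            Real.exp (-(lam * ∑ y : Site P j, w * ‖p.2 y‖ ^ 4)))) 0 = 0) ∧
    iteratedDeriv (2 * k + 1) (fun e => derivWithin (fun lam =>
        (∫ p : JCfg P j N, J C η w c (m2 + ct e lam) μ2 e p *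
            (Real.exp (-(lam * ∑ y : Site P j, w * ‖p.2 y‖ ^ 4)) * legs a b x x' p.2)) /
          (∫ p : JCfg P j N, J C η w c (m2 + ct e lam) μ2 e p *
            Real.exp (-(lam * ∑ y : Site P j, w * ‖p.2 y‖ ^ 4)))) (Set.Ici 0) 0) 0 = 0 := by
  refine ⟨fun lam => iteratedDeriv_odd_eq_zero_of_even (fun e => ?_) k, iteratedDeriv_odd_eq_zero_of_even (fun e => ?_) k⟩
  · exact twoPtJoint_neg_charge C η w c m2 μ2 lam hct e a b x x'
  · congr 1
    funext lam
    exact twoPtJoint_neg_charge C η w c m2 μ2 lam hct e a b x x'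


/-! ## §14 (v1.2) THE INDEX `(1,1)` NON-VACUOUSLY: the joint `(e,λ)` family is differentiable in `e` near `0` at every `λ ≥ 0`, its
`e`-derivative at `e = 0` is the TRUE derivative `0`, and `λ ↦ ∂_eG^{ct}(0,λ) ≡ 0` has right-derivative `0` at `λ = 0⁺` -/

omit C η c m2 μ2 in
/-- the Boltzmann factor `e^{−λΣ_yη^d∣φ(y)∣⁴}` of the quartic interaction, `λ ≥ 0`, is a bounded continuous observable (`≤ 1`), hence of
exponential-linear growth. [cite: Balaban1983Higgs3, (1.20) p.416] -/
theorem expGrowth_exp_neg_V (hw : 0 ≤ w) {lam : ℝ} (hlam : 0 ≤ lam) :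
    ExpGrowth (fun φ : Cfg P j N => Real.exp (-(lam * ∑ y : Site P j, w * ‖φ y‖ ^ 4))) := by
  refine ⟨Real.continuous_exp.comp ((continuous_const.mul (B3Eq122FirstOrderWick.expGrowth_V (P := P) (j := j) (N := N) w).1).neg),
    1, 0, zero_le_one, le_rfl, fun φ => ?_⟩
  have hV : 0 ≤ ∑ y : Site P j, w * ‖φ y‖ ^ 4 := Finset.sum_nonneg fun y _ => mul_nonneg hw (by positivity)
  rw [zero_mul, Real.exp_zero, mul_one, abs_of_pos (Real.exp_pos _), Real.exp_le_one_iff]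
  nlinarith

/-- `∫dA dφ e^{−S^ε_e}g(φ) > 0` for a positive observable `g` (the partition function of (1.19) with `e^{−λV}`, `λ ≥ 0`, is positive).
[cite: Balaban1983Higgs3, (1.19) p.416] -/
theorem integral_J_mul_pos (hw : 0 < w) (hm : 0 < m2) (hμ : 0 < μ2) {g : Cfg P j N → ℝ} (hg : ExpGrowth g)
    (hgpos : ∀ φ, 0 < g φ) (e : ℝ) : 0 < ∫ p : JCfg P j N, J C η w c m2 μ2 e p * g p.2 := by
  have hint := integrable_J_mul C η w c m2 μ2 hw hm hμ hg e
  have hpos : ∀ p : JCfg P j N, 0 < J C η w c m2 μ2 e p * g p.2 := fun p => mul_pos (J_pos' C η w c μ2 m2 e p) (hgpos p.2)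
  rw [integral_pos_iff_support_of_nonneg (fun p => (hpos p).le) hint]
  have hsupp : Function.support (fun p : JCfg P j N => J C η w c m2 μ2 e p * g p.2) = Set.univ :=
    Set.eq_univ_iff_forall.mpr fun p => Function.mem_support.mpr (hpos p).ne'
  rw [hsupp, Measure.volume_eq_prod, ← Set.univ_prod_univ, Measure.prod_prod]
  exact ENNReal.mul_pos (isOpen_univ.measure_pos volume Set.univ_nonempty).ne'
    (isOpen_univ.measure_pos volume Set.univ_nonempty).ne'

/-- **THE JOINT FAMILY IS DIFFERENTIABLE IN THE CHARGE, ON THE BALL, AT EVERY `λ ≥ 0`**: `G^{ct}_{e,λ} = N/Z`,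
`N(e) = ∫e^{−S^ε_e}e^{−λV}φ_a(x)φ_b(x′)`, `Z(e) = ∫e^{−S^ε_e}e^{−λV}` (`δm² = ct(e)` in `S^ε_e` at this `λ`, `V = Σ_yη^d∣φ(y)∣⁴`), has
`(G^{ct})′ = (N′Z − NZ′)/Z²` with `N′ = ∫[D₁ − ½ct′Σ∣φ∣²]e^{−S^ε_e}e^{−λV}φ_aφ_b` — §4's dominated differentiation with the bounded factor
`e^{−λV} ≤ 1` in the observable. [cite: Balaban1983Higgs3, (1.19)–(1.21) p.416, (1.23) p.417] -/
theorem hasDerivAt_twoPtJoint_massCurve_of_ball (hw : 0 < w) (hm : 0 < m2) (hμ : 0 < μ2) {lam : ℝ} (hlam : 0 ≤ lam)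
    (a b : Fin N) (x x' : Site P j) {ct ct' : ℝ → ℝ} {r B : ℝ} (hd : ∀ e, |e| < r → HasDerivAt ct (ct' e) e)
    (hct : ∀ e, |e| < r → |ct e| ≤ m2 / 2) (hct' : ∀ e, |e| < r → |ct' e| ≤ B) {e₀ : ℝ} (he₀ : |e₀| < r) :
    HasDerivAt (fun e =>
        (∫ p : JCfg P j N, J C η w c (m2 + ct e) μ2 e p *
            (Real.exp (-(lam * ∑ y : Site P j, w * ‖p.2 y‖ ^ 4)) * legs a b x x' p.2)) /
          (∫ p : JCfg P j N, J C η w c (m2 + ct e) μ2 e p *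
            Real.exp (-(lam * ∑ y : Site P j, w * ‖p.2 y‖ ^ 4))))
      (((∫ p : JCfg P j N, (D1 C η w c e₀ (toVec p.1) p.2 - 1 / 2 * ct' e₀ * massForm w p.2) *
            J C η w c (m2 + ct e₀) μ2 e₀ p *
              (Real.exp (-(lam * ∑ y : Site P j, w * ‖p.2 y‖ ^ 4)) * legs a b x x' p.2)) *
          (∫ p : JCfg P j N, J C η w c (m2 + ct e₀) μ2 e₀ p *
            Real.exp (-(lam * ∑ y : Site P j, w * ‖p.2 y‖ ^ 4)))
        - (∫ p : JCfg P j N, J C η w c (m2 + ct e₀) μ2 e₀ p *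
              (Real.exp (-(lam * ∑ y : Site P j, w * ‖p.2 y‖ ^ 4)) * legs a b x x' p.2)) *
          (∫ p : JCfg P j N, (D1 C η w c e₀ (toVec p.1) p.2 - 1 / 2 * ct' e₀ * massForm w p.2) *
            J C η w c (m2 + ct e₀) μ2 e₀ p *
              Real.exp (-(lam * ∑ y : Site P j, w * ‖p.2 y‖ ^ 4)))) /
        (∫ p : JCfg P j N, J C η w c (m2 + ct e₀) μ2 e₀ p *
            Real.exp (-(lam * ∑ y : Site P j, w * ‖p.2 y‖ ^ 4))) ^ 2) e₀ := by
  have hB := expGrowth_exp_neg_V (P := P) (j := j) (N := N) w hw.le hlam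
  have hN := (hasDerivAt_integral_J_massCurve C η w c m2 μ2 hw hm hμ (hB.mul (expGrowth_legs a b x x')) hd hct hct' he₀).2
  have hZ := (hasDerivAt_integral_J_massCurve C η w c m2 μ2 hw hm hμ hB hd hct hct' he₀).2
  have hZ0 : (∫ p : JCfg P j N, J C η w c (m2 + ct e₀) μ2 e₀ p *
      Real.exp (-(lam * ∑ y : Site P j, w * ‖p.2 y‖ ^ 4))) ≠ 0 :=
    (integral_J_mul_pos C η w c (m2 + ct e₀) μ2 hw (mass_pos_of_abs_le m2 hm (hct e₀ he₀)) hμ hB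
      (fun φ => Real.exp_pos _) e₀).ne'
  exact hN.div hZ hZ0

omit C η w c μ2 in
/-- continuity at `0` gives a ball `∣e∣ < r` on which `∣ct∣ ≤ m²/2` and `∣ct′∣ ≤ B` (first-order version of §5's ball lemma).
[folklore] -/
private theorem exists_ball_bounds₁ (hm : 0 < m2) {ct ct' : ℝ → ℝ} (hd : ∀ e, HasDerivAt ct (ct' e) e)
    (hc' : ContinuousAt ct' 0) (h0 : ct 0 = 0) :
    ∃ r B : ℝ, 0 < r ∧ (∀ e, |e| < r → |ct e| ≤ m2 / 2) ∧ (∀ e, |e| < r → |ct' e| ≤ B) := by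
  have h1 : ∀ᶠ e in 𝓝 (0:ℝ), dist (ct e) (ct 0) < m2 / 2 :=
    Metric.tendsto_nhds.mp (hd 0).continuousAt (m2 / 2) (half_pos hm)
  have h2 : ∀ᶠ e in 𝓝 (0:ℝ), dist (ct' e) (ct' 0) < 1 := Metric.tendsto_nhds.mp hc' 1 one_pos
  obtain ⟨r, hr, hball⟩ := Metric.eventually_nhds_iff.mp (h1.and h2)
  have hmem : ∀ e : ℝ, |e| < r → dist e 0 < r := fun e he => by rwa [Real.dist_eq, sub_zero]
  refine ⟨r, |ct' 0| + 1, hr, fun e he => ?_, fun e he => ?_⟩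
  · have h := (hball (hmem e he)).1
    rw [Real.dist_eq, h0, sub_zero] at h
    exact h.le
  · have h := (hball (hmem e he)).2
    rw [Real.dist_eq] at h
    have := abs_sub_abs_le_abs_sub (ct' e) (ct' 0)
    linarith

/-- **AT `e = 0` THE `e`-DERIVATIVE OF THE JOINT FAMILY EXISTS AND IS `0`, AT EVERY `λ ≥ 0`**, for a counterterm `ct` (at this `λ`)
that is `C¹` near `0`, even, with positive running mass `m² + ct(0) > 0` (print's `m² + λδm²_{(0,1)} + λ²δm²_{(0,2)}` at `e = 0`):
the existence is §4's dominated differentiation about the shifted mass `m² + ct(0)`, the value `0` is the reflection `A ↦ −A` (§13) —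
so part (i) of `iteratedDeriv_odd_twoPtJoint_massCurve` at `k = 0` is a statement about a genuine derivative.
[cite: Balaban1983Higgs3, (1.19)–(1.21) p.416, (1.23) p.417] -/
theorem hasDerivAt_twoPtJoint_massCurve_zero (hw : 0 < w) (hμ : 0 < μ2) {lam : ℝ} (hlam : 0 ≤ lam) (a b : Fin N)
    (x x' : Site P j) {ct ct' : ℝ → ℝ} (hd : ∀ e, HasDerivAt ct (ct' e) e) (hc' : ContinuousAt ct' 0)
    (hpos : 0 < m2 + ct 0) (hev : ∀ e, ct (-e) = ct e) :
    HasDerivAt (fun e =>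
        (∫ p : JCfg P j N, J C η w c (m2 + ct e) μ2 e p *
            (Real.exp (-(lam * ∑ y : Site P j, w * ‖p.2 y‖ ^ 4)) * legs a b x x' p.2)) /
          (∫ p : JCfg P j N, J C η w c (m2 + ct e) μ2 e p *
            Real.exp (-(lam * ∑ y : Site P j, w * ‖p.2 y‖ ^ 4)))) 0 0 := by
  -- recentre the mass: `m² + ct(e) = (m² + ct(0)) + (ct(e) − ct(0))`
  have hd₁ : ∀ e, HasDerivAt (fun s => ct s - ct 0) (ct' e) e := fun e => (hd e).sub_const (ct 0)
  obtain ⟨r, B, hr, hct, hct'⟩ :=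
    exists_ball_bounds₁ (m2 := m2 + ct 0) hpos (ct := fun s => ct s - ct 0) hd₁ hc' (sub_self (ct 0))
  have hr0 : |(0:ℝ)| < r := by rwa [abs_zero]
  have h := hasDerivAt_twoPtJoint_massCurve_of_ball C η w c (m2 + ct 0) μ2 hw hpos hμ hlam a b x x'
    (fun e _ => hd₁ e) hct hct' hr0
  have hshift : ∀ e, m2 + ct 0 + (ct e - ct 0) = m2 + ct e := fun e => by ring
  simp only [hshift] at h
  -- the derivative that exists is `deriv … 0`, which vanishes by parity (§13)
  have key := (iteratedDeriv_odd_twoPtJoint_massCurve C η w c m2 μ2 (ct := fun e _ => ct e) (fun e _ => hev e)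
    a b x x' 0).1 lam
  rw [Nat.mul_zero, Nat.zero_add, iteratedDeriv_one] at key
  exact h.congr_deriv (h.deriv.symm.trans key)

/-- **PRINT'S INDEX `(1,1)` AS A GENUINE ITERATED DERIVATIVE (order: `e` first, then `λ`)**: for any counterterm `ct(e,λ)` even in `e`,
the function `λ ↦ ∂_e∣₀G^{ct}_{ab}(x,x′;·,λ)` is IDENTICALLY `0` (§13), so it has right-derivative `0` at `λ = 0⁺`: the `e¹λ¹` Taylor
coefficient exists and vanishes — consistent with `δm²_{(1,1)} = 0` in print's equation at `(1,1)` and with (1.23) displaying no `eλ`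
term (the 1PI letter `Σ^ε_{(1,1)}` is not extracted here).  (With `hasDerivAt_twoPtJoint_massCurve_zero` the inner `∂_e` is a true derivative at every `λ ≥ 0` under its hypotheses.)
[cite: Balaban1983Higgs3, (1.19)–(1.21) p.416, (1.23) p.417] -/
theorem hasDerivWithinAt_deriv_twoPtJoint_massCurve {ct : ℝ → ℝ → ℝ} (hct : ∀ e l, ct (-e) l = ct e l) (a b : Fin N)
    (x x' : Site P j) :
    HasDerivWithinAt (fun lam : ℝ => deriv (fun e =>
        (∫ p : JCfg P j N, J C η w c (m2 + ct e lam) μ2 e p *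
            (Real.exp (-(lam * ∑ y : Site P j, w * ‖p.2 y‖ ^ 4)) * legs a b x x' p.2)) /
          (∫ p : JCfg P j N, J C η w c (m2 + ct e lam) μ2 e p *
            Real.exp (-(lam * ∑ y : Site P j, w * ‖p.2 y‖ ^ 4)))) 0) 0 (Set.Ici 0) 0 := by
  have hz : (fun lam : ℝ => deriv (fun e =>
        (∫ p : JCfg P j N, J C η w c (m2 + ct e lam) μ2 e p *
            (Real.exp (-(lam * ∑ y : Site P j, w * ‖p.2 y‖ ^ 4)) * legs a b x x' p.2)) /
          (∫ p : JCfg P j N, J C η w c (m2 + ct e lam) μ2 e p *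
            Real.exp (-(lam * ∑ y : Site P j, w * ‖p.2 y‖ ^ 4)))) 0) = fun _ => 0 := by
    funext lam
    have h := (iteratedDeriv_odd_twoPtJoint_massCurve C η w c m2 μ2 hct a b x x' 0).1 lam
    rwa [Nat.mul_zero, Nat.zero_add, iteratedDeriv_one] at h
  rw [hz]
  exact hasDerivWithinAt_const (0 : ℝ) (Set.Ici 0) (0 : ℝ)

/-- **AT `e = 0` THE VECTOR FIELD INTEGRATES OUT OF THE JOINT FAMILY**: with the weight-2 counterterm `λδ₁` (`δ₁ = δm²_{(0,1)}`) at
`e = 0`, `G^{ct}_{0,λ,ab}(x,x′)` IS §10's family — BRICK 1's `λ∣φ∣⁴` two-point function with `λδ₁` inserted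
(`hasDerivWithinAt_twoPointPhi4_massCurve`): the joint weight factorizes (`J_zero`), `∫dA e^{−½⟨A,(−Δ+μ₀²)A⟩}` cancels in the quotient,
and `e^{−½λδ₁Σ∣φ∣²}` joins the interaction (`weight_mul_exp_massCurve`).  So §13–§14's `(1,1)` statements and §10's `(0,1)` statement
concern the same function at `e = 0`. [cite: Balaban1983Higgs3, (1.19)–(1.20) p.416, (1.23) p.417] -/
theorem twoPtJoint_zero_charge (hw : 0 < w) (hμ : 0 < μ2) (lam δ₁ : ℝ) (a b : Fin N) (x x' : Site P j) :
    (∫ p : JCfg P j N, J C η w c (m2 + lam * δ₁) μ2 0 p *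
        (Real.exp (-(lam * ∑ y : Site P j, w * ‖p.2 y‖ ^ 4)) * legs a b x x' p.2)) /
      (∫ p : JCfg P j N, J C η w c (m2 + lam * δ₁) μ2 0 p *
        Real.exp (-(lam * ∑ y : Site P j, w * ‖p.2 y‖ ^ 4))) =
    (∫ φ : Cfg P j N, weight C η w c m2 (0 : VecField P j ℝ) φ *
        (Real.exp (-(lam * ((∑ y : Site P j, w * ‖φ y‖ ^ 4) + 1 / 2 * δ₁ * massForm w φ))) *
          (⟪φ x, EuclideanSpace.basisFun (Fin N) ℝ a⟫_ℝ * ⟪φ x', EuclideanSpace.basisFun (Fin N) ℝ b⟫_ℝ))) /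
      ∫ φ : Cfg P j N, weight C η w c m2 (0 : VecField P j ℝ) φ *
        (Real.exp (-(lam * ((∑ y : Site P j, w * ‖φ y‖ ^ 4) + 1 / 2 * δ₁ * massForm w φ))) * 1) := by
  rw [integral_J_zero_mul C η w c (m2 + lam * δ₁) μ2
      (fun φ => Real.exp (-(lam * ∑ y : Site P j, w * ‖φ y‖ ^ 4)) * legs a b x x' φ),
    integral_J_zero_mul C η w c (m2 + lam * δ₁) μ2 (fun φ => Real.exp (-(lam * ∑ y : Site P j, w * ‖φ y‖ ^ 4)))]
  have hK : (∫ A : Cfg P j P.d, WA η w c μ2 A * (1 : ℝ)) ≠ 0 := by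
    simp only [mul_one]
    exact (B3WT226Traces.Z_pos (P := P) (j := j) (Cvec P.d) η w c μ2 hw hμ).ne'
  rw [mul_div_mul_left _ _ hK]
  congr 1
  · refine integral_congr_ae (Eventually.of_forall fun φ => ?_)
    dsimp only
    rw [← mul_assoc (weight C η w c m2 _ φ), weight_mul_exp_massCurve, mul_assoc]
    rfl
  · refine integral_congr_ae (Eventually.of_forall fun φ => ?_)
    dsimp only
    rw [← mul_assoc (weight C η w c m2 _ φ), weight_mul_exp_massCurve, mul_assoc, mul_one]


/-! ## §15 (v1.3) THE ORDER «`λ` FIRST»: the right `λ`-derivative of the joint family AT EVERY CHARGE (one-sided dominated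
differentiation with the joint weight `e^{−S^ε_e}`), and — for counterterms affine in `λ` — the `e`-derivative at `0` of
`e ↦ ∂_λ∣_{0⁺}G^{ct}_{e,λ}` EXISTS and VANISHES -/

omit C η w c m2 μ2 in
/-- `∣e^{−t} − 1∣ ≤ t` for `t ≥ 0`. [folklore] -/
private theorem abs_exp_neg_sub_one_le {t : ℝ} (ht : 0 ≤ t) : |Real.exp (-t) - 1| ≤ t := by
  have h1 : Real.exp (-t) ≤ 1 := Real.exp_le_one_iff.mpr (by linarith)
  have h2 : 1 - t ≤ Real.exp (-t) := by linarith [Real.add_one_le_exp (-t)]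
  rw [abs_sub_comm, abs_of_nonneg (by linarith)]
  linarith

/-- **ONE-SIDED DIFFERENTIATION IN `λ` UNDER THE JOINT INTEGRAL `∫dA dφ e^{−S^ε_e}`, AT EVERY CHARGE `e`**: for observables `V ≥ 0`, `F`
of the scalar field of exponential-linear growth, `λ ↦ ∫dA dφ e^{−S^ε_e}e^{−λV}F` (`λ ≥ 0`) has right-derivative `−∫dA dφ e^{−S^ε_e}VF`
at `λ = 0⁺` — BRICK 1's dominated convergence on the difference quotients (`∣(e^{−λV} − 1)/λ∣ ≤ V`) with the joint weight of
(1.19)–(1.20) in place of the scalar Gaussian (integrability: BRICK 7's `integrable_J_mul`).  The first-order perturbation theory in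
`λ` of (1.21) at charge `e`. [cite: Balaban1983Higgs3, (1.19)–(1.21) p.416] [cite: GlimmJaffeQP1987, §8.4–8.5] -/
theorem hasDerivWithinAt_integral_J_exp_neg (hw : 0 < w) (hm : 0 < m2) (hμ : 0 < μ2) {V F : Cfg P j N → ℝ}
    (hV : ExpGrowth V) (hV0 : ∀ φ, 0 ≤ V φ) (hF : ExpGrowth F) (e : ℝ) :
    HasDerivWithinAt (fun lam : ℝ => ∫ p : JCfg P j N, J C η w c m2 μ2 e p * (Real.exp (-(lam * V p.2)) * F p.2))
      (-(∫ p : JCfg P j N, J C η w c m2 μ2 e p * (V p.2 * F p.2))) (Set.Ici 0) 0 := by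
  have hWF : Integrable (fun p : JCfg P j N => J C η w c m2 μ2 e p * F p.2) := integrable_J_mul C η w c m2 μ2 hw hm hμ hF e
  have hWVF : Integrable (fun p : JCfg P j N => J C η w c m2 μ2 e p * (V p.2 * F p.2)) :=
    integrable_J_mul C η w c m2 μ2 hw hm hμ (hV.mul hF) e
  have hVc : Continuous fun p : JCfg P j N => V p.2 := hV.1.comp continuous_snd
  -- integrability of the integrand for `λ ≥ 0` (a bounded continuous factor times `J·F`)
  have hIlam : ∀ lam : ℝ, 0 ≤ lam →
      Integrable (fun p : JCfg P j N => J C η w c m2 μ2 e p * (Real.exp (-(lam * V p.2)) * F p.2)) := by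
    intro lam hlam
    have hmeas : AEStronglyMeasurable (fun p : JCfg P j N => Real.exp (-(lam * V p.2))) volume :=
      (Real.continuous_exp.comp ((continuous_const.mul hVc).neg)).aestronglyMeasurable
    have hb := hWF.bdd_mul (c := 1) hmeas (Filter.Eventually.of_forall fun p => by
      rw [Real.norm_eq_abs, abs_of_pos (Real.exp_pos _)]
      exact Real.exp_le_one_iff.mpr (by nlinarith [hV0 p.2]))
    refine hb.congr (Filter.Eventually.of_forall fun p => ?_)
    show Real.exp (-(lam * V p.2)) * (J C η w c m2 μ2 e p * F p.2) = J C η w c m2 μ2 e p * (Real.exp (-(lam * V p.2)) * F p.2)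
    ring
  have hI : Set.Ici (0 : ℝ) \ {0} = Set.Ioi 0 := by
    ext t
    simp only [Set.mem_sdiff, Set.mem_Ici, Set.mem_singleton_iff, Set.mem_Ioi]
    exact ⟨fun h => lt_of_le_of_ne h.1 (Ne.symm h.2), fun h => ⟨h.le, h.ne'⟩⟩
  rw [hasDerivWithinAt_iff_tendsto_slope, hI]
  -- the difference quotients as integrals
  have hslope : ∀ lam : ℝ, 0 < lam →
      slope (fun lam : ℝ => ∫ p : JCfg P j N, J C η w c m2 μ2 e p * (Real.exp (-(lam * V p.2)) * F p.2)) 0 lam =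
        ∫ p : JCfg P j N, J C η w c m2 μ2 e p * (F p.2 * ((Real.exp (-(lam * V p.2)) - 1) / lam)) := by
    intro lam hlam
    rw [slope_def_field, sub_zero]
    have e0 : (fun p : JCfg P j N => J C η w c m2 μ2 e p * (Real.exp (-(0 * V p.2)) * F p.2)) =
        fun p => J C η w c m2 μ2 e p * F p.2 := by
      funext p; rw [zero_mul, neg_zero, Real.exp_zero, one_mul]
    simp only [e0]
    rw [← integral_sub (hIlam lam hlam.le) hWF, ← integral_div]
    refine integral_congr_ae (Filter.Eventually.of_forall fun p => ?_)
    show (J C η w c m2 μ2 e p * (Real.exp (-(lam * V p.2)) * F p.2) - J C η w c m2 μ2 e p * F p.2) / lam =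
      J C η w c m2 μ2 e p * (F p.2 * ((Real.exp (-(lam * V p.2)) - 1) / lam))
    field_simp
  have hev : (fun lam => ∫ p : JCfg P j N, J C η w c m2 μ2 e p * (F p.2 * ((Real.exp (-(lam * V p.2)) - 1) / lam)))
      =ᶠ[𝓝[Set.Ioi (0 : ℝ)] 0]
      slope (fun lam : ℝ => ∫ p : JCfg P j N, J C η w c m2 μ2 e p * (Real.exp (-(lam * V p.2)) * F p.2)) 0 :=
    eventually_nhdsWithin_of_forall fun lam hlam => (hslope lam hlam).symm
  refine Filter.Tendsto.congr' hev ?_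
  -- dominated convergence
  have hlim : (-(∫ p : JCfg P j N, J C η w c m2 μ2 e p * (V p.2 * F p.2))) =
      ∫ p : JCfg P j N, J C η w c m2 μ2 e p * (F p.2 * (-V p.2)) := by
    rw [← integral_neg]
    exact integral_congr_ae (Filter.Eventually.of_forall fun p => by ring)
  rw [hlim]
  refine tendsto_integral_filter_of_dominated_convergence (fun p => ‖J C η w c m2 μ2 e p * (V p.2 * F p.2)‖) ?_ ?_
    hWVF.norm ?_
  · refine eventually_nhdsWithin_of_forall fun lam hlam => ?_
    exact ((hWF.aestronglyMeasurable).mul (((Real.continuous_exp.comp ((continuous_const.mul hVc).neg)).sub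
      continuous_const).div_const lam).aestronglyMeasurable).congr (Filter.Eventually.of_forall fun p => by
        show J C η w c m2 μ2 e p * F p.2 * ((Real.exp (-(lam * V p.2)) - 1) / lam) =
          J C η w c m2 μ2 e p * (F p.2 * ((Real.exp (-(lam * V p.2)) - 1) / lam))
        ring)
  · refine eventually_nhdsWithin_of_forall fun lam (hlam : 0 < lam) => Filter.Eventually.of_forall fun p => ?_
    have hq : |(Real.exp (-(lam * V p.2)) - 1) / lam| ≤ |V p.2| := by
      rw [abs_div, abs_of_pos hlam, div_le_iff₀ hlam, abs_of_nonneg (hV0 p.2)]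
      have := abs_exp_neg_sub_one_le (t := lam * V p.2) (by nlinarith [hV0 p.2])
      linarith [mul_comm lam (V p.2)]
    rw [Real.norm_eq_abs, Real.norm_eq_abs, abs_mul, abs_mul, abs_mul, abs_mul]
    have hWn : 0 ≤ |J C η w c m2 μ2 e p| := abs_nonneg _
    calc |J C η w c m2 μ2 e p| * (|F p.2| * |(Real.exp (-(lam * V p.2)) - 1) / lam|)
        ≤ |J C η w c m2 μ2 e p| * (|F p.2| * |V p.2|) :=
          mul_le_mul_of_nonneg_left (mul_le_mul_of_nonneg_left hq (abs_nonneg _)) hWn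
      _ = |J C η w c m2 μ2 e p| * (|V p.2| * |F p.2|) := by ring
  · refine Filter.Eventually.of_forall fun p => ?_
    have hd : HasDerivAt (fun lam : ℝ => Real.exp (-(lam * V p.2))) (-V p.2) 0 := by
      have h1 : HasDerivAt (fun lam : ℝ => -(lam * V p.2)) (-(1 * V p.2)) 0 := ((hasDerivAt_id 0).mul_const (V p.2)).neg
      have h2 : HasDerivAt (fun lam : ℝ => Real.exp (-(lam * V p.2))) (Real.exp (-(0 * V p.2)) * -(1 * V p.2)) 0 :=
        h1.exp
      simpa using h2
    have ht : Tendsto (slope (fun lam : ℝ => Real.exp (-(lam * V p.2))) 0) (𝓝[Set.Ioi (0:ℝ)] 0) (𝓝 (-V p.2)) := by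
      have h := hasDerivAt_iff_tendsto_slope.mp hd
      exact h.mono_left (nhdsWithin_mono _ fun t (ht : 0 < t) => ne_of_gt ht)
    have ht' : Tendsto (fun lam : ℝ => (Real.exp (-(lam * V p.2)) - 1) / lam) (𝓝[Set.Ioi (0:ℝ)] 0) (𝓝 (-V p.2)) := by
      refine ht.congr' (eventually_nhdsWithin_of_forall fun lam hlam => ?_)
      rw [slope_def_field, sub_zero, zero_mul, neg_zero, Real.exp_zero]
    exact (ht'.const_mul (F p.2)).const_mul (J C η w c m2 μ2 e p)

/-- **… FOR INTERACTIONS BOUNDED BELOW**, `V ≥ −K` (the quartic interaction shifted by the counterterm's mass term,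
`Σ_yη^d(∣φ∣⁴ + ½δ∣φ∣²) ≥ −∣T∣η^dδ²/16`): the same right-derivative `−∫dA dφ e^{−S^ε_e}VF` at `λ = 0⁺` (factor `e^{λK}`).
[cite: Balaban1983Higgs3, (1.19)–(1.21) p.416] [cite: GlimmJaffeQP1987, §8.4–8.5] -/
theorem hasDerivWithinAt_integral_J_exp_neg_of_le (hw : 0 < w) (hm : 0 < m2) (hμ : 0 < μ2) {V F : Cfg P j N → ℝ}
    (hV : ExpGrowth V) {K : ℝ} (hVK : ∀ φ, -K ≤ V φ) (hF : ExpGrowth F) (e : ℝ) :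
    HasDerivWithinAt (fun lam : ℝ => ∫ p : JCfg P j N, J C η w c m2 μ2 e p * (Real.exp (-(lam * V p.2)) * F p.2))
      (-(∫ p : JCfg P j N, J C η w c m2 μ2 e p * (V p.2 * F p.2))) (Set.Ici 0) 0 := by
  have hV' : ExpGrowth (fun φ : Cfg P j N => V φ + K) := hV.add (ExpGrowth.const K)
  have hV'0 : ∀ φ : Cfg P j N, 0 ≤ V φ + K := fun φ => by linarith [hVK φ]
  have h := hasDerivWithinAt_integral_J_exp_neg C η w c m2 μ2 hw hm hμ hV' hV'0 hF e
  have hWF : Integrable (fun p : JCfg P j N => J C η w c m2 μ2 e p * F p.2) := integrable_J_mul C η w c m2 μ2 hw hm hμ hF e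
  have hWVF : Integrable (fun p : JCfg P j N => J C η w c m2 μ2 e p * (V p.2 * F p.2)) :=
    integrable_J_mul C η w c m2 μ2 hw hm hμ (hV.mul hF) e
  have hexp : HasDerivWithinAt (fun lam : ℝ => Real.exp (lam * K)) K (Set.Ici 0) 0 := by
    have h1 : HasDerivAt (fun lam : ℝ => lam * K) K 0 := hasDerivAt_mul_const K
    have h2 := h1.exp
    simp only [zero_mul, Real.exp_zero, one_mul] at h2
    exact h2.hasDerivWithinAt
  have hfun : (fun lam : ℝ => ∫ p : JCfg P j N, J C η w c m2 μ2 e p * (Real.exp (-(lam * V p.2)) * F p.2))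
      = fun lam => Real.exp (lam * K) *
          ∫ p : JCfg P j N, J C η w c m2 μ2 e p * (Real.exp (-(lam * (V p.2 + K))) * F p.2) := by
    funext lam
    rw [← integral_const_mul]
    refine integral_congr_ae (Filter.Eventually.of_forall fun p => ?_)
    show J C η w c m2 μ2 e p * (Real.exp (-(lam * V p.2)) * F p.2)
        = Real.exp (lam * K) * (J C η w c m2 μ2 e p * (Real.exp (-(lam * (V p.2 + K))) * F p.2))
    have e1 : Real.exp (-(lam * V p.2)) = Real.exp (lam * K) * Real.exp (-(lam * (V p.2 + K))) := by
      rw [← Real.exp_add]; congr 1; ring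
    rw [e1]; ring
  rw [hfun]
  refine (hexp.mul h).congr_deriv ?_
  simp only [zero_mul, neg_zero, Real.exp_zero, one_mul]
  have hsplit : (∫ p : JCfg P j N, J C η w c m2 μ2 e p * ((V p.2 + K) * F p.2)) =
      (∫ p : JCfg P j N, J C η w c m2 μ2 e p * (V p.2 * F p.2)) + K * ∫ p : JCfg P j N, J C η w c m2 μ2 e p * F p.2 := by
    have hKWF : Integrable (fun p : JCfg P j N => K * (J C η w c m2 μ2 e p * F p.2)) := hWF.const_mul K
    rw [← integral_const_mul, ← integral_add hWVF hKWF]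
    refine integral_congr_ae (Filter.Eventually.of_forall fun p => ?_)
    show J C η w c m2 μ2 e p * ((V p.2 + K) * F p.2) = J C η w c m2 μ2 e p * (V p.2 * F p.2) + K * (J C η w c m2 μ2 e p * F p.2)
    ring
  rw [hsplit]
  ring

/-- the joint weight along a counterterm AFFINE in `λ`: `e^{−S^ε_e}∣_{m²+c₀+λc₁}·e^{−λV}F = e^{−S^ε_e}∣_{m²+c₀}·e^{−λ(V+½c₁Σ_yη^d∣φ(y)∣²)}F`
(the `λc₁` part of the counterterm joins the interaction, `weight_mass_add`). [cite: Balaban1983Higgs3, (1.20) p.416, (1.23) p.417] -/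
theorem J_affine_mul_exp (c₀ c₁ lam e : ℝ) (V F : Cfg P j N → ℝ) (p : JCfg P j N) :
    J C η w c (m2 + (c₀ + lam * c₁)) μ2 e p * (Real.exp (-(lam * V p.2)) * F p.2) =
      J C η w c (m2 + c₀) μ2 e p * (Real.exp (-(lam * (V p.2 + 1 / 2 * c₁ * massForm w p.2))) * F p.2) := by
  rw [show m2 + (c₀ + lam * c₁) = (m2 + c₀) + lam * c₁ by ring, J_mass_add C η w c (m2 + c₀) μ2 (lam * c₁) e p, mul_assoc]
  congr 1
  rw [← mul_assoc, ← Real.exp_add]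
  congr 2
  ring

/-- **THE RIGHT `λ`-DERIVATIVE AT `λ = 0⁺` OF THE JOINT FAMILY, AT EVERY CHARGE `e`**, for a counterterm affine in `λ`,
`δm² = c₀ + λc₁` with `m² + c₀ > 0` (print's series at fixed `e` truncated at weight `3`: `c₀ = Σ_αe^αδm²_{(α,0)}`,
`c₁ = Σ_αe^αδm²_{(α,1)}`): `∂_λ∣_{0⁺}G^{ct}_{e,λ,ab}(x,x′) = (N′Z − NZ′)/Z²` with `N′ = −∫e^{−S^ε_e}(V + ½c₁Σ∣φ∣²)φ_aφ_b`,
`Z′ = −∫e^{−S^ε_e}(V + ½c₁Σ∣φ∣²)`, all at mass `m² + c₀` — first-order perturbation theory in `λ` AT CHARGE `e` with the letters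
`Σ^ε∣_λ` and `−δm²∣_λ`. [cite: Balaban1983Higgs3, (1.19)–(1.21) p.416, (1.23) p.417] -/
theorem hasDerivWithinAt_twoPtJoint_affine (hw : 0 < w) (hμ : 0 < μ2) {c₀ : ℝ} (hM : 0 < m2 + c₀) (c₁ e : ℝ) (a b : Fin N)
    (x x' : Site P j) :
    HasDerivWithinAt (fun lam : ℝ =>
        (∫ p : JCfg P j N, J C η w c (m2 + (c₀ + lam * c₁)) μ2 e p *
            (Real.exp (-(lam * ∑ y : Site P j, w * ‖p.2 y‖ ^ 4)) * legs a b x x' p.2)) /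
          (∫ p : JCfg P j N, J C η w c (m2 + (c₀ + lam * c₁)) μ2 e p *
            Real.exp (-(lam * ∑ y : Site P j, w * ‖p.2 y‖ ^ 4))))
      (((-(∫ p : JCfg P j N, J C η w c (m2 + c₀) μ2 e p *
              (((∑ y : Site P j, w * ‖p.2 y‖ ^ 4) + 1 / 2 * c₁ * massForm w p.2) * legs a b x x' p.2))) *
            (∫ p : JCfg P j N, J C η w c (m2 + c₀) μ2 e p * (1 : ℝ))
          - (∫ p : JCfg P j N, J C η w c (m2 + c₀) μ2 e p * legs a b x x' p.2) *
            (-(∫ p : JCfg P j N, J C η w c (m2 + c₀) μ2 e p *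
              (((∑ y : Site P j, w * ‖p.2 y‖ ^ 4) + 1 / 2 * c₁ * massForm w p.2) * 1)))) /
        (∫ p : JCfg P j N, J C η w c (m2 + c₀) μ2 e p * (1 : ℝ)) ^ 2)
      (Set.Ici 0) 0 := by
  have hV : ExpGrowth (fun φ : Cfg P j N => (∑ y : Site P j, w * ‖φ y‖ ^ 4) + 1 / 2 * c₁ * massForm w φ) :=
    (B3Eq122FirstOrderWick.expGrowth_V w).add ((expGrowth_massForm (P := P) (j := j) (N := N) w).const_mul (1 / 2 * c₁))
  have hVK := neg_le_V_massCurve (P := P) (j := j) (N := N) w hw.le c₁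
  have hN := hasDerivWithinAt_integral_J_exp_neg_of_le C η w c (m2 + c₀) μ2 hw hM hμ hV hVK (expGrowth_legs a b x x') e
  have hZ := hasDerivWithinAt_integral_J_exp_neg_of_le C η w c (m2 + c₀) μ2 hw hM hμ hV hVK (ExpGrowth.const (1 : ℝ)) e
  have hfun : (fun lam : ℝ =>
        (∫ p : JCfg P j N, J C η w c (m2 + (c₀ + lam * c₁)) μ2 e p *
            (Real.exp (-(lam * ∑ y : Site P j, w * ‖p.2 y‖ ^ 4)) * legs a b x x' p.2)) /
          (∫ p : JCfg P j N, J C η w c (m2 + (c₀ + lam * c₁)) μ2 e p *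
            Real.exp (-(lam * ∑ y : Site P j, w * ‖p.2 y‖ ^ 4)))) =
      fun lam : ℝ =>
        (∫ p : JCfg P j N, J C η w c (m2 + c₀) μ2 e p *
            (Real.exp (-(lam * ((∑ y : Site P j, w * ‖p.2 y‖ ^ 4) + 1 / 2 * c₁ * massForm w p.2))) *
              legs a b x x' p.2)) /
          (∫ p : JCfg P j N, J C η w c (m2 + c₀) μ2 e p *
            (Real.exp (-(lam * ((∑ y : Site P j, w * ‖p.2 y‖ ^ 4) + 1 / 2 * c₁ * massForm w p.2))) * 1)) := by
    funext lam
    congr 1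
    · exact integral_congr_ae (Eventually.of_forall fun p =>
        J_affine_mul_exp C η w c m2 μ2 c₀ c₁ lam e (fun φ => ∑ y : Site P j, w * ‖φ y‖ ^ 4) (legs a b x x') p)
    · refine integral_congr_ae (Eventually.of_forall fun p => ?_)
      have h := J_affine_mul_exp C η w c m2 μ2 c₀ c₁ lam e (fun φ => ∑ y : Site P j, w * ‖φ y‖ ^ 4) (fun _ => (1 : ℝ)) p
      simp only [mul_one] at h ⊢
      exact h
  rw [hfun]
  have h0 : (∫ p : JCfg P j N, J C η w c (m2 + c₀) μ2 e p *
      (Real.exp (-(0 * ((∑ y : Site P j, w * ‖p.2 y‖ ^ 4) + 1 / 2 * c₁ * massForm w p.2))) * 1)) ≠ 0 := by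
    simp only [zero_mul, neg_zero, Real.exp_zero, mul_one]
    exact (integral_J_pos C η w c (m2 + c₀) μ2 hw hM hμ e).ne'
  refine (hN.div hZ h0).congr_deriv ?_
  simp only [zero_mul, neg_zero, Real.exp_zero, one_mul]

omit C η w c m2 μ2 in
/-- the quotient-rule combination is differentiable when its six integrals and the coefficient are. [folklore] -/
private theorem differentiableAt_quotientComb {IVl Iml I1 Il IV Im c₁ : ℝ → ℝ} (hIVl : DifferentiableAt ℝ IVl 0)
    (hIml : DifferentiableAt ℝ Iml 0) (hI1 : DifferentiableAt ℝ I1 0) (hIl : DifferentiableAt ℝ Il 0)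
    (hIV : DifferentiableAt ℝ IV 0) (hIm : DifferentiableAt ℝ Im 0) (hc₁ : DifferentiableAt ℝ c₁ 0) (h1 : I1 0 ≠ 0) :
    DifferentiableAt ℝ (fun e =>
      ((-(IVl e + 1 / 2 * c₁ e * Iml e)) * I1 e - Il e * (-(IV e + 1 / 2 * c₁ e * Im e))) / I1 e ^ 2) 0 := by
  have h2 : I1 0 ^ 2 ≠ 0 := pow_ne_zero 2 h1
  refine DifferentiableAt.div ?_ (hI1.pow 2) h2
  exact (((hIVl.add (((differentiableAt_const _).mul hc₁).mul hIml)).neg.mul hI1).sub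
    (hIl.mul ((hIV.add (((differentiableAt_const _).mul hc₁).mul hIm)).neg)))

/-- **PRINT'S INDEX `(1,1)` IN THE ORDER «`λ` FIRST», NON-VACUOUSLY**: for a counterterm `δm²(e,λ) = c₀(e) + λc₁(e)` affine in `λ`
with `c₀`, `c₁` even, `c₀ ∈ C¹` near `0`, `c₀(0) = 0`, `c₁` differentiable at `0` (print's series (1.23) truncated at weight `3`:
`c₀ = δm²_{(2,0)}e² + δm²_{(3,0)}e³ + …` even iff `δm²_{(3,0)} = 0`, `c₁ = δm²_{(0,1)} + δm²_{(1,1)}e + δm²_{(2,1)}e²` even iff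
`δm²_{(1,1)} = 0`), the function `e ↦ ∂_λ∣_{0⁺}G^{ct}_{e,λ,ab}(x,x′)` — which near `e = 0` IS the explicit first-order formula of
`hasDerivWithinAt_twoPtJoint_affine` — is differentiable at `e = 0` (§4's dominated differentiation of its six integrals) with
derivative `0` (the reflection `A ↦ −A`, §13): the `λ¹e¹` Taylor coefficient of (1.19) exists in this order too and vanishes —
consistent with `δm²_{(1,1)} = 0` (the 1PI letter `Σ^ε_{(1,1)}` is not extracted here). [cite: Balaban1983Higgs3, (1.19)–(1.21) p.416, (1.23) p.417] -/
theorem hasDerivAt_derivWithin_twoPtJoint_affine (hw : 0 < w) (hm : 0 < m2) (hμ : 0 < μ2) {c₀ c₀' c₁ : ℝ → ℝ}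
    (hd₀ : ∀ e, HasDerivAt c₀ (c₀' e) e) (hc₀' : ContinuousAt c₀' 0) (h₀ : c₀ 0 = 0) (hc₁ : DifferentiableAt ℝ c₁ 0)
    (hev₀ : ∀ e, c₀ (-e) = c₀ e) (hev₁ : ∀ e, c₁ (-e) = c₁ e) (a b : Fin N) (x x' : Site P j) :
    HasDerivAt (fun e => derivWithin (fun lam : ℝ =>
        (∫ p : JCfg P j N, J C η w c (m2 + (c₀ e + lam * c₁ e)) μ2 e p *
            (Real.exp (-(lam * ∑ y : Site P j, w * ‖p.2 y‖ ^ 4)) * legs a b x x' p.2)) /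
          (∫ p : JCfg P j N, J C η w c (m2 + (c₀ e + lam * c₁ e)) μ2 e p *
            Real.exp (-(lam * ∑ y : Site P j, w * ‖p.2 y‖ ^ 4)))) (Set.Ici 0) 0) 0 0 := by
  obtain ⟨r, B, hr, hct, hct'⟩ := exists_ball_bounds₁ (m2 := m2) hm hd₀ hc₀' h₀
  have hr0 : |(0:ℝ)| < r := by rwa [abs_zero]
  have hM : ∀ e, |e| < r → 0 < m2 + c₀ e := fun e he => mass_pos_of_abs_le m2 hm (hct e he)
  have hV4 := B3Eq122FirstOrderWick.expGrowth_V (P := P) (j := j) (N := N) w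
  have hmf := expGrowth_massForm (P := P) (j := j) (N := N) w
  have hlegs := expGrowth_legs (P := P) (j := j) (N := N) a b x x'
  -- on the ball, `∂_λ∣_{0⁺}` is the explicit first-order formula
  have hD : ∀ e, |e| < r → derivWithin (fun lam : ℝ =>
        (∫ p : JCfg P j N, J C η w c (m2 + (c₀ e + lam * c₁ e)) μ2 e p *
            (Real.exp (-(lam * ∑ y : Site P j, w * ‖p.2 y‖ ^ 4)) * legs a b x x' p.2)) /
          (∫ p : JCfg P j N, J C η w c (m2 + (c₀ e + lam * c₁ e)) μ2 e p *
            Real.exp (-(lam * ∑ y : Site P j, w * ‖p.2 y‖ ^ 4)))) (Set.Ici 0) 0 =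
      ((-(∫ p : JCfg P j N, J C η w c (m2 + c₀ e) μ2 e p *
              (((∑ y : Site P j, w * ‖p.2 y‖ ^ 4) + 1 / 2 * c₁ e * massForm w p.2) * legs a b x x' p.2))) *
            (∫ p : JCfg P j N, J C η w c (m2 + c₀ e) μ2 e p * (1 : ℝ))
          - (∫ p : JCfg P j N, J C η w c (m2 + c₀ e) μ2 e p * legs a b x x' p.2) *
            (-(∫ p : JCfg P j N, J C η w c (m2 + c₀ e) μ2 e p *
              (((∑ y : Site P j, w * ‖p.2 y‖ ^ 4) + 1 / 2 * c₁ e * massForm w p.2) * 1)))) /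
        (∫ p : JCfg P j N, J C η w c (m2 + c₀ e) μ2 e p * (1 : ℝ)) ^ 2 := fun e he =>
    (hasDerivWithinAt_twoPtJoint_affine C η w c m2 μ2 hw hμ (hM e he) (c₁ e) e a b x x').derivWithin
      (uniqueDiffOn_Ici (0 : ℝ) 0 Set.self_mem_Ici)
  -- the mass-type vertex splits off the `e`-dependent coefficient `½c₁(e)`
  have hsplit : ∀ {F : Cfg P j N → ℝ}, ExpGrowth F → ∀ e, |e| < r →
      (∫ p : JCfg P j N, J C η w c (m2 + c₀ e) μ2 e p *
          (((∑ y : Site P j, w * ‖p.2 y‖ ^ 4) + 1 / 2 * c₁ e * massForm w p.2) * F p.2)) =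
        (∫ p : JCfg P j N, J C η w c (m2 + c₀ e) μ2 e p * ((∑ y : Site P j, w * ‖p.2 y‖ ^ 4) * F p.2)) +
          1 / 2 * c₁ e * ∫ p : JCfg P j N, J C η w c (m2 + c₀ e) μ2 e p * (massForm w p.2 * F p.2) := by
    intro F hF e he
    rw [← integral_const_mul, ← integral_add (integrable_J_mul C η w c (m2 + c₀ e) μ2 hw (hM e he) hμ (hV4.mul hF) e)
      ((integrable_J_mul C η w c (m2 + c₀ e) μ2 hw (hM e he) hμ (hmf.mul hF) e).const_mul _)]
    exact integral_congr_ae (Eventually.of_forall fun p => by ring)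
  -- differentiability in `e` at `0` of the six integrals (§4)
  have hI : ∀ {F : Cfg P j N → ℝ}, ExpGrowth F →
      DifferentiableAt ℝ (fun e => ∫ p : JCfg P j N, J C η w c (m2 + c₀ e) μ2 e p * F p.2) 0 := fun hF =>
    (hasDerivAt_integral_J_massCurve C η w c m2 μ2 hw hm hμ hF (fun e _ => hd₀ e) hct hct' hr0).2.differentiableAt
  have hZ0 : (∫ p : JCfg P j N, J C η w c (m2 + c₀ 0) μ2 0 p * (1 : ℝ)) ≠ 0 := by
    simp only [mul_one]
    exact (integral_J_pos C η w c (m2 + c₀ 0) μ2 hw (hM 0 hr0) hμ 0).ne'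
  have hcomb := differentiableAt_quotientComb (hI (hV4.mul hlegs)) (hI (hmf.mul hlegs)) (hI (ExpGrowth.const (1 : ℝ)))
    (hI hlegs) (hI (hV4.mul (ExpGrowth.const (1 : ℝ)))) (hI (hmf.mul (ExpGrowth.const (1 : ℝ)))) hc₁ hZ0
  have hev : (fun e => derivWithin (fun lam : ℝ =>
        (∫ p : JCfg P j N, J C η w c (m2 + (c₀ e + lam * c₁ e)) μ2 e p *
            (Real.exp (-(lam * ∑ y : Site P j, w * ‖p.2 y‖ ^ 4)) * legs a b x x' p.2)) /
          (∫ p : JCfg P j N, J C η w c (m2 + (c₀ e + lam * c₁ e)) μ2 e p *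
            Real.exp (-(lam * ∑ y : Site P j, w * ‖p.2 y‖ ^ 4)))) (Set.Ici 0) 0) =ᶠ[𝓝 (0:ℝ)]
      (fun e => ((-((∫ p : JCfg P j N, J C η w c (m2 + c₀ e) μ2 e p *
                ((∑ y : Site P j, w * ‖p.2 y‖ ^ 4) * legs a b x x' p.2)) +
              1 / 2 * c₁ e * ∫ p : JCfg P j N, J C η w c (m2 + c₀ e) μ2 e p * (massForm w p.2 * legs a b x x' p.2))) *
            (∫ p : JCfg P j N, J C η w c (m2 + c₀ e) μ2 e p * (1 : ℝ))
          - (∫ p : JCfg P j N, J C η w c (m2 + c₀ e) μ2 e p * legs a b x x' p.2) *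
            (-((∫ p : JCfg P j N, J C η w c (m2 + c₀ e) μ2 e p * ((∑ y : Site P j, w * ‖p.2 y‖ ^ 4) * 1)) +
              1 / 2 * c₁ e * ∫ p : JCfg P j N, J C η w c (m2 + c₀ e) μ2 e p * (massForm w p.2 * 1)))) /
        (∫ p : JCfg P j N, J C η w c (m2 + c₀ e) μ2 e p * (1 : ℝ)) ^ 2) := by
    filter_upwards [ball_mem_nhds_of_abs_lt hr0] with e he
    have he' := abs_lt_of_mem_ball he
    rw [hD e he', hsplit hlegs e he', hsplit (ExpGrowth.const (1 : ℝ)) e he']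
  have hdiff : DifferentiableAt ℝ (fun e => derivWithin (fun lam : ℝ =>
        (∫ p : JCfg P j N, J C η w c (m2 + (c₀ e + lam * c₁ e)) μ2 e p *
            (Real.exp (-(lam * ∑ y : Site P j, w * ‖p.2 y‖ ^ 4)) * legs a b x x' p.2)) /
          (∫ p : JCfg P j N, J C η w c (m2 + (c₀ e + lam * c₁ e)) μ2 e p *
            Real.exp (-(lam * ∑ y : Site P j, w * ‖p.2 y‖ ^ 4)))) (Set.Ici 0) 0) 0 :=
    hcomb.congr_of_eventuallyEq hev
  -- the derivative is `0` by the reflection symmetry (§13)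
  have key := (iteratedDeriv_odd_twoPtJoint_massCurve C η w c m2 μ2 (ct := fun e lam => c₀ e + lam * c₁ e)
    (fun e l => by rw [hev₀, hev₁]) a b x x' 0).2
  rw [Nat.mul_zero, Nat.zero_add, iteratedDeriv_one] at key
  exact hdiff.hasDerivAt.congr_deriv key

omit C η w c m2 μ2 in
/-- the even polynomial `δ₂e² + δ₄e⁴` and its derivative. [folklore] -/
private theorem hasDerivAt_evenSeries (δ₂ δ₄ e : ℝ) :
    HasDerivAt (fun s : ℝ => δ₂ * s ^ 2 + δ₄ * s ^ 4) (δ₂ * (2 * e) + δ₄ * (4 * e ^ 3)) e := by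
  have h : HasDerivAt (fun s : ℝ => δ₂ * s ^ 2 + δ₄ * s ^ 4)
      (δ₂ * ((2 : ℕ) * e ^ (2 - 1)) + δ₄ * ((4 : ℕ) * e ^ (4 - 1))) e :=
    ((hasDerivAt_pow 2 e).const_mul δ₂).add ((hasDerivAt_pow 4 e).const_mul δ₄)
  refine h.congr_deriv ?_
  norm_num

/-- **… FOR PRINT'S SERIES (1.23) TRUNCATED AT WEIGHT `3`** (r15's `dm2Of123 e λ ε^d Σ^ε` with `δm²_{(3,0)} = δm²_{(1,1)} = 0` — the
weight-3 coefficients, which §13 shows must vanish for the symmetric insertion — and the weight-4 `λ²` coefficient `δm²_{(0,2)}` switched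
off, so that the inserted counterterm `δm²_{(2,0)}e² + δm²_{(4,0)}e⁴ + λ(δm²_{(0,1)} + δm²_{(2,1)}e²)` is affine in `λ`):
`e ↦ ∂_λ∣_{0⁺}G^{δm²}_{e,λ,ab}(x,x′)` is differentiable at `e = 0` with derivative `0`. [cite: Balaban1983Higgs3, (1.23) p.417] -/
theorem hasDerivAt_derivWithin_twoPtJoint_dm2Of123 (hw : 0 < w) (hm : 0 < m2) (hμ : 0 < μ2) {X : Type*} [Fintype X]
    (epsd : ℝ) (S : ℕ → ℕ → X → ℝ) (h30 : B3Sect1TwoPoint.dm2Coeff epsd S 3 0 = 0)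
    (h11 : B3Sect1TwoPoint.dm2Coeff epsd S 1 1 = 0) (h02 : B3Sect1TwoPoint.dm2Coeff epsd S 0 2 = 0) (a b : Fin N)
    (x x' : Site P j) :
    HasDerivAt (fun e => derivWithin (fun lam : ℝ =>
        (∫ p : JCfg P j N, J C η w c (m2 + B3Sect1TwoPoint.dm2Of123 e lam epsd S) μ2 e p *
            (Real.exp (-(lam * ∑ y : Site P j, w * ‖p.2 y‖ ^ 4)) * legs a b x x' p.2)) /
          (∫ p : JCfg P j N, J C η w c (m2 + B3Sect1TwoPoint.dm2Of123 e lam epsd S) μ2 e p *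
            Real.exp (-(lam * ∑ y : Site P j, w * ‖p.2 y‖ ^ 4)))) (Set.Ici 0) 0) 0 0 := by
  have hser : ∀ e lam : ℝ, B3Sect1TwoPoint.dm2Of123 e lam epsd S =
      (B3Sect1TwoPoint.dm2Coeff epsd S 2 0 * e ^ 2 + B3Sect1TwoPoint.dm2Coeff epsd S 4 0 * e ^ 4) +
        lam * (B3Sect1TwoPoint.dm2Coeff epsd S 0 1 + B3Sect1TwoPoint.dm2Coeff epsd S 2 1 * e ^ 2) := by
    intro e lam
    simp [B3Sect1TwoPoint.dm2Of123, B3Sect1TwoPoint.idx123_eq, h30, h11, h02]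
    ring
  simp_rw [hser]
  exact hasDerivAt_derivWithin_twoPtJoint_affine C η w c m2 μ2 hw hm hμ
    (c₀ := fun e => B3Sect1TwoPoint.dm2Coeff epsd S 2 0 * e ^ 2 + B3Sect1TwoPoint.dm2Coeff epsd S 4 0 * e ^ 4)
    (c₀' := fun e => B3Sect1TwoPoint.dm2Coeff epsd S 2 0 * (2 * e) + B3Sect1TwoPoint.dm2Coeff epsd S 4 0 * (4 * e ^ 3))
    (c₁ := fun e => B3Sect1TwoPoint.dm2Coeff epsd S 0 1 + B3Sect1TwoPoint.dm2Coeff epsd S 2 1 * e ^ 2)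
    (fun e => hasDerivAt_evenSeries _ _ e) (by fun_prop) (by simp) (by fun_prop) (fun e => by ring) (fun e => by ring)
    a b x x'

end Literature.MathematicalPhysics.QuantumFieldTheory.Balaban1983to89.B3Eq123RenormalizationConditions
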